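import Literature.InformationTheory.Entanglement.TwoCopySwapPurity
import Literature.Computability.QuantumComplexity.CertificationSampleComplexity
import Literature.InformationTheory.Entanglement.CollectiveSpinVarianceBound
import Mathlib.Analysis.SpecialFunctions.Complex.CircleAddChar
import Mathlib.NumberTheory.LegendreSymbol.AddCharacter
import HarnessLib

/-!
# Mutually unbiased bases are complex projective 2-designs (Klappenecker–Rötteler 2005)

Topic `Literature/Computability/QuantumComplexity` — companion of `DesignAnticoncentration.lean`, whose
`IsStateTwoDesign` (Zhu–Kueng–Grassl–Gross, Proposition 1 statement 2 at `t = 2`) is the hypothesis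
of three results already in the tree: anticoncentration of exact state 2-designs
(`IsStateTwoDesign.anticoncentration`, Hangleiter–Bermejo-Vega–Schwarz–Eisert 2018 Theorem 5), the
certification sample-complexity lower bound `CertificationSampleComplexity.twoDesign_certification_lower_bound`
(Hangleiter–Kliesch–Eisert–Gogolin 2019 Theorem 7b) and the collective-spin QFI average
`CollectiveSpinVarianceBound.twoDesign_avg_qfi`.  Until this file the predicate was witnessed only by
the six one-qubit stabilizer states (`stabilizerQubit_isStateTwoDesign`, a 16-entry computation).
This file proves the two standard SUPPLY theorems for 2-designs — complete sets of mutually unbiased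
bases and SIC-POVMs — through the frame-potential (Welch-bound) criterion, and instantiates them:
every odd prime dimension `p` (Ivanović / Wootters–Fields quadratic-phase bases, `p(p+1)` vectors),
`d = 4` (two qubits, Klappenecker–Rötteler's Example 2, 20 vectors), `d = 2`, and (v2) EVERY
prime-power dimension: for qubits `N = 2ⁿ` the `2ⁿ + 1` stabilizer MUBs of
Bandyopadhyay–Boykin–Roychowdhury–Vatan's Theorem 4.4 (explicit `ℤ/4`-phase eigenvectors) built from the
trace-form symmetric spread of `𝔽_{2ⁿ}` (Mathlib's `GaloisField 2 n`), plus their explicit examples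
`d = 4` and `d = 8`; for odd `p` the `pⁿ + 1` Wootters–Fields bases of `ℂ^{pⁿ}` (`ω_p`-phases) from the
same spread of `𝔽_{pⁿ}`; v2 also adds Welch's bound for `k = 1` / Klappenecker–Rötteler Theorem 3
(1-designs = uniform tight frames), and closes the loop with `CertificationSampleComplexity.lean`:
Hangleiter–Kliesch–Eisert–Gogolin's Theorem 7b holds for the n-qubit stabilizer-MUB ensemble with NO
unproved input (Valiant–Valiant's Theorem 2 is a theorem of the tree for its output distributions —
point masses and the uniform distribution on `𝔽₂ⁿ`); v3 adds invariance under relabelling the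
computational basis and, through `CollectiveSpinVarianceBound.lean`, that the “Haar random value”
`F_Q^Haar = 4n·2ⁿ/(2ⁿ+1)` of the collective-spin QFI is attained exactly by the stabilizer-MUB ensemble.

HONEST FRAMING (pub-qadeq lane, CLAIMS §5: the ‘2-design ⇒ anticoncentration’ premise of the RCS /
IQP hardness language of rows E-01…E-10, E-16 and the ‘flat outputs cannot be certified from samples’
sentence behind Theorem 7b): instance-level adjudication of specific advantage claims; no claim about
BQP vs BPP or the summit.  This file is finite-dimensional linear algebra about explicit vector
families; it asserts nothing about any circuit family, device or classical cost, and it does NOT prove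
that random circuits, Clifford circuits or IQP circuits form a design.

## Source statements [cite: KlappeneckerRoetteler2005]

A. Klappenecker, M. Rötteler, *Mutually unbiased bases are complex projective 2-designs*, Proc. ISIT
2005, 1740–1744 = arXiv:quant-ph/0502031 (held text `paper:arxiv-quant-ph_0502031`, read in full by
the seat 2026-08-23):

* §2 Definition 1: “Two orthonormal bases `B` and `C` of `ℂ^d` are called mutually unbiased iff
  `|⟨b|c⟩|² = 1/d` holds for all `b ∈ B` and `c ∈ C`.”
* §2 Construction I (Wootters and Fields): “Let `q` be an odd prime power. Define
  `|v_{a,b}⟩ = q^{−1/2} (ω_p^{tr(ax²+bx)})_{x∈𝔽_q} ∈ ℂ^q`, with `ω_p = exp(2πi/p)`. Then the standard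
  basis together with the bases `B_a = {|v_{a,b}⟩ | b ∈ 𝔽_q}`, `a ∈ 𝔽_q`, form a set of `q+1` mutually
  unbiased bases of `ℂ^q`.”
* §2 Example 2: “In dimension `d = 4` Construction II yields the bases
  ½{(+,+,+,+), (+,+,−,−), (+,−,−,+), (+,−,+,−)}, ½{(+,−,−i,−i), (+,−,i,i), (+,+,i,−i), (+,+,−i,i)},
  ½{(+,−i,−i,−), (+,−i,i,+), (+,i,i,−), (+,i,−i,+)}, ½{(+,−i,−,−i), (+,−i,+,i), (+,i,+,−i), (+,i,−,i)}.
  These four bases and the standard basis `𝟙₄` form an extremal set of five MUBs in `ℂ⁴`.”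
* §3 eq. (1) (Welch [welch74]): “`(1/|X|²) Σ_{x,y∈X} |⟨x|y⟩|^{2k} ≥ 1/binom(d+k−1, k)`.”
* §4 Theorem 2: “Suppose that `X` is a finite nonempty subset of `ℂS^{d−1}`. Then the following
  statements are equivalent: 1) The set `X` is a `t`-design in `ℂS^{d−1}`; … 3) the set `X` satisfies
  the Welch bounds (1) with equality for all `k` in the range `0 ≤ k ≤ t`.”  Proof of 3) ⇒ 1): the
  vector `ξ = (1/|X|) Σ_x x^{⊗k} ⊗ x̄^{⊗k} − ∫ x^{⊗k} ⊗ x̄^{⊗k} dμ(x)` has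
  `⟨ξ,ξ⟩ = (1/|X|²) Σ_{x,y} |⟨x|y⟩|^{2k} − ∫∫ |⟨x|y⟩|^{2k} ≥ 0` (eq. (5)).
* §3: “A set `X` attaining the Welch bound (1) for `k = 1` is called a WBE-sequence set … the union of
  `d+1` mutually unbiased bases of `ℂ^d` form a WBE-sequence set.”  §5 Theorem 3: “Let `F` be a finite
  nonempty subset of vectors in `ℂ^d`. The following statements about `F` are equivalent: 1) `F` is a
  uniform tight frame; 2) `F` is a WBE-sequence set; 3) `F` is a 1-design in `ℂS^{d−1}`.” (“The frame
  constants of a uniform tight frame `F` in `ℂ^d` are given by `A = B = |F|/d`.”)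
* §6 Theorem 4: “The union `X` of `d+1` mutually unbiased bases in `ℂ^d` forms a 2-design in
  `ℂS^{d−1}` with angle set `{0, 1/d}` and `d(d+1)` elements.”  Proof: “for `k = 2`,
  `(1/(d²(d+1)²)) Σ_{x,y∈X} |⟨x|y⟩|⁴ = (d(d+1)/(d²(d+1)²)) (1 + (d−1)·0 + d²·(1/d²)) = 2/(d(d+1))`,
  and this coincides with `binom(d+2−1, 2)⁻¹`.”
* §7 Theorem 6 (SIC-POVMs are 2-designs [RBSC:2004]): “Let `X` be a SIC-POVM in dimension `d`”
  (“systems of `d²` vectors in `ℂ^d` … `|⟨v, w⟩|² = 1/(d+1)` for all `v, w` in the set”). “Then `X`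
  forms a 2-design in `ℂS^{d−1}` with angle set `{1/(d+1)}` and `d²` elements.”  Proof:
  `(1/d⁴)(d²·1 + (d⁴ − d²)/(d+1)²) = 2/(d(d+1))`.
* §1: “A simple example is provided by the Pauli spin matrices `σ_x, σ_y, σ_z`.”

## Source statements [cite: ZhuEtAl2016]

H. Zhu, R. Kueng, M. Grassl, D. Gross, *The Clifford group fails gracefully to be a unitary 4-design*,
arXiv:1609.08172, §2.1 (held text `paper:arxiv-1609.08172`, p. 5):

* eq. (3): “The `t`th frame potential of `{ψ_j}` is defined by `Φ_t({ψ_j}) := (1/K²) Σ_{j,k} |⟨ψ_j|ψ_k⟩|^{2t}`.”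
* Proposition 1: “The following statements are equivalent: (1) `{ψ_j}` is a `t`-design.
  (2) `(1/K) Σ_j (|ψ_j⟩⟨ψ_j|)^{⊗t} = P_[t]/D_[t]`, where `K = |{ψ_j}|`. (3) `Φ_t({ψ_j}) = 1/D_[t]`.”
  Remark 1: “In general, `Φ_t({ψ_j}) ≥ 1/D_[t]`, and the lower bound is saturated iff `{ψ_j}` is a
  `t`-design.”  Proof of (2) ⇔ (3): “`‖(1/K) Σ_j (|ψ_j⟩⟨ψ_j|)^{⊗t} − P_[t]/D_[t]‖₂² = Φ_t({ψ_j}) − 1/D_[t]`,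
  where `‖·‖₂` denotes the Hilbert-Schmidt norm or the Frobenius norm.”
* “Another interesting example of 2-designs are complete sets of mutually unbiased bases (MUB)
  [Ivan81, WootF89, KlapR05M, DurtEBZ10].”

## Source statements [cite: BandyopadhyayEtAl2002]

S. Bandyopadhyay, P. O. Boykin, V. Roychowdhury, F. Vatan, *A new proof for the existence of mutually
unbiased bases*, Algorithmica **34** (2002) 512–528 = arXiv:quant-ph/0103162 (held text
`paper:arxiv-quant-ph_0103162`, §3–§4 read 2026-08-23):

* Theorem 4.4: “Let `{A_1,…,A_ℓ}` be a set of symmetric `m×m` matrices over `𝔽_p` such that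
  `det(A_j − A_k) ≠ 0`, for every `1 ≤ j < k ≤ ℓ`. Then there is a set of `ℓ+1` mutually unbiased bases
  on `ℂ^{p^m}`. More specifically, the `ℓ+1` bases of the above theorem are represented by the matrices
  `(0_m|𝟙_m), (𝟙_m|A_1), …, (𝟙_m|A_ℓ)`.” (Lemma 4.3: the class `(𝟙|A)` “is a set of commuting operators
  if and only if `A` is symmetric”.)
* §4.2 Example `d = 4`: “The four matrices (over `𝔽₂`) … `(0 0;0 0), (1 0;0 1), (0 1;1 1), (1 1;1 0)`”;
  Example `d = 8`: “The following eight `3×3` matrices determine a set 9 mutually unbiased bases on `ℂ⁸`.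
  Let `A_1 = 0_3`, `A_2 = 𝟙_3`, and `A_3 = (0 1 0;1 1 1;0 1 1)`, …, `A_8 = (1 1 1;1 1 0;1 0 0)`.”
* §4.3: “to construct `p^m+1` mutually unbiased bases in `ℂ^{p^m}`, we only need to find `m` symmetric
  nonsingular matrices `B_1,…,B_m` such that the matrix `Σ_j b_jB_j` is also nonsingular, for every nonzero
  vector `(b_1,…,b_m) ∈ 𝔽_p^m` … Wootters and Fields have found the following general construction for
  the matrices `B_1,…,B_m`. Let `γ_1,…,γ_m` be a basis of `𝔽_{p^m}` … `γ_iγ_j = Σ_ℓ b^ℓ_{ij} γ_ℓ`.”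
* The stabilizer normal form used for the explicit eigenvectors: amplitudes `i^{l(x)}(−1)^{q(x)}` with
  `l` linear and `q` quadratic over GF(2) [cite: DehaeneDemoor2003, Theorem 5].

Original sources of the constructions, cited by both papers: [cite: Ivanovic1981] (the `p + 1`
complementary observables in prime dimension), [cite: WoottersFields1989] (prime powers),
[cite: Welch1974] (the bound), [cite: RenesEtAl2004] (SIC-POVMs are 2-designs).

## What is formalised (all proved; 0 named facts, no `sorry`)

With the tree's `proj ψ = |ψ⟩⟨ψ|`, `swapOp V = F`, `IsStateTwoDesign` (DesignAnticoncentration) and the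
swap-trick lemmas of `TwoCopySwapPurity` (`Tr(F(A⊗B)) = Tr(AB)`, `F² = 1`, `F† = F`):

* `braket φ ψ = ⟨φ|ψ⟩`, `overlapSq φ ψ = |⟨φ|ψ⟩|²`, `framePotential₂ ψ = Φ₂` (eq. (3), `t = 2`);
  `avgTensorTwo`, `symTarget` (the two sides of the design identity), `deviation` (their difference).
* **`frobeniusSq_deviation_eq`** — the Frobenius identity of the proof of Proposition 1 at `t = 2`,
  `Σ_{pq} |deviation_{pq}|² = Φ₂ − 2/(N(N+1))`, from `Tr(MM) = Σ|⟨ψ_j|ψ_k⟩|⁴`, `Tr(M(𝟙+F)) = 2K`,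
  `Tr(𝟙+F)² = 2N(N+1)` (`M = Σ_j (|ψ_j⟩⟨ψ_j|)^{⊗2}`).
* **`welch_bound_two`** — Welch's bound for `k = 2` / Remark 1: `Φ₂ ≥ 2/(N(N+1))`.
* **`isStateTwoDesign_iff_framePotential₂`** — Proposition 1 (2) ⇔ (3) at `t = 2`
  (= Klappenecker–Rötteler Theorem 2 (1) ⇔ (3) for `t = 2`, the design being DEFINED by statement 2);
  `isStateTwoDesign_of_framePotential₂`.
* **`IsMUBFamily B`** — Definition 1 for a family of bases `B : ι → κ → ℂ^V` (`|κ| = N`, each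
  orthonormal, distinct ones unbiased); `IsMUBFamily.sum_overlapSq_sq` (row sums `= 2`),
  `.framePotential₂_eq`, **`IsMUBFamily.isStateTwoDesign`** = Theorem 4 (`|ι| = N + 1`), and the
  corollaries `.anticoncentration` (Hangleiter et al. 2018 Theorem 5 for MUB ensembles) and
  `.avg_collisionProb` (`Z = 2/(N+1)`).
* **`IsSIC ψ`** and **`IsSIC.isStateTwoDesign`** = Theorem 6.
* Construction I for `q = p` an odd PRIME (`𝔽_p = ZMod p`, `ω_p^k = ZMod.stdAddChar k`):
  `wfVec p a b`, `stdVec`, `wfMUB p : Option (ZMod p) → ZMod p → ℂ^p`; `braket_wfVec`,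
  **`normSq_quadGaussSum`** (`|Σ_x ω^{ax²+bx}|² = p` for `a ≠ 0`, by completing the square),
  `braket_wfVec_same`, `overlapSq_stdVec_wfVec`, `overlapSq_wfVec`, **`wfMUB_isMUBFamily`** (`p ≠ 2`)
  and **`wfMUB_isStateTwoDesign`**: a 2-design of `p(p+1)` vectors in `ℂ^p` for every odd prime `p`.
  (Prime POWERS `pⁿ`, odd and even, are the v2 sections below; KR05's own Construction II through
  Galois rings GR(4,n) is not transcribed — the qubit bases below are built from `𝔽_{2ⁿ}` instead.)
  -- TODO(general form): `t`-designs for `t > 2` and the converse Theorem 5 (2-designs with angle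
  -- set {0,1/d} are MUBs) are not formalised.
* Example 2: **`twoQubitMUB`** (`Fin 5 → Fin 4 → ℂ⁴`, transcribed verbatim), `twoQubitMUB_isMUBFamily`
  (orthonormality and the 160 cross angles `= 1/4` by computation), **`twoQubitMUB_isStateTwoDesign`**.
* §1: `qubitMUB` (eigenbases of `σ_z, σ_x, σ_y`), `qubitMUB_isMUBFamily`, `qubitMUB_isStateTwoDesign`.
* v2 — Welch `k = 1` / **Klappenecker–Rötteler Theorem 3** (uniform tight frames ⇔ WBE-sequence sets ⇔
  1-designs, operator form `(1/K)Σ_j|ψ_j⟩⟨ψ_j| = 𝟙/N`): `framePotential₁`, `avgProj`, `IsStateOneDesign`,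
  `frobeniusSq_avgProj_sub_eq` (the Frobenius identity at `t = 1`), **`welch_bound_one`**,
  **`isStateOneDesign_iff_framePotential₁`**, `IsMUBFamily.sum_overlapSq` (row sums `d + 1`),
  `IsMUBFamily.framePotential₁_eq`, **`IsMUBFamily.isStateOneDesign`** (the pooled `d+1` bases resolve
  the identity: `Σ_{i,a}|B_i a⟩⟨B_i a| = (d+1)𝟙`), `IsSIC.sum_overlapSq`, `IsSIC.framePotential₁_eq`,
  **`IsSIC.isStateOneDesign`** (the SIC elements `(1/d)|ψ_j⟩⟨ψ_j|` form a POVM).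
* v2 — **qubit dimensions `N = 2ⁿ` (BBRV Theorem 4.4 for `p = 2`, explicit eigenbases)**: `Bits n = 𝔽₂ⁿ`,
  `quadExp M x = xᵀMx` (integer lift), `sgnVec c x = (−1)^{c·x}`, `iPow`, **`quadVec M c`**
  (`x ↦ 2^{−n/2} i^{xᵀMx}(−1)^{c·x}`), `basisVec`, `liftMat`, **`IsSymmSpread A`** (section SymmSpread:
  symmetric matrices over a commutative ring — `𝔽_p` in the source — with nonsingular differences, the
  hypothesis of Theorem 4.4), **`spreadMUB A`**; plumbing (character orthogonality `sum_sgnVec`,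
  completing the square `quadExp_add`, `intCast_bilin`); **`normSq_quadGaussSum₂`** (the `ℤ/4` quadratic
  Gauss sum `|Σ_x i^{xᵀMx}(−1)^{c·x}|² = 2ⁿ` for `M mod 2` nonsingular); `braket_quadVec`,
  `braket_quadVec_same`, `overlapSq_basisVec_quadVec`, `overlapSq_quadVec`; BBRV's operators
  `weyl₂ α β` (`X(α)Z(β)|a⟩ = (−1)^{a·β}|a+α⟩`) with **`weyl₂_mulVec_quadVec`** (the `v_{Ã,c}` are the common
  eigenvectors of the class `(𝟙|A)`) and `weyl₂_zero_mulVec_basisVec` (class `(0|𝟙)`); **`spreadMUB_isMUBFamily`**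
  (Theorem 4.4) and **`spreadMUB_isStateTwoDesign`** (`|ι| = 2ⁿ` ⇒ 2-design of `2ⁿ(2ⁿ+1)` vectors);
  BBRV's examples `bbrvSpread₂` / `bbrvSpread₃` (`IsSymmSpread` by `decide`) with
  **`bbrvSpread₂_isStateTwoDesign`** (two qubits) and **`bbrvSpread₃_isStateTwoDesign`** (three qubits,
  72 states); and the general case **`traceSpread p n hn`** (section SymmSpread: `A_λ = (tr(λγ_iγ_j))` over
  Mathlib's `GaloisField p n`, any prime `p`), **`traceSpread_isSymmSpread`** (via `traceForm_nondegenerate`),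
  **`traceSpread_isMUBFamily`** (`2ⁿ + 1` MUBs of `ℂ^{2ⁿ}` for every `n ≥ 1`) and
  **`traceSpread_isStateTwoDesign`** (a 2-design of `2ⁿ(2ⁿ+1)` n-qubit stabilizer states for every `n ≥ 1`).
  NOT formalised: BBRV's Theorem 3.2 route (unbiasedness FROM the eigenbasis property) as such — the
  eigen-relations are proved, but unbiasedness is obtained directly from the Gauss sums; the Clifford
  group and stabilizer formalism in the group-theoretic sense are not developed.
* v2 — **odd prime powers `N = pⁿ` (BBRV Theorem 4.4 for odd `p`; Wootters–Fields)**: `Digits p n = 𝔽_pⁿ`,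
  **`oddQuadVec p A c`** (`x ↦ p^{−n/2} ω_p^{xᵀAx + c·x}`), **`oddSpreadMUB p A`**; `stdAddChar_sum`,
  `sum_stdAddChar_dotProduct` (character orthogonality on `𝔽_pⁿ`), `quadOdd_add` (completing the square),
  **`normSq_quadGaussSum_odd`** (`|Σ_x ω_p^{xᵀMx + c·x}|² = pⁿ` for `M` symmetric nonsingular, `p` odd),
  `braket_oddQuadVec`, `braket_oddQuadVec_same`, `overlapSq_basisVec_oddQuadVec`, `overlapSq_oddQuadVec`,
  `weylOdd α β` with **`weylOdd_mulVec_oddQuadVec`** (the `v_{A,c}` are the common eigenvectors of the class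
  `(𝟙|2A)`; `A ↦ 2A` permutes symmetric spreads) and `weylOdd_zero_mulVec_basisVec`;
  **`oddSpreadMUB_isMUBFamily`** (Theorem 4.4, `p` odd) and **`oddSpreadMUB_isStateTwoDesign`**
  (`|ι| = pⁿ`), **`traceSpread_isMUBFamily_odd`** (`pⁿ + 1` MUBs of `ℂ^{pⁿ}`, every odd prime `p`, `n ≥ 1`)
  and **`traceSpread_isStateTwoDesign_odd`** (a 2-design of `pⁿ(pⁿ+1)` vectors in `ℂ^{pⁿ}`).  Together with
  the qubit section: a complete set of `N + 1` MUBs, hence a 2-design of `N(N+1)` vectors, in EVERY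
  prime-power dimension `N`.
* v2 — **certification (section Certification, importing `CertificationSampleComplexity`)**:
  `vvLowerBoundAt_flatOn_singleton` (Theorem 2's bound for a point mass, `c₂ = 1/8`, from
  `certification_needs_inv_eps`), `designDist_spreadMUB_none` / `designDist_spreadMUB_some` (output
  distributions of the spread MUB states: point masses / uniform on `𝔽₂ⁿ`),
  **`spreadMUB_certification_lower_bound`** and **`traceSpread_certification_lower_bound`** — HKEG
  Theorem 7b (`twoDesign_certification_lower_bound`, `c₂ = 1/8`, `0 < ε ≤ 1/2`) for the `2ⁿ(2ⁿ+1)` n-qubit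
  stabilizer-MUB states with the `VVLowerBoundAt` hypothesis DISCHARGED (`vvLowerBoundAt_flatOn` for the
  uniform outputs, the singleton lemma for the standard basis): at most a `δ`-fraction of them admit an
  `ε`-certification test from fewer than `(1/8)·2^{n/4}(δ/2)^{1/4}(1 − 2ε − 2^{−n/2}(δ/2)^{−1/2})^{3/2}/ε²`
  samples.  (Odd `pⁿ`: section CertificationOdd below, v4.)
* v3 — **relabelling and the Haar QFI value (section Relabel, importing `CollectiveSpinVarianceBound`)**:
  `braket_comp_equiv`, `overlapSq_comp_equiv`, **`IsMUBFamily.comp_equiv`** (MUB families are invariant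
  under `V ≃ W`), `spreadMUB_isStateTwoDesign_comp_equiv` (the qubit designs on any labelling, e.g. the
  register `Fin n → Bool`), and **`traceSpread_avg_qfi_collectiveZ`**: for every `n ≥ 1` and every
  relabelling `e : 𝔽₂ⁿ ≃ (Fin n → Bool)`, the mean of `4(⟨ψ|J²|ψ⟩ − ⟨ψ|J|ψ⟩²)` (`J = Σ_i Ẑ_i`) over the
  `2ⁿ(2ⁿ+1)` stabilizer-MUB states is EXACTLY `4n·2ⁿ/(2ⁿ+1)` = `F_Q^Haar`
  (`CollectiveSpinVarianceBound.twoDesign_avg_qfi_collectiveZ`, Nagao et al. Fig. 4).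
* v4 — **certification for odd prime powers (section CertificationOdd)**: `designDist_oddSpreadMUB_none` /
  `designDist_oddSpreadMUB_some` (point mass / uniform on `𝔽_pⁿ`), **`oddSpreadMUB_certification_lower_bound`**
  and **`traceSpread_certification_lower_bound_odd`** — HKEG Theorem 7b hypothesis-free for the
  `pⁿ(pⁿ+1)` Wootters–Fields MUB states, `p` odd, every `n ≥ 1` (Theorem 2's input from
  `CertificationSampleComplexity.vvLowerBoundAt_flatOn_two_le`, flat targets of every support size).
-/

noncomputable section

open Finset Matrix
open scoped Kronecker ComplexConjugate
open Literature.Computability.QuantumComplexity.DesignAnticoncentration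
open Literature.InformationTheory.Entanglement.TwoCopy

namespace Literature.Computability.QuantumComplexity.MutuallyUnbiasedBases

variable {V : Type*} [Fintype V] [DecidableEq V]
variable {J : Type*} [Fintype J]

/-! ### Overlaps and the frame potential -/

/-- The inner product `⟨φ|ψ⟩ = Σ_a φ̄_a ψ_a` of two vectors of `ℂ^V` (linear in the second slot).
[cite: KlappeneckerRoetteler2005, §1 (“|⟨b|b'⟩|² = 1/d”)] -/
def braket (φ ψ : V → ℂ) : ℂ := star φ ⬝ᵥ ψ

/-- The squared overlap `|⟨φ|ψ⟩|²` (the “angle” `(cos θ_{xy})²` of the pair).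
[cite: KlappeneckerRoetteler2005, §4 (“α_{xy} := (cos θ_{xy})²”) and §6 (“angle set A = {|⟨x|y⟩|² : x ≠ y}”)] -/
def overlapSq (φ ψ : V → ℂ) : ℝ := Complex.normSq (braket φ ψ)

/-- The second frame potential `Φ₂({ψ_j}) = (1/K²) Σ_{j,k} |⟨ψ_j|ψ_k⟩|⁴` of a finite family of
`K = |J|` vectors — the left-hand side of Welch's bound for `k = 2`.
[cite: ZhuEtAl2016, §2.1 eq. (3) (“Φ_t({ψ_j}) := (1/K²) Σ_{j,k} |⟨ψ_j|ψ_k⟩|^{2t}”)]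
[cite: KlappeneckerRoetteler2005, §3 eq. (1) (left-hand side, k = 2)] -/
def framePotential₂ (ψ : J → V → ℂ) : ℝ :=
  ((Fintype.card J : ℝ) ^ 2)⁻¹ * ∑ j, ∑ k, overlapSq (ψ j) (ψ k) ^ 2

omit [DecidableEq V] in
/-- `⟨φ|φ⟩ = Σ_a |φ_a|²`. [cite: KlappeneckerRoetteler2005, §3 (“vectors of unit norm”)] -/
theorem braket_self (φ : V → ℂ) : braket φ φ = ((∑ a, Complex.normSq (φ a) : ℝ) : ℂ) := by
  unfold braket
  rw [dotProduct]
  push_cast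
  refine sum_congr rfl fun a _ => ?_
  rw [Pi.star_apply, Complex.star_def, Complex.normSq_eq_conj_mul_self]

omit [DecidableEq V] in
/-- Unit vectors in the two spellings: `Σ_a |φ_a|² = 1 ↔ ⟨φ|φ⟩ = 1`. [cite: KlappeneckerRoetteler2005, §3 (“vectors of unit norm”)] -/
theorem braket_self_eq_one_iff (φ : V → ℂ) :
    braket φ φ = 1 ↔ ∑ a, Complex.normSq (φ a) = 1 := by
  rw [braket_self]
  exact_mod_cast Iff.rfl

omit [DecidableEq V] in
/-- `⟨ψ|φ⟩ = conj ⟨φ|ψ⟩`. [cite: KlappeneckerRoetteler2005, §4 (the angle is symmetric in x, y)] -/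
theorem braket_comm (φ ψ : V → ℂ) : braket ψ φ = conj (braket φ ψ) := by
  unfold braket
  rw [← Complex.star_def, star_dotProduct]

omit [DecidableEq V] in
/-- The angle is symmetric: `|⟨ψ|φ⟩|² = |⟨φ|ψ⟩|²`. [cite: KlappeneckerRoetteler2005, §4 (definition of θ_{xy})] -/
theorem overlapSq_comm (φ ψ : V → ℂ) : overlapSq ψ φ = overlapSq φ ψ := by
  unfold overlapSq
  rw [braket_comm, Complex.normSq_conj]

omit [DecidableEq V] in
/-- `|⟨φ|φ⟩|² = 1` for a unit vector. [cite: KlappeneckerRoetteler2005, §6 proof of Theorem 4 (the diagonal terms “1”)] -/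
theorem overlapSq_self {φ : V → ℂ} (h : ∑ a, Complex.normSq (φ a) = 1) : overlapSq φ φ = 1 := by
  unfold overlapSq
  rw [(braket_self_eq_one_iff φ).2 h, map_one]

omit [DecidableEq V] in
/-- `0 ≤ |⟨φ|ψ⟩|²`. [cite: KlappeneckerRoetteler2005, §4 (“0 ≤ θ_{xy} ≤ π/2”)] -/
theorem overlapSq_nonneg (φ ψ : V → ℂ) : 0 ≤ overlapSq φ ψ := Complex.normSq_nonneg _

/-! ### Trace identities for `|ψ⟩⟨ψ|` and its tensor square -/

omit [DecidableEq V] in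
/-- `Tr |φ⟩⟨φ| = ⟨φ|φ⟩`. [cite: ZhuEtAl2016, §2.1 proof of Proposition 1 (“p_A(ψ) := tr[A (|ψ⟩⟨ψ|)^{⊗t}]”)] -/
theorem trace_proj (φ : V → ℂ) : (proj φ).trace = braket φ φ := by
  rw [proj, trace_vecMulVec, braket, dotProduct_comm]

omit [DecidableEq V] in
/-- `Tr(|α⟩⟨α| |β⟩⟨β|) = |⟨α|β⟩|²`. [cite: KlappeneckerRoetteler2005, §4 proof of Theorem 2 (“⟨x^{⊗k}|y^{⊗k}⟩ = ⟨x|y⟩^k”, k = 1)] -/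
theorem trace_proj_mul_proj_eq (α β : V → ℂ) : (proj α * proj β).trace = (overlapSq α β : ℂ) := by
  rw [trace_proj_mul_proj, overlapSq, braket]
  generalize star α ⬝ᵥ β = z
  rw [Complex.star_def, Complex.mul_conj]

omit [DecidableEq V] in
/-- `Tr((|α⟩⟨α|)^{⊗2} (|β⟩⟨β|)^{⊗2}) = |⟨α|β⟩|⁴`. [cite: KlappeneckerRoetteler2005, §4 proof of Theorem 2 (“⟨x^{⊗k}|y^{⊗k}⟩ = ⟨x|y⟩^k”, k = 2)] -/
theorem trace_projTwo_mul_projTwo (α β : V → ℂ) :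
    ((proj α ⊗ₖ proj α) * (proj β ⊗ₖ proj β)).trace = ((overlapSq α β ^ 2 : ℝ) : ℂ) := by
  rw [← mul_kronecker_mul, trace_kronecker, trace_proj_mul_proj_eq]
  push_cast; ring

/-- `Tr F = N` on `ℂ^V ⊗ ℂ^V`. [cite: ZhuEtAl2016, §2.1 (“D_[t] = binom(d+t−1, t)”, via Tr P_[2] = (N² + N)/2)] -/
theorem trace_swapOp : (swapOp V).trace = (Fintype.card V : ℂ) := by
  simp only [Matrix.trace, Matrix.diag, swapOp_apply]
  rw [Fintype.sum_prod_type]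
  have h : ∀ x y : V, (x = y ∧ y = x) ↔ x = y := fun x y => ⟨fun h => h.1, fun h => ⟨h, h.symm⟩⟩
  simp only [h, Finset.sum_ite_eq, Finset.mem_univ, if_true, Finset.sum_const, Finset.card_univ,
    nsmul_eq_mul, mul_one]

/-- `Tr (𝟙 + F)² = 2N(N+1)` (`= 4·Tr P_[2] = 4 D_[2]`). [cite: ZhuEtAl2016, §2.1 (“D_[t] = binom(d+t−1, t)”, t = 2)] -/
theorem trace_onePlusSwap_sq :
    (((1 : Matrix (V × V) (V × V) ℂ) + swapOp V) * (1 + swapOp V)).trace =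
      2 * (Fintype.card V : ℂ) * (Fintype.card V + 1) := by
  simp only [add_mul, mul_add, one_mul, mul_one, swapOp_mul_swapOp, trace_add, trace_one, trace_swapOp,
    Fintype.card_prod]
  push_cast; ring

/-! ### The averaged tensor square, the target `P_[2]/D_[2]`, and the deviation operator -/

/-- `(1/K) Σ_j (|ψ_j⟩⟨ψ_j|)^{⊗2}` — the left side of the design identity.
[cite: ZhuEtAl2016, Proposition 1, statement 2] -/
def avgTensorTwo (ψ : J → V → ℂ) : Matrix (V × V) (V × V) ℂ :=
  ((Fintype.card J : ℂ))⁻¹ • ∑ j, proj (ψ j) ⊗ₖ proj (ψ j)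

/-- `P_[2]/D_[2] = (𝟙 + F)/(N(N+1))` — the right side of the design identity.
[cite: ZhuEtAl2016, Proposition 1, statement 2 (“P_[t]/D_[t]”, t = 2)] -/
def symTarget (V : Type*) [Fintype V] [DecidableEq V] : Matrix (V × V) (V × V) ℂ :=
  (((Fintype.card V : ℂ)) * (Fintype.card V + 1))⁻¹ • ((1 : Matrix (V × V) (V × V) ℂ) + swapOp V)

/-- The deviation operator `(1/K) Σ_j (|ψ_j⟩⟨ψ_j|)^{⊗2} − P_[2]/D_[2]`.
[cite: ZhuEtAl2016, §2.1 proof of Proposition 1 (“‖(1/K)Σ_j (|ψ_j⟩⟨ψ_j|)^{⊗t} − P_[t]/D_[t]‖₂²”) and eq. (7)] -/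
def deviation (ψ : J → V → ℂ) : Matrix (V × V) (V × V) ℂ := avgTensorTwo ψ - symTarget V

/-- The design identity is exactly `deviation = 0`. [cite: ZhuEtAl2016, Proposition 1 (2 ⇔ 3, “the lower bound is saturated iff eq. (tdesignSum) is satisfied”)] -/
theorem isStateTwoDesign_iff_deviation_eq_zero (ψ : J → V → ℂ) :
    IsStateTwoDesign ψ ↔ (∀ j, ∑ a, Complex.normSq (ψ j a) = 1) ∧ deviation ψ = 0 := by
  rw [deviation, sub_eq_zero, avgTensorTwo, symTarget]
  exact ⟨fun h => ⟨h.norm_sq, h.tensor_two⟩, fun h => ⟨h.1, h.2⟩⟩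

/-! ### Frobenius norm plumbing -/

/-- `Tr(A†A) = Σ_{p,q} |A_{pq}|²`. [cite: ZhuEtAl2016, §2.1 (“‖·‖₂ denotes the Hilbert-Schmidt norm or the Frobenius norm”)] -/
private theorem trace_conjTranspose_mul_self {ι : Type*} [Fintype ι] (A : Matrix ι ι ℂ) :
    (Aᴴ * A).trace = ((∑ p, ∑ q, Complex.normSq (A p q) : ℝ) : ℂ) := by
  simp only [Matrix.trace, Matrix.diag, Matrix.mul_apply, Matrix.conjTranspose_apply]
  push_cast
  rw [Finset.sum_comm]
  refine sum_congr rfl fun p _ => sum_congr rfl fun q _ => ?_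
  rw [Complex.star_def, Complex.normSq_eq_conj_mul_self]

/-- A matrix with vanishing Frobenius norm is zero. [cite: ZhuEtAl2016, §2.1 proof of Proposition 1 (“the lower bound is saturated iff …”)] -/
private theorem eq_zero_of_sum_normSq_eq_zero {ι : Type*} [Fintype ι] (A : Matrix ι ι ℂ)
    (h : ∑ p, ∑ q, Complex.normSq (A p q) = 0) : A = 0 := by
  ext p q
  have hp := (sum_eq_zero_iff_of_nonneg (fun p _ => sum_nonneg fun q _ => Complex.normSq_nonneg (A p q))).1
    h p (mem_univ _)
  have hq := (sum_eq_zero_iff_of_nonneg (fun q _ => Complex.normSq_nonneg (A p q))).1 hp q (mem_univ _)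
  exact Complex.normSq_eq_zero.1 hq

omit [Fintype V] [DecidableEq V] in
/-- `|ψ⟩⟨ψ|` is Hermitian. [cite: ZhuEtAl2016, §2.1 (projectors |ψ_j⟩⟨ψ_j|)] -/
private theorem conjTranspose_proj (φ : V → ℂ) : (proj φ)ᴴ = proj φ := by
  rw [proj, conjTranspose_vecMulVec, star_star]

/-- The deviation operator is Hermitian. [cite: ZhuEtAl2016, §2.1 eq. (7) (the deviation operator)] -/
private theorem conjTranspose_deviation (ψ : J → V → ℂ) : (deviation ψ)ᴴ = deviation ψ := by
  unfold deviation avgTensorTwo symTarget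
  rw [conjTranspose_sub, conjTranspose_smul, conjTranspose_smul, conjTranspose_sum, conjTranspose_add,
    conjTranspose_one, conjTranspose_swapOp]
  simp_rw [conjTranspose_kronecker, conjTranspose_proj]
  congr 2
  · rw [star_inv₀, star_natCast]
  · rw [star_inv₀, star_mul', star_add, star_one, star_natCast]

/-! ### Zhu–Kueng–Grassl–Gross, Proposition 1 (proof): the Frobenius identity at t = 2 -/

section frobenius

variable (ψ : J → V → ℂ)

omit [DecidableEq V] in
/-- `Tr(M M) = Σ_{j,k} |⟨ψ_j|ψ_k⟩|⁴` for `M = Σ_j (|ψ_j⟩⟨ψ_j|)^{⊗2}`. [cite: KlappeneckerRoetteler2005, §4 proof of Theorem 2, eq. (5) (first term of ⟨ξ,ξ⟩)] -/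
private theorem trace_tensorSum_mul_tensorSum :
    ((∑ j, proj (ψ j) ⊗ₖ proj (ψ j)) * (∑ k, proj (ψ k) ⊗ₖ proj (ψ k))).trace =
      ((∑ j, ∑ k, overlapSq (ψ j) (ψ k) ^ 2 : ℝ) : ℂ) := by
  rw [sum_mul_sum, trace_sum]
  push_cast
  refine sum_congr rfl fun j _ => ?_
  rw [trace_sum]
  exact sum_congr rfl fun k _ => by rw [trace_projTwo_mul_projTwo]; push_cast; ring

/-- `Tr(M (𝟙 + F)) = 2K` for unit vectors (`Tr(P⊗P) = (Tr P)² = 1` and `Tr((P⊗P)F) = Tr P² = 1`).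
[cite: KlappeneckerRoetteler2005, §4 proof of Theorem 2 (the cross term of ⟨ξ,ξ⟩, evaluated by Lemma 1)] -/
private theorem trace_tensorSum_mul_onePlusSwap (hunit : ∀ j, ∑ a, Complex.normSq (ψ j a) = 1) :
    ((∑ j, proj (ψ j) ⊗ₖ proj (ψ j)) * ((1 : Matrix (V × V) (V × V) ℂ) + swapOp V)).trace =
      2 * (Fintype.card J : ℂ) := by
  rw [mul_add, mul_one, trace_add, trace_sum, sum_mul, trace_sum]
  have h1 : ∀ j, (proj (ψ j) ⊗ₖ proj (ψ j)).trace = 1 := fun j => by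
    rw [trace_kronecker, trace_proj, (braket_self_eq_one_iff _).2 (hunit j), mul_one]
  have h2 : ∀ j, ((proj (ψ j) ⊗ₖ proj (ψ j)) * swapOp V).trace = 1 := fun j => by
    rw [trace_mul_comm, trace_swapOp_mul_kronecker, trace_proj_mul_proj_eq, overlapSq_self (hunit j)]
    norm_num
  simp_rw [h1, h2]
  rw [sum_const, card_univ, nsmul_eq_mul, mul_one]
  ring

/-- **The Frobenius identity** (Zhu–Kueng–Grassl–Gross, proof of Proposition 1, at `t = 2`):
for unit vectors `ψ_j`,
`‖(1/K) Σ_j (|ψ_j⟩⟨ψ_j|)^{⊗2} − P_[2]/D_[2]‖₂² = Φ₂({ψ_j}) − 1/D_[2]`, `D_[2] = N(N+1)/2`.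
[cite: ZhuEtAl2016, §2.1 proof of Proposition 1 (“‖(1/K)Σ_j (|ψ_j⟩⟨ψ_j|)^{⊗t} − P_[t]/D_[t]‖₂² = Φ_t({ψ_j}) − 1/D_[t]”)]
[cite: KlappeneckerRoetteler2005, §4 proof of Theorem 2, eq. (5) (⟨ξ,ξ⟩ ≥ 0)] -/
theorem frobeniusSq_deviation_eq [Nonempty J] [Nonempty V]
    (hunit : ∀ j, ∑ a, Complex.normSq (ψ j a) = 1) :
    ∑ p, ∑ q, Complex.normSq (deviation ψ p q) =
      framePotential₂ ψ - 2 / ((Fintype.card V : ℝ) * (Fintype.card V + 1)) := by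
  have hK : (Fintype.card J : ℂ) ≠ 0 := by exact_mod_cast Fintype.card_ne_zero
  have hN : (Fintype.card V : ℂ) ≠ 0 := by exact_mod_cast Fintype.card_ne_zero
  have hN1 : (Fintype.card V : ℂ) + 1 ≠ 0 := by
    exact_mod_cast (by positivity : (Fintype.card V : ℝ) + 1 ≠ 0)
  apply Complex.ofReal_injective
  rw [← trace_conjTranspose_mul_self, conjTranspose_deviation]
  -- expand `(cM − c'Π)(cM − c'Π)`
  set M : Matrix (V × V) (V × V) ℂ := ∑ j, proj (ψ j) ⊗ₖ proj (ψ j) with hM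
  set T : Matrix (V × V) (V × V) ℂ := (1 : Matrix (V × V) (V × V) ℂ) + swapOp V with hT
  set c : ℂ := ((Fintype.card J : ℂ))⁻¹ with hc
  set c' : ℂ := (((Fintype.card V : ℂ)) * (Fintype.card V + 1))⁻¹ with hc'
  have hdev : deviation ψ = c • M - c' • T := rfl
  have hMM : (M * M).trace = ((∑ j, ∑ k, overlapSq (ψ j) (ψ k) ^ 2 : ℝ) : ℂ) :=
    trace_tensorSum_mul_tensorSum ψ
  have hMT : (M * T).trace = 2 * (Fintype.card J : ℂ) := trace_tensorSum_mul_onePlusSwap ψ hunit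
  have hTM : (T * M).trace = 2 * (Fintype.card J : ℂ) := by rw [trace_mul_comm, hMT]
  have hTT : (T * T).trace = 2 * (Fintype.card V : ℂ) * (Fintype.card V + 1) := trace_onePlusSwap_sq
  rw [hdev, sub_mul, mul_sub, mul_sub]
  simp only [Matrix.smul_mul, Matrix.mul_smul, smul_smul, trace_sub, trace_smul, smul_eq_mul, hMM, hMT,
    hTM, hTT, framePotential₂, hc, hc']
  push_cast
  field_simp
  ring

/-- **Welch's bound for `k = 2`** (Remark 1 of Zhu et al.: “In general, Φ_t({ψ_j}) ≥ 1/D_[t]”):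
`Φ₂({ψ_j}) ≥ 2/(N(N+1)) = 1/binom(N+1, 2)` for every nonempty finite family of unit vectors in `ℂ^N`.
[cite: Welch1974, (the bound for k = 2)] [cite: KlappeneckerRoetteler2005, §3 eq. (1) (k = 2) and Remark 1]
[cite: ZhuEtAl2016, §2.1 Remark 1] -/
theorem welch_bound_two [Nonempty J] [Nonempty V] (hunit : ∀ j, ∑ a, Complex.normSq (ψ j a) = 1) :
    2 / ((Fintype.card V : ℝ) * (Fintype.card V + 1)) ≤ framePotential₂ ψ := by
  have h := frobeniusSq_deviation_eq ψ hunit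
  have h0 : 0 ≤ ∑ p, ∑ q, Complex.normSq (deviation ψ p q) :=
    sum_nonneg fun p _ => sum_nonneg fun q _ => Complex.normSq_nonneg _
  linarith

/-- **Zhu–Kueng–Grassl–Gross Proposition 1, (2) ⇔ (3), at `t = 2`** (= Klappenecker–Rötteler
Theorem 2, (1) ⇔ (3), for `t = 2` in the operator form): a nonempty finite family of unit vectors is a
complex projective 2-design — `(1/K) Σ_j (|ψ_j⟩⟨ψ_j|)^{⊗2} = P_[2]/D_[2]` — iff its second frame
potential attains Welch's bound, `Φ₂ = 2/(N(N+1))`.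
[cite: ZhuEtAl2016, Proposition 1 (statements 2 and 3) and Remark 1]
[cite: KlappeneckerRoetteler2005, Theorem 2 ((1) ⇔ (3)), t = 2] -/
theorem isStateTwoDesign_iff_framePotential₂ [Nonempty J] [Nonempty V] :
    IsStateTwoDesign ψ ↔
      (∀ j, ∑ a, Complex.normSq (ψ j a) = 1) ∧
        framePotential₂ ψ = 2 / ((Fintype.card V : ℝ) * (Fintype.card V + 1)) := by
  rw [isStateTwoDesign_iff_deviation_eq_zero]
  refine ⟨fun ⟨hu, hd⟩ => ⟨hu, ?_⟩, fun ⟨hu, hΦ⟩ => ⟨hu, ?_⟩⟩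
  · have h := frobeniusSq_deviation_eq ψ hu
    rw [hd] at h
    simp only [Matrix.zero_apply, map_zero, sum_const_zero] at h
    linarith
  · apply eq_zero_of_sum_normSq_eq_zero
    rw [frobeniusSq_deviation_eq ψ hu, hΦ, sub_self]

/-- The saturating direction as a usable criterion: unit vectors with `Φ₂ = 2/(N(N+1))` form a
2-design. [cite: ZhuEtAl2016, Proposition 1 ((3) ⇒ (2))] [cite: KlappeneckerRoetteler2005, Theorem 2 ((3) ⇒ (1))] -/
theorem isStateTwoDesign_of_framePotential₂ [Nonempty J] [Nonempty V]
    (hunit : ∀ j, ∑ a, Complex.normSq (ψ j a) = 1)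
    (hΦ : framePotential₂ ψ = 2 / ((Fintype.card V : ℝ) * (Fintype.card V + 1))) :
    IsStateTwoDesign ψ :=
  (isStateTwoDesign_iff_framePotential₂ ψ).2 ⟨hunit, hΦ⟩

end frobenius

/-! ### Mutually unbiased bases (Klappenecker–Rötteler, Definition 1 and Theorem 4) -/

/-- **A family of mutually unbiased bases** of `ℂ^V` (`N = |V|`): orthonormal bases `B_i = {B_i a}_{a∈κ}`
(`|κ| = N`), pairwise *mutually unbiased* — “Two orthonormal bases `B` and `C` of `ℂ^d` are called
mutually unbiased iff `|⟨b|c⟩|² = 1/d` holds for all `b ∈ B` and `c ∈ C`.”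
[cite: KlappeneckerRoetteler2005, §2 Definition 1] -/
structure IsMUBFamily {ι κ : Type*} [Fintype κ] [DecidableEq κ] (B : ι → κ → V → ℂ) : Prop where
  /-- each `B_i` has `N` members (with orthonormality: a basis) -/
  card_eq : Fintype.card κ = Fintype.card V
  /-- each `B_i` is orthonormal -/
  orthonormal : ∀ i a b, braket (B i a) (B i b) = if a = b then 1 else 0
  /-- distinct bases are mutually unbiased -/
  unbiased : ∀ i i', i ≠ i' → ∀ a b, overlapSq (B i a) (B i' b) = 1 / (Fintype.card V : ℝ)

namespace IsMUBFamily

variable {ι κ : Type*} [Fintype ι] [DecidableEq ι] [Fintype κ] [DecidableEq κ] {B : ι → κ → V → ℂ}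

omit [DecidableEq V] [Fintype ι] [DecidableEq ι] in
/-- Members of a MUB family are unit vectors. [cite: KlappeneckerRoetteler2005, §2 Definition 1 (“orthonormal bases”)] -/
theorem norm_sq (hB : IsMUBFamily B) (i : ι) (a : κ) : ∑ x, Complex.normSq (B i a x) = 1 :=
  (braket_self_eq_one_iff _).1 (by rw [hB.orthonormal i a a, if_pos rfl])

omit [DecidableEq V] [Fintype ι] [DecidableEq ι] in
/-- Within one basis the angles are `|⟨B_i a|B_i b⟩|² = [a = b]`. [cite: KlappeneckerRoetteler2005, §6 proof of Theorem 4 (“1 + (d−1)·0”)] -/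
theorem overlapSq_same (hB : IsMUBFamily B) (i : ι) (a b : κ) :
    overlapSq (B i a) (B i b) = if a = b then 1 else 0 := by
  unfold overlapSq
  rw [hB.orthonormal i a b]
  split_ifs <;> simp

omit [DecidableEq V] in
/-- The row sums of the fourth powers of the angles: for every member `x = B_i a` of `d+1` MUBs,
`Σ_y |⟨x|y⟩|⁴ = 1 + (d−1)·0 + d²·(1/d²) = 2`. [cite: KlappeneckerRoetteler2005, §6 proof of Theorem 4 (the k = 2 display)] -/
theorem sum_overlapSq_sq (hB : IsMUBFamily B) (hι : Fintype.card ι = Fintype.card V + 1) (i : ι) (a : κ) :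
    ∑ q : ι × κ, overlapSq (B i a) (B q.1 q.2) ^ 2 = 2 := by
  classical
  have hN : (0 : ℝ) < Fintype.card V := by
    have : 0 < Fintype.card κ := Fintype.card_pos_iff.2 ⟨a⟩
    rw [hB.card_eq] at this
    exact_mod_cast this
  rw [Fintype.sum_prod_type, ← Finset.add_sum_erase _ _ (mem_univ i)]
  simp only
  -- same basis: `Σ_b [a = b] = 1`
  have hsame : ∑ b, overlapSq (B i a) (B i b) ^ 2 = 1 := by
    simp_rw [hB.overlapSq_same]
    simp
  -- other bases: each of the `d` other bases contributes `d · (1/d)² = 1/d`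
  have hother : ∀ i' ∈ univ.erase i, ∑ b, overlapSq (B i a) (B i' b) ^ 2 = 1 / (Fintype.card V : ℝ) := by
    intro i' hi'
    have hne : i ≠ i' := (ne_of_mem_erase hi').symm
    simp_rw [hB.unbiased i i' hne]
    rw [sum_const, card_univ, hB.card_eq, nsmul_eq_mul]
    field_simp
  rw [hsame, sum_congr rfl hother, sum_const, card_erase_of_mem (mem_univ i), card_univ, hι,
    Nat.add_sub_cancel, nsmul_eq_mul]
  field_simp
  ring

omit [DecidableEq V] in
/-- The second frame potential of the union of `d+1` MUBs attains Welch's bound: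
`(1/(d²(d+1)²)) Σ_{x,y} |⟨x|y⟩|⁴ = 2/(d(d+1))`. [cite: KlappeneckerRoetteler2005, §6 proof of Theorem 4 (k = 2: “= 2/(d(d+1)) … coincides with binom(d+2−1,2)⁻¹”)] -/
theorem framePotential₂_eq [Nonempty V] (hB : IsMUBFamily B) (hι : Fintype.card ι = Fintype.card V + 1) :
    framePotential₂ (fun p : ι × κ => B p.1 p.2) =
      2 / ((Fintype.card V : ℝ) * (Fintype.card V + 1)) := by
  classical
  have hN : (0 : ℝ) < Fintype.card V := by exact_mod_cast Fintype.card_pos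
  unfold framePotential₂
  rw [Fintype.sum_prod_type]
  simp only
  simp_rw [hB.sum_overlapSq_sq hι]
  simp only [sum_const, card_univ, nsmul_eq_mul, Fintype.card_prod, hι, hB.card_eq]
  push_cast
  field_simp

/-- **Klappenecker–Rötteler Theorem 4: the union of `d+1` mutually unbiased bases of `ℂ^d` is a
complex projective 2-design with `d(d+1)` elements** (here: the design identity
`(1/K) Σ (|x⟩⟨x|)^{⊗2} = (𝟙+F)/(d(d+1))` of Zhu–Kueng–Grassl–Gross's Proposition 1, `K = d(d+1)`).
[cite: KlappeneckerRoetteler2005, Theorem 4] [cite: ZhuEtAl2016, §2.1 (“Another interesting example of 2-designs are complete sets of mutually unbiased bases (MUB)”)] -/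
theorem isStateTwoDesign (hB : IsMUBFamily B) (hι : Fintype.card ι = Fintype.card V + 1) :
    IsStateTwoDesign (fun p : ι × κ => B p.1 p.2) := by
  classical
  haveI : Nonempty ι := Fintype.card_pos_iff.1 (by omega)
  rcases isEmpty_or_nonempty V with hV | hV
  · -- degenerate `d = 0`: `κ` is empty too and both sides of the identity are `0 × 0` matrices
    have hκ : IsEmpty κ :=
      Fintype.card_eq_zero_iff.1 (by rw [hB.card_eq]; exact Fintype.card_eq_zero)
    refine ⟨fun p => (hκ.false p.2).elim, ?_⟩
    ext p q
    exact (hV.false p.1).elim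
  · haveI : Nonempty κ := Fintype.card_pos_iff.1 (by rw [hB.card_eq]; exact Fintype.card_pos)
    exact isStateTwoDesign_of_framePotential₂ _ (fun p => hB.norm_sq p.1 p.2) (hB.framePotential₂_eq hι)

/-- Hence the union of `d+1` MUBs **anticoncentrates** (Hangleiter et al. 2018, Theorem 5 for exact
state 2-designs, through the tree's `IsStateTwoDesign.anticoncentration`): for every basis state `x`
and `0 ≤ α ≤ 1`, `Pr_{(i,a)}[ |⟨x|B_i a⟩|² > α/d ] ≥ (1−α)²/2`.
[cite: KlappeneckerRoetteler2005, Theorem 4] [cite: HangleiterEtAl2018, Theorem 5 (state 2-designs)] -/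
theorem anticoncentration (hB : IsMUBFamily B) (hι : Fintype.card ι = Fintype.card V + 1) (x : V)
    {α : ℝ} (hα0 : 0 ≤ α) (hα1 : α ≤ 1) :
    (1 - α) ^ 2 / 2 ≤
      (#(univ.filter fun p : ι × κ => α / (Fintype.card V) < Complex.normSq (B p.1 p.2 x)) : ℝ) /
        Fintype.card (ι × κ) :=
  (hB.isStateTwoDesign hι).anticoncentration x hα0 hα1

/-- … and has average collision probability `Z = (1/K) Σ_{(i,a)} Σ_x |⟨x|B_i a⟩|⁴ = 2/(d+1)`, the
Haar value `Z_H` (Dalzell–Hunter-Jones–Brandão: exact 2-designs “also 1/2-anti-concentrate”), through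
the tree's `IsStateTwoDesign.avg_collisionProb`.
[cite: KlappeneckerRoetteler2005, Theorem 4] [cite: DalzellHunterJonesBrandao2022, App. ‘Approximate 2-designs and anti-concentration’ (Z = 2/(qⁿ+1) for exact 2-designs)] -/
theorem avg_collisionProb [Nonempty V] (hB : IsMUBFamily B) (hι : Fintype.card ι = Fintype.card V + 1) :
    ((Fintype.card (ι × κ) : ℝ))⁻¹ *
        ∑ p : ι × κ, collisionProb (fun x => Complex.normSq (B p.1 p.2 x)) =
      2 / ((Fintype.card V : ℝ) + 1) :=
  (hB.isStateTwoDesign hι).avg_collisionProb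

end IsMUBFamily


/-! ### SIC-POVMs are 2-designs (Renes et al. 2004; Klappenecker–Rötteler Theorem 6) -/

/-- **A symmetric informationally complete family (SIC-POVM)**: `d²` unit vectors of `ℂ^d` with
constant angle `|⟨v|w⟩|² = 1/(d+1)` for `v ≠ w` — “systems of `d²` vectors in `ℂ^d` which have constant
inner product, i.e., `|⟨v, w⟩|² = 1/(d+1)` for all `v,w` in the set”.
[cite: KlappeneckerRoetteler2005, §7 (definition of SIC-POVMs)] [cite: RenesEtAl2004, §1 (definition of a SIC-POVM)] -/
structure IsSIC (ψ : J → V → ℂ) : Prop where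
  /-- unit vectors -/
  norm_sq : ∀ j, ∑ a, Complex.normSq (ψ j a) = 1
  /-- `d²` of them -/
  card_eq : Fintype.card J = Fintype.card V ^ 2
  /-- equiangular with angle `1/(d+1)` -/
  equiangular : ∀ j k, j ≠ k → overlapSq (ψ j) (ψ k) = 1 / ((Fintype.card V : ℝ) + 1)

namespace IsSIC

variable [DecidableEq J] {ψ : J → V → ℂ}

omit [DecidableEq V] in
/-- Row sums of the fourth powers of the angles of a SIC: `Σ_w |⟨v|w⟩|⁴ = 1 + (d²−1)/(d+1)² = 2d/(d+1)`.
[cite: KlappeneckerRoetteler2005, §7 proof of Theorem 6 (k = 2 display: “d²·1 + (d⁴ − d²)/(d+1)²”)] -/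
theorem sum_overlapSq_sq [Nonempty V] (h : IsSIC ψ) (j : J) :
    ∑ k, overlapSq (ψ j) (ψ k) ^ 2 = 2 * (Fintype.card V : ℝ) / (Fintype.card V + 1) := by
  have hN : (0 : ℝ) < Fintype.card V := by exact_mod_cast Fintype.card_pos
  rw [← Finset.add_sum_erase _ _ (mem_univ j), overlapSq_self (h.norm_sq j)]
  have hother : ∀ k ∈ univ.erase j, overlapSq (ψ j) (ψ k) ^ 2 = (1 / ((Fintype.card V : ℝ) + 1)) ^ 2 :=
    fun k hk => by rw [h.equiangular j k (ne_of_mem_erase hk).symm]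
  rw [sum_congr rfl hother, sum_const, card_erase_of_mem (mem_univ j), card_univ, h.card_eq, nsmul_eq_mul]
  have hcast : ((Fintype.card V ^ 2 - 1 : ℕ) : ℝ) = (Fintype.card V : ℝ) ^ 2 - 1 := by
    rw [Nat.cast_sub (Nat.one_le_pow _ _ Fintype.card_pos), Nat.cast_pow, Nat.cast_one]
  rw [hcast]
  field_simp
  ring

omit [DecidableEq V] in
/-- The second frame potential of a SIC attains Welch's bound: `(1/d⁴) Σ_{x,y} |⟨x|y⟩|⁴ = 2/(d(d+1))`.
[cite: KlappeneckerRoetteler2005, §7 proof of Theorem 6 (k = 2: “= 2/(d(d+1)) … coincides with binom(d+2−1,2)⁻¹”)] -/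
theorem framePotential₂_eq [Nonempty V] (h : IsSIC ψ) :
    framePotential₂ ψ = 2 / ((Fintype.card V : ℝ) * (Fintype.card V + 1)) := by
  have hN : (0 : ℝ) < Fintype.card V := by exact_mod_cast Fintype.card_pos
  unfold framePotential₂
  simp_rw [h.sum_overlapSq_sq]
  rw [sum_const, card_univ, h.card_eq, nsmul_eq_mul]
  push_cast
  field_simp

/-- **SIC-POVMs are 2-designs** (Renes–Blume-Kohout–Scott–Caves; Klappenecker–Rötteler Theorem 6:
“Let `X` be a SIC-POVM in dimension `d`. Then `X` forms a 2-design … with angle set `{1/(d+1)}` and `d²`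
elements.”) [cite: KlappeneckerRoetteler2005, Theorem 6] [cite: RenesEtAl2004, §3 (SIC-POVMs are spherical 2-designs)] -/
theorem isStateTwoDesign (h : IsSIC ψ) : IsStateTwoDesign ψ := by
  rcases isEmpty_or_nonempty V with hV | hV
  · have hJ : IsEmpty J :=
      Fintype.card_eq_zero_iff.1 (by rw [h.card_eq, Fintype.card_eq_zero (α := V)]; rfl)
    refine ⟨h.norm_sq, ?_⟩
    ext p q
    exact (hV.false p.1).elim
  · haveI : Nonempty J :=
      Fintype.card_pos_iff.1 (by rw [h.card_eq]; exact pow_pos Fintype.card_pos 2)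
    exact isStateTwoDesign_of_framePotential₂ ψ h.norm_sq h.framePotential₂_eq

end IsSIC

/-! ### Construction I in prime dimension (Ivanović 1981; Wootters–Fields 1989): `p + 1` MUBs of `ℂ^p`

“Let `q` be an odd prime power. Define `|v_{a,b}⟩ = q^{−1/2} (ω_p^{tr(ax²+bx)})_{x∈𝔽_q}`, with
`ω_p = exp(2πi/p)`. Then the standard basis together with the bases `B_a = {|v_{a,b}⟩ : b ∈ 𝔽_q}`,
`a ∈ 𝔽_q`, form a set of `q+1` mutually unbiased bases of `ℂ^q`.” [cite: KlappeneckerRoetteler2005, §2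
Construction I (Wootters and Fields)]  Formalised for `q = p` an odd PRIME (`𝔽_p = ZMod p`, `tr = id`,
`ω_p^k` = Mathlib's `ZMod.stdAddChar k`); the unbiasedness of two quadratic-phase bases is the
quadratic Gauss-sum magnitude `|Σ_x ω^{ax²+bx}|² = p` (`a ≠ 0`, `p` odd).
Prime powers: `q = pⁿ` with `p` odd is section OddPrimePower below (BBRV Theorem 4.4 with the
trace-form spread of `𝔽_{pⁿ}` — for `n = 1` it is this construction), `q = 2ⁿ` is section QubitSpread
(KR05's Galois-ring Construction II is not transcribed; the case `p = 2`, where `x² = x` kills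
Construction I, is handled there with `ℤ/4` phases). -/

section PrimeDim

open ZMod

variable (p : ℕ) [Fact p.Prime]

/-- The quadratic-phase vector `|v_{a,b}⟩ = p^{−1/2} (ω_p^{a x² + b x})_{x ∈ 𝔽_p}`.
[cite: KlappeneckerRoetteler2005, §2 Construction I] [cite: WoottersFields1989, (the prime-power construction)] [cite: Ivanovic1981, (the prime construction)] -/
def wfVec (a b : ZMod p) : ZMod p → ℂ :=
  fun x => (((Real.sqrt p)⁻¹ : ℝ) : ℂ) * (stdAddChar (a * x ^ 2 + b * x) : ℂ)

/-- The standard basis vector `|b⟩`. [cite: KlappeneckerRoetteler2005, §2 Construction I (“the standard basis together with the bases B_a”)] -/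
def stdVec (b : ZMod p) : ZMod p → ℂ := fun x => if x = b then 1 else 0

/-- Construction I as a family of `p + 1` bases indexed by `Option (ZMod p)`: `none ↦` the standard
basis, `some a ↦ B_a`. [cite: KlappeneckerRoetteler2005, §2 Construction I] -/
def wfMUB : Option (ZMod p) → ZMod p → ZMod p → ℂ
  | none => stdVec p
  | some a => wfVec p a

variable {p}

/-- `conj ω_p^k = ω_p^{−k}`. [cite: KlappeneckerRoetteler2005, §2 Construction I (ω_p = exp(2πi/p))] -/
private theorem star_stdAddChar (k : ZMod p) : star (stdAddChar k : ℂ) = stdAddChar (-k) := by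
  rw [stdAddChar_apply, stdAddChar_apply, AddChar.map_neg_eq_inv, Circle.coe_inv_eq_conj]
  rfl

/-- Orthogonality of characters: `Σ_x ω_p^{t x} = p [t = 0]`. [cite: KlappeneckerRoetteler2005, §2 Construction I (orthonormality of B_a)] -/
private theorem sum_stdAddChar_mul (t : ZMod p) :
    ∑ x : ZMod p, (stdAddChar (x * t) : ℂ) = if t = 0 then (p : ℂ) else 0 := by
  rw [AddChar.sum_mulShift t (isPrimitive_stdAddChar p), ZMod.card]
  split_ifs <;> simp

omit [Fact p.Prime] in
/-- `(1/√p)² = 1/p`. [cite: KlappeneckerRoetteler2005, §2 Construction I (the prefactor q^{−1/2})] -/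
private theorem sqrtInv_mul_sqrtInv :
    ((((Real.sqrt p)⁻¹ : ℝ) : ℂ)) * (((Real.sqrt p)⁻¹ : ℝ) : ℂ) = ((p : ℂ))⁻¹ := by
  rw [← Complex.ofReal_mul, ← mul_inv, Real.mul_self_sqrt (Nat.cast_nonneg p)]
  push_cast
  rfl

/-- Inner products inside Construction I:
`⟨v_{a,b}|v_{a',b'}⟩ = (1/p) Σ_x ω_p^{(a'−a)x² + (b'−b)x}`. [cite: KlappeneckerRoetteler2005, §2 Construction I] -/
theorem braket_wfVec (a b a' b' : ZMod p) :
    braket (wfVec p a b) (wfVec p a' b') =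
      ((p : ℂ))⁻¹ * ∑ x : ZMod p, (stdAddChar ((a' - a) * x ^ 2 + (b' - b) * x) : ℂ) := by
  unfold braket wfVec
  rw [dotProduct, mul_sum]
  refine sum_congr rfl fun x _ => ?_
  rw [Pi.star_apply, star_mul', Complex.star_def, Complex.conj_ofReal, ← Complex.star_def,
    star_stdAddChar, mul_mul_mul_comm, sqrtInv_mul_sqrtInv, ← AddChar.map_add_eq_mul]
  congr 2
  ring

/-- **The quadratic Gauss-sum magnitude**: for an odd prime `p`, `a ≠ 0` and any `b`,
`|Σ_{x ∈ 𝔽_p} ω_p^{a x² + b x}|² = p` (complete the square: the double sum collapses on the diagonal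
because `2a ≠ 0`). [cite: KlappeneckerRoetteler2005, §2 Construction I (unbiasedness of B_a and B_{a'})] [cite: WoottersFields1989, (unbiasedness via Gauss sums)] -/
theorem normSq_quadGaussSum (hp : p ≠ 2) {a : ZMod p} (ha : a ≠ 0) (b : ZMod p) :
    Complex.normSq (∑ x : ZMod p, (stdAddChar (a * x ^ 2 + b * x) : ℂ)) = p := by
  have h2 : (2 : ZMod p) ≠ 0 := by
    intro h
    have h' : ((2 : ℕ) : ZMod p) = 0 := by exact_mod_cast h
    rw [ZMod.natCast_eq_zero_iff] at h'
    have := (Nat.prime_dvd_prime_iff_eq (Fact.out : p.Prime) Nat.prime_two).1 h'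
    exact hp this
  apply Complex.ofReal_injective
  rw [Complex.normSq_eq_conj_mul_self, map_sum, sum_mul_sum]
  -- substitute `x = y + h` in the inner sum and use `χ(f(y+h) − f(y)) = χ(a h² + b h) χ(y · 2ah)`
  have hinner : ∀ y : ZMod p,
      ∑ x : ZMod p, conj (stdAddChar (a * y ^ 2 + b * y) : ℂ) * (stdAddChar (a * x ^ 2 + b * x) : ℂ) =
        ∑ h : ZMod p, (stdAddChar (a * h ^ 2 + b * h) : ℂ) * (stdAddChar (y * (2 * a * h)) : ℂ) := by
    intro y
    rw [← Equiv.sum_comp (Equiv.addLeft y)]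
    refine sum_congr rfl fun h _ => ?_
    rw [Equiv.coe_addLeft, ← Complex.star_def, star_stdAddChar, ← AddChar.map_add_eq_mul,
      ← AddChar.map_add_eq_mul]
    congr 1
    ring
  simp_rw [hinner]
  rw [sum_comm]
  simp_rw [← mul_sum, sum_stdAddChar_mul]
  have hiff : ∀ h : ZMod p, (2 * a * h = 0) ↔ h = 0 := fun h => by
    simp [mul_eq_zero, ha, h2]
  simp_rw [hiff, mul_ite, mul_zero]
  rw [Finset.sum_ite_eq' univ (0 : ZMod p), if_pos (mem_univ _)]
  simp

/-- Orthonormality of each quadratic-phase basis `B_a`. [cite: KlappeneckerRoetteler2005, §2 Construction I (“the bases B_a”)] -/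
theorem braket_wfVec_same (a b b' : ZMod p) :
    braket (wfVec p a b) (wfVec p a b') = if b = b' then 1 else 0 := by
  have hp0 : (p : ℂ) ≠ 0 := by exact_mod_cast (Fact.out : p.Prime).ne_zero
  rw [braket_wfVec, sub_self]
  simp_rw [zero_mul, zero_add]
  have : ∑ x : ZMod p, (stdAddChar ((b' - b) * x) : ℂ) = ∑ x : ZMod p, (stdAddChar (x * (b' - b)) : ℂ) :=
    sum_congr rfl fun x _ => by rw [mul_comm]
  rw [this, sum_stdAddChar_mul]
  by_cases h : b = b'
  · subst h; simp [hp0]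
  · rw [if_neg (sub_ne_zero.2 (Ne.symm h)), if_neg h, mul_zero]

/-- Orthonormality of the standard basis. [cite: KlappeneckerRoetteler2005, §2 Construction I (“the standard basis”)] -/
theorem braket_stdVec (b b' : ZMod p) : braket (stdVec p b) (stdVec p b') = if b = b' then 1 else 0 := by
  unfold braket
  rw [dotProduct, Finset.sum_eq_single b]
  · simp [stdVec]
  · intro x _ hx; simp [stdVec, hx]
  · simp

/-- The standard basis is unbiased to every `B_a`: `|⟨b|v_{a,b'}⟩|² = 1/p`.
[cite: KlappeneckerRoetteler2005, §2 Construction I] -/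
theorem overlapSq_stdVec_wfVec (b a b' : ZMod p) :
    overlapSq (stdVec p b) (wfVec p a b') = 1 / (p : ℝ) := by
  unfold overlapSq braket
  rw [dotProduct, Finset.sum_eq_single b]
  · simp only [stdVec, Pi.star_apply, if_true, star_one, one_mul, wfVec]
    rw [Complex.normSq_mul, Complex.normSq_ofReal, stdAddChar_apply, Complex.normSq_eq_norm_sq,
      Circle.norm_coe, one_pow, mul_one, ← mul_inv, Real.mul_self_sqrt (Nat.cast_nonneg p), one_div]
  · intro x _ hx; simp [stdVec, hx]
  · simp

/-- Distinct quadratic-phase bases are unbiased: `|⟨v_{a,b}|v_{a',b'}⟩|² = 1/p` for `a ≠ a'`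
(`p` an odd prime). [cite: KlappeneckerRoetteler2005, §2 Construction I] [cite: Ivanovic1981, (p + 1 complementary observables in prime dimension)] -/
theorem overlapSq_wfVec (hp : p ≠ 2) {a a' : ZMod p} (ha : a ≠ a') (b b' : ZMod p) :
    overlapSq (wfVec p a b) (wfVec p a' b') = 1 / (p : ℝ) := by
  have hp0 : (p : ℝ) ≠ 0 := by exact_mod_cast (Fact.out : p.Prime).ne_zero
  unfold overlapSq
  rw [braket_wfVec, Complex.normSq_mul, normSq_quadGaussSum hp (sub_ne_zero.2 (Ne.symm ha)),
    Complex.normSq_inv, Complex.normSq_natCast]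
  field_simp

/-- **Construction I gives `p + 1` mutually unbiased bases of `ℂ^p`** for every odd prime `p`.
[cite: KlappeneckerRoetteler2005, §2 Construction I (Wootters and Fields)] [cite: WoottersFields1989, (q + 1 MUBs in prime-power dimension q)] [cite: Ivanovic1981, (p + 1 bases for p prime)] -/
theorem wfMUB_isMUBFamily (hp : p ≠ 2) : IsMUBFamily (wfMUB p) where
  card_eq := rfl
  orthonormal := by
    rintro (_ | a) b b'
    · exact braket_stdVec b b'
    · exact braket_wfVec_same a b b'
  unbiased := by
    rintro (_ | a) (_ | a') hne b b'
    · exact absurd rfl hne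
    · rw [wfMUB, wfMUB, overlapSq_stdVec_wfVec, ZMod.card]
    · rw [wfMUB, wfMUB, overlapSq_comm, overlapSq_stdVec_wfVec, ZMod.card]
    · rw [wfMUB, wfMUB, overlapSq_wfVec hp (fun h => hne (by rw [h])), ZMod.card]

/-- Hence, for every odd prime `p`, the `p(p+1)` vectors of Construction I form a complex projective
2-design in `ℂ^p` (Klappenecker–Rötteler Theorem 4 applied to Construction I) — an infinite family of
witnesses of the tree's `IsStateTwoDesign` beyond one qubit.
[cite: KlappeneckerRoetteler2005, Theorem 4 and §2 Construction I] -/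
theorem wfMUB_isStateTwoDesign (hp : p ≠ 2) :
    IsStateTwoDesign (fun q : Option (ZMod p) × ZMod p => wfMUB p q.1 q.2) :=
  (wfMUB_isMUBFamily hp).isStateTwoDesign (by rw [Fintype.card_option, ZMod.card])

end PrimeDim


/-! ### Klappenecker–Rötteler Example 2: five mutually unbiased bases of `ℂ⁴` (two qubits)

“In dimension `d = 4` Construction II yields the bases (where we have abbreviated “+” for `1` and “−”
for `−1` …): ½{(+,+,+,+), (+,+,−,−), (+,−,−,+), (+,−,+,−)}, ½{(+,−,−i,−i), (+,−,i,i), (+,+,i,−i),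
(+,+,−i,i)}, ½{(+,−i,−i,−), (+,−i,i,+), (+,i,i,−), (+,i,−i,+)}, ½{(+,−i,−,−i), (+,−i,+,i), (+,i,+,−i),
(+,i,−,i)}.  These four bases and the standard basis `𝟙₄` form an extremal set of five MUBs in `ℂ⁴`.”
[cite: KlappeneckerRoetteler2005, §2 Example 2] — transcribed verbatim; mutual unbiasedness is
checked entry by entry (the `d = 2^n` Galois-ring Construction II itself is not formalised). -/

section TwoQubits

open Complex

/-- `½`, the common prefactor of Example 2. -/
local notation "𝗁" => (1 / 2 : ℂ)

/-- The five mutually unbiased bases of `ℂ⁴` of Klappenecker–Rötteler's Example 2 (index `0` = the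
standard basis, `1 … 4` = the four Galois-ring bases, in the printed order).
[cite: KlappeneckerRoetteler2005, §2 Example 2] -/
def twoQubitMUB : Fin 5 → Fin 4 → Fin 4 → ℂ :=
  ![![![1, 0, 0, 0], ![0, 1, 0, 0], ![0, 0, 1, 0], ![0, 0, 0, 1]],
    ![![𝗁, 𝗁, 𝗁, 𝗁], ![𝗁, 𝗁, -𝗁, -𝗁], ![𝗁, -𝗁, -𝗁, 𝗁], ![𝗁, -𝗁, 𝗁, -𝗁]],
    ![![𝗁, -𝗁, -(𝗁 * I), -(𝗁 * I)], ![𝗁, -𝗁, 𝗁 * I, 𝗁 * I], ![𝗁, 𝗁, 𝗁 * I, -(𝗁 * I)], ![𝗁, 𝗁, -(𝗁 * I), 𝗁 * I]],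
    ![![𝗁, -(𝗁 * I), -(𝗁 * I), -𝗁], ![𝗁, -(𝗁 * I), 𝗁 * I, 𝗁], ![𝗁, 𝗁 * I, 𝗁 * I, -𝗁], ![𝗁, 𝗁 * I, -(𝗁 * I), 𝗁]],
    ![![𝗁, -(𝗁 * I), -𝗁, -(𝗁 * I)], ![𝗁, -(𝗁 * I), 𝗁, 𝗁 * I], ![𝗁, 𝗁 * I, 𝗁, -(𝗁 * I)], ![𝗁, 𝗁 * I, -𝗁, 𝗁 * I]]]

/-- Example 2, bases `0` and `1` are unbiased (16 angles `= 1/4`, by computation).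
[cite: KlappeneckerRoetteler2005, §2 Example 2] -/
private theorem unb01 (a b : Fin 4) : overlapSq (twoQubitMUB 0 a) (twoQubitMUB 1 b) = 1 / 4 := by
  fin_cases a <;> fin_cases b <;>
    simp [overlapSq, braket, twoQubitMUB, dotProduct, Fin.sum_univ_four, Complex.normSq_apply] <;> norm_num

/-- Example 2, bases `0` and `2` are unbiased (16 angles `= 1/4`, by computation).
[cite: KlappeneckerRoetteler2005, §2 Example 2] -/
private theorem unb02 (a b : Fin 4) : overlapSq (twoQubitMUB 0 a) (twoQubitMUB 2 b) = 1 / 4 := by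
  fin_cases a <;> fin_cases b <;>
    simp [overlapSq, braket, twoQubitMUB, dotProduct, Fin.sum_univ_four, Complex.normSq_apply] <;> norm_num

/-- Example 2, bases `0` and `3` are unbiased (16 angles `= 1/4`, by computation).
[cite: KlappeneckerRoetteler2005, §2 Example 2] -/
private theorem unb03 (a b : Fin 4) : overlapSq (twoQubitMUB 0 a) (twoQubitMUB 3 b) = 1 / 4 := by
  fin_cases a <;> fin_cases b <;>
    simp [overlapSq, braket, twoQubitMUB, dotProduct, Fin.sum_univ_four, Complex.normSq_apply] <;> norm_num

/-- Example 2, bases `0` and `4` are unbiased (16 angles `= 1/4`, by computation).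
[cite: KlappeneckerRoetteler2005, §2 Example 2] -/
private theorem unb04 (a b : Fin 4) : overlapSq (twoQubitMUB 0 a) (twoQubitMUB 4 b) = 1 / 4 := by
  fin_cases a <;> fin_cases b <;>
    simp [overlapSq, braket, twoQubitMUB, dotProduct, Fin.sum_univ_four, Complex.normSq_apply] <;> norm_num

/-- Example 2, bases `1` and `2` are unbiased (16 angles `= 1/4`, by computation).
[cite: KlappeneckerRoetteler2005, §2 Example 2] -/
private theorem unb12 (a b : Fin 4) : overlapSq (twoQubitMUB 1 a) (twoQubitMUB 2 b) = 1 / 4 := by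
  fin_cases a <;> fin_cases b <;>
    simp [overlapSq, braket, twoQubitMUB, dotProduct, Fin.sum_univ_four, Complex.normSq_apply] <;> norm_num

/-- Example 2, bases `1` and `3` are unbiased (16 angles `= 1/4`, by computation).
[cite: KlappeneckerRoetteler2005, §2 Example 2] -/
private theorem unb13 (a b : Fin 4) : overlapSq (twoQubitMUB 1 a) (twoQubitMUB 3 b) = 1 / 4 := by
  fin_cases a <;> fin_cases b <;>
    simp [overlapSq, braket, twoQubitMUB, dotProduct, Fin.sum_univ_four, Complex.normSq_apply] <;> norm_num

/-- Example 2, bases `1` and `4` are unbiased (16 angles `= 1/4`, by computation).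
[cite: KlappeneckerRoetteler2005, §2 Example 2] -/
private theorem unb14 (a b : Fin 4) : overlapSq (twoQubitMUB 1 a) (twoQubitMUB 4 b) = 1 / 4 := by
  fin_cases a <;> fin_cases b <;>
    simp [overlapSq, braket, twoQubitMUB, dotProduct, Fin.sum_univ_four, Complex.normSq_apply] <;> norm_num

/-- Example 2, bases `2` and `3` are unbiased (16 angles `= 1/4`, by computation).
[cite: KlappeneckerRoetteler2005, §2 Example 2] -/
private theorem unb23 (a b : Fin 4) : overlapSq (twoQubitMUB 2 a) (twoQubitMUB 3 b) = 1 / 4 := by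
  fin_cases a <;> fin_cases b <;>
    simp [overlapSq, braket, twoQubitMUB, dotProduct, Fin.sum_univ_four, Complex.normSq_apply] <;> norm_num

/-- Example 2, bases `2` and `4` are unbiased (16 angles `= 1/4`, by computation).
[cite: KlappeneckerRoetteler2005, §2 Example 2] -/
private theorem unb24 (a b : Fin 4) : overlapSq (twoQubitMUB 2 a) (twoQubitMUB 4 b) = 1 / 4 := by
  fin_cases a <;> fin_cases b <;>
    simp [overlapSq, braket, twoQubitMUB, dotProduct, Fin.sum_univ_four, Complex.normSq_apply] <;> norm_num

/-- Example 2, bases `3` and `4` are unbiased (16 angles `= 1/4`, by computation).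
[cite: KlappeneckerRoetteler2005, §2 Example 2] -/
private theorem unb34 (a b : Fin 4) : overlapSq (twoQubitMUB 3 a) (twoQubitMUB 4 b) = 1 / 4 := by
  fin_cases a <;> fin_cases b <;>
    simp [overlapSq, braket, twoQubitMUB, dotProduct, Fin.sum_univ_four, Complex.normSq_apply] <;> norm_num

/-- Unbiasedness of Example 2 across distinct bases, `i < i'` half.
[cite: KlappeneckerRoetteler2005, §2 Example 2] -/
private theorem twoQubitMUB_unbiased_lt :
    ∀ i i' : Fin 5, i < i' → ∀ a b : Fin 4, overlapSq (twoQubitMUB i a) (twoQubitMUB i' b) = 1 / 4 := by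
  intro i i' hlt a b
  fin_cases i <;> fin_cases i' <;> norm_num at hlt <;>
    first | exact unb01 a b | exact unb02 a b | exact unb03 a b | exact unb04 a b | exact unb12 a b | exact unb13 a b | exact unb14 a b | exact unb23 a b | exact unb24 a b | exact unb34 a b

/-- **Example 2 is a family of five mutually unbiased bases of `ℂ⁴`.**
[cite: KlappeneckerRoetteler2005, §2 Example 2 (“These four bases and the standard basis 𝟙₄ form an extremal set of five MUBs in ℂ⁴”)] -/
theorem twoQubitMUB_isMUBFamily : IsMUBFamily twoQubitMUB where
  card_eq := by simp
  orthonormal := by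
    intro i a b
    fin_cases i <;> fin_cases a <;> fin_cases b <;>
      simp [braket, twoQubitMUB, dotProduct, Fin.sum_univ_four, Complex.ext_iff] <;> norm_num
  unbiased := by
    intro i i' hne a b
    rw [Fintype.card_fin]
    rcases lt_or_gt_of_ne hne with h | h
    · exact twoQubitMUB_unbiased_lt i i' h a b
    · rw [overlapSq_comm]; exact twoQubitMUB_unbiased_lt i' i h b a

/-- Hence the `20` vectors of Example 2 form a complex projective 2-design in `ℂ⁴` — a two-qubit witness
of the tree's `IsStateTwoDesign` (until now instantiated only by the six one-qubit stabilizer states,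
`DesignAnticoncentration.stabilizerQubit_isStateTwoDesign`).
[cite: KlappeneckerRoetteler2005, Theorem 4 and §2 Example 2] -/
theorem twoQubitMUB_isStateTwoDesign :
    IsStateTwoDesign (fun q : Fin 5 × Fin 4 => twoQubitMUB q.1 q.2) :=
  twoQubitMUB_isMUBFamily.isStateTwoDesign (by simp)

end TwoQubits


/-! ### One qubit: the eigenbases of `σ_z, σ_x, σ_y` are three mutually unbiased bases of `ℂ²`

“A simple example is provided by the Pauli spin matrices `σ_x, σ_y, σ_z`” — their eigenbases
`{|0⟩,|1⟩}, {|±⟩}, {|±i⟩}` are `d + 1 = 3` MUBs of `ℂ²`, whose union is the set of six one-qubit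
stabilizer states of `DesignAnticoncentration.stabilizerQubit`. [cite: KlappeneckerRoetteler2005, §1] -/

section OneQubit

open Complex

/-- `1/√2` as a real-cast complex number. -/
local notation "𝗌" => (((Real.sqrt 2)⁻¹ : ℝ) : ℂ)

/-- The three Pauli eigenbases of `ℂ²`: index `0` = `{|0⟩,|1⟩}` (σ_z), `1` = `{|+⟩,|−⟩}` (σ_x),
`2` = `{|+i⟩,|−i⟩}` (σ_y). [cite: KlappeneckerRoetteler2005, §1 (“the Pauli spin matrices σ_x, σ_y, σ_z”)] -/
def qubitMUB : Fin 3 → Fin 2 → Fin 2 → ℂ :=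
  ![![![1, 0], ![0, 1]],
    ![![𝗌, 𝗌], ![𝗌, -𝗌]],
    ![![𝗌, 𝗌 * I], ![𝗌, -(𝗌 * I)]]]

/-- `(√2/2)·(√2/2) = 1/2` (simp rewrites `1/√2` as `√2/2`). [cite: KlappeneckerRoetteler2005, §1] -/
private theorem sqrt2_half_mul_self : Real.sqrt 2 / 2 * (Real.sqrt 2 / 2) = 1 / 2 := by
  rw [div_mul_div_comm, Real.mul_self_sqrt zero_le_two]
  norm_num

/-- **The three Pauli eigenbases are mutually unbiased.** [cite: KlappeneckerRoetteler2005, §1 (“Thus the eigenbases of non-degenerate complementary observables are mutually unbiased” — σ_x, σ_y, σ_z)] -/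
theorem qubitMUB_isMUBFamily : IsMUBFamily qubitMUB where
  card_eq := by simp
  orthonormal := by
    intro i a b
    fin_cases i <;> fin_cases a <;> fin_cases b <;>
      simp [braket, qubitMUB, dotProduct, Fin.sum_univ_two, Complex.ext_iff, sqrt2_half_mul_self] <;>
      norm_num
  unbiased := by
    intro i i' hne a b
    rw [Fintype.card_fin]
    fin_cases i <;> fin_cases i' <;>
      first
        | exact absurd rfl hne
        | (fin_cases a <;> fin_cases b <;>
            simp [overlapSq, braket, qubitMUB, dotProduct, Fin.sum_univ_two, Complex.normSq_apply,
              sqrt2_half_mul_self] <;> norm_num)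

/-- Hence the six one-qubit stabilizer states form a 2-design — recovered here from Theorem 4 rather
than from the entrywise check of `DesignAnticoncentration.stabilizerQubit_isStateTwoDesign`.
[cite: KlappeneckerRoetteler2005, Theorem 4 and §1] -/
theorem qubitMUB_isStateTwoDesign : IsStateTwoDesign (fun q : Fin 3 × Fin 2 => qubitMUB q.1 q.2) :=
  qubitMUB_isMUBFamily.isStateTwoDesign (by simp)

end OneQubit


/-! ### v2 — Welch's bound for `k = 1`, 1-designs = uniform tight frames (Klappenecker–Rötteler Theorem 3)

“A finite subset `F` of nonzero vectors of `ℂ^d` is called a frame if there exist nonzero real constants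
`A` and `B` such that `A‖v‖² ≤ Σ_{f∈F} |⟨f|v⟩|² ≤ B‖v‖²` holds for all `v ∈ ℂ^d` … tight if `A = B` …
isometric (or uniform) if each vector in `F` has unit norm.  Theorem 3. Let `F` be a finite nonempty
subset of vectors in `ℂ^d`. The following statements about `F` are equivalent: 1) `F` is a uniform tight
frame; 2) `F` is a WBE-sequence set; 3) `F` is a 1-design in `ℂS^{d−1}`.  Proof. The frame constants of
a uniform tight frame `F` in `ℂ^d` are given by `A = B = |F|/d` …” [cite: KlappeneckerRoetteler2005, §5
and Theorem 3]; a WBE-sequence set is one attaining eq. (1) for `k = 1` [cite: KlappeneckerRoetteler2005,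
§3 (“A set X attaining the Welch bound (1) for k = 1 is called a WBE-sequence set”)].  In the operator
form of Zhu–Kueng–Grassl–Gross Proposition 1 at `t = 1` (`P_[1] = 𝟙`, `D_[1] = N`): the frame operator
identity `(1/K) Σ_j |ψ_j⟩⟨ψ_j| = 𝟙/N` (tight frame with `A = B = K/N`) ⇔ `Φ₁ = 1/N`, and `Φ₁ ≥ 1/N`
always; complete MUB families and SICs satisfy it (“the union of `d+1` mutually unbiased bases of `ℂ^d`
form a WBE-sequence set”, §3; Theorem 4 / Theorem 6 proofs, `k = 1` displays). -/

section OneDesign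

variable (ψ : J → V → ℂ)

/-- The first frame potential `Φ₁({ψ_j}) = (1/K²) Σ_{j,k} |⟨ψ_j|ψ_k⟩|²` — the left side of Welch's bound
for `k = 1`. [cite: ZhuEtAl2016, §2.1 eq. (3) (t = 1)] [cite: KlappeneckerRoetteler2005, §3 eq. (1) (k = 1)] -/
def framePotential₁ (ψ : J → V → ℂ) : ℝ :=
  ((Fintype.card J : ℝ) ^ 2)⁻¹ * ∑ j, ∑ k, overlapSq (ψ j) (ψ k)

/-- The (normalised) frame operator `(1/K) Σ_j |ψ_j⟩⟨ψ_j|`. [cite: KlappeneckerRoetteler2005, §5 (“Σ_{f∈F} |⟨f|v⟩|²”, the frame operator's quadratic form)] [cite: ZhuEtAl2016, Proposition 1 statement 2 (t = 1)] -/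
def avgProj (ψ : J → V → ℂ) : Matrix V V ℂ := ((Fintype.card J : ℂ))⁻¹ • ∑ j, proj (ψ j)

/-- **1-design / uniform tight frame** (operator form): unit vectors with `(1/K) Σ_j |ψ_j⟩⟨ψ_j| = 𝟙/N`,
i.e. frame constants `A = B = K/N`. [cite: KlappeneckerRoetteler2005, §5 and Theorem 3 (“A = B = |F|/d”)] [cite: ZhuEtAl2016, Proposition 1 (t = 1: P_[1]/D_[1] = 𝟙/d)] -/
structure IsStateOneDesign (ψ : J → V → ℂ) : Prop where
  /-- unit vectors -/
  norm_sq : ∀ j, ∑ a, Complex.normSq (ψ j a) = 1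
  /-- the frame operator identity -/
  frame_eq : avgProj ψ = ((Fintype.card V : ℂ))⁻¹ • (1 : Matrix V V ℂ)

omit [DecidableEq V] in
/-- `Tr(M₁M₁) = Σ_{j,k} |⟨ψ_j|ψ_k⟩|²` for `M₁ = Σ_j |ψ_j⟩⟨ψ_j|`. [cite: KlappeneckerRoetteler2005, §4 proof of Theorem 2, eq. (5) (k = 1)] -/
private theorem trace_projSum_mul_projSum :
    ((∑ j, proj (ψ j)) * (∑ k, proj (ψ k))).trace = ((∑ j, ∑ k, overlapSq (ψ j) (ψ k) : ℝ) : ℂ) := by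
  rw [sum_mul_sum, trace_sum]
  push_cast
  refine sum_congr rfl fun j _ => ?_
  rw [trace_sum]
  exact sum_congr rfl fun k _ => by rw [trace_proj_mul_proj_eq]

omit [DecidableEq V] in
/-- `Tr M₁ = K` for unit vectors. [cite: KlappeneckerRoetteler2005, §5 (“each vector in F has unit norm”)] -/
private theorem trace_projSum (hunit : ∀ j, ∑ a, Complex.normSq (ψ j a) = 1) :
    (∑ j, proj (ψ j)).trace = (Fintype.card J : ℂ) := by
  rw [trace_sum]
  simp_rw [trace_proj, fun j => (braket_self_eq_one_iff (ψ j)).2 (hunit j)]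
  rw [sum_const, card_univ, nsmul_eq_mul, mul_one]

/-- **The Frobenius identity at `t = 1`**: `‖(1/K) Σ_j |ψ_j⟩⟨ψ_j| − 𝟙/N‖₂² = Φ₁ − 1/N` for unit vectors.
[cite: ZhuEtAl2016, §2.1 proof of Proposition 1 (“‖(1/K)Σ_j (|ψ_j⟩⟨ψ_j|)^{⊗t} − P_[t]/D_[t]‖₂² = Φ_t − 1/D_[t]”, t = 1)] -/
theorem frobeniusSq_avgProj_sub_eq [Nonempty J] [Nonempty V]
    (hunit : ∀ j, ∑ a, Complex.normSq (ψ j a) = 1) :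
    ∑ p, ∑ q, Complex.normSq ((avgProj ψ - ((Fintype.card V : ℂ))⁻¹ • (1 : Matrix V V ℂ)) p q) =
      framePotential₁ ψ - 1 / (Fintype.card V : ℝ) := by
  have hK : (Fintype.card J : ℂ) ≠ 0 := by exact_mod_cast Fintype.card_ne_zero
  have hN : (Fintype.card V : ℂ) ≠ 0 := by exact_mod_cast Fintype.card_ne_zero
  apply Complex.ofReal_injective
  have hherm : (avgProj ψ - ((Fintype.card V : ℂ))⁻¹ • (1 : Matrix V V ℂ))ᴴ =
      avgProj ψ - ((Fintype.card V : ℂ))⁻¹ • (1 : Matrix V V ℂ) := by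
    unfold avgProj
    rw [conjTranspose_sub, conjTranspose_smul, conjTranspose_smul, conjTranspose_sum, conjTranspose_one]
    simp_rw [conjTranspose_proj]
    rw [star_inv₀, star_natCast, star_inv₀, star_natCast]
  rw [← trace_conjTranspose_mul_self, hherm]
  set M : Matrix V V ℂ := ∑ j, proj (ψ j) with hM
  set c : ℂ := ((Fintype.card J : ℂ))⁻¹ with hc
  set b : ℂ := ((Fintype.card V : ℂ))⁻¹ with hb
  have hdev : avgProj ψ - b • (1 : Matrix V V ℂ) = c • M - b • (1 : Matrix V V ℂ) := rfl
  have hMM : (M * M).trace = ((∑ j, ∑ k, overlapSq (ψ j) (ψ k) : ℝ) : ℂ) := trace_projSum_mul_projSum ψ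
  have hM1 : M.trace = (Fintype.card J : ℂ) := trace_projSum ψ hunit
  rw [hdev, sub_mul, mul_sub, mul_sub]
  simp only [Matrix.smul_mul, Matrix.mul_smul, smul_smul, Matrix.mul_one, Matrix.one_mul, trace_sub,
    trace_smul, smul_eq_mul, hMM, hM1, trace_one, framePotential₁, hc, hb]
  push_cast
  field_simp
  ring

/-- **Welch's bound for `k = 1`**: `Φ₁({ψ_j}) ≥ 1/N` for every nonempty finite family of unit vectors.
[cite: Welch1974, (the bound for k = 1)] [cite: KlappeneckerRoetteler2005, §3 eq. (1) (k = 1)] [cite: ZhuEtAl2016, §2.1 Remark 1 (t = 1)] -/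
theorem welch_bound_one [Nonempty J] [Nonempty V] (hunit : ∀ j, ∑ a, Complex.normSq (ψ j a) = 1) :
    1 / (Fintype.card V : ℝ) ≤ framePotential₁ ψ := by
  have h := frobeniusSq_avgProj_sub_eq ψ hunit
  have h0 : 0 ≤ ∑ p, ∑ q,
      Complex.normSq ((avgProj ψ - ((Fintype.card V : ℂ))⁻¹ • (1 : Matrix V V ℂ)) p q) :=
    sum_nonneg fun p _ => sum_nonneg fun q _ => Complex.normSq_nonneg _
  linarith

/-- **Klappenecker–Rötteler Theorem 3 (1) ⇔ (2)** (= Zhu et al. Proposition 1 (2) ⇔ (3) at `t = 1`):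
unit vectors form a uniform tight frame (`(1/K)Σ|ψ_j⟩⟨ψ_j| = 𝟙/N`) iff they are a WBE-sequence set
(`Φ₁ = 1/N`). [cite: KlappeneckerRoetteler2005, Theorem 3] [cite: ZhuEtAl2016, Proposition 1 (t = 1)] -/
theorem isStateOneDesign_iff_framePotential₁ [Nonempty J] [Nonempty V] :
    IsStateOneDesign ψ ↔
      (∀ j, ∑ a, Complex.normSq (ψ j a) = 1) ∧ framePotential₁ ψ = 1 / (Fintype.card V : ℝ) := by
  constructor
  · rintro ⟨hu, hf⟩
    refine ⟨hu, ?_⟩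
    have h := frobeniusSq_avgProj_sub_eq ψ hu
    rw [hf, sub_self] at h
    simp only [Matrix.zero_apply, map_zero, sum_const_zero] at h
    linarith
  · rintro ⟨hu, hΦ⟩
    refine ⟨hu, ?_⟩
    have h := frobeniusSq_avgProj_sub_eq ψ hu
    rw [hΦ, sub_self] at h
    exact sub_eq_zero.1 (eq_zero_of_sum_normSq_eq_zero _ h)

end OneDesign

namespace IsMUBFamily

variable {ι κ : Type*} [Fintype ι] [DecidableEq ι] [Fintype κ] [DecidableEq κ] {B : ι → κ → V → ℂ}

omit [DecidableEq V] in
/-- Row sums of the squared angles of `d+1` MUBs: `Σ_y |⟨x|y⟩|² = 1 + (d−1)·0 + d²·(1/d) = d + 1`.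
[cite: KlappeneckerRoetteler2005, §6 proof of Theorem 4 (the k = 1 display)] -/
theorem sum_overlapSq (hB : IsMUBFamily B) (hι : Fintype.card ι = Fintype.card V + 1) (i : ι) (a : κ) :
    ∑ q : ι × κ, overlapSq (B i a) (B q.1 q.2) = (Fintype.card V : ℝ) + 1 := by
  classical
  have hN : (0 : ℝ) < Fintype.card V := by
    have : 0 < Fintype.card κ := Fintype.card_pos_iff.2 ⟨a⟩
    rw [hB.card_eq] at this
    exact_mod_cast this
  rw [Fintype.sum_prod_type, ← Finset.add_sum_erase _ _ (mem_univ i)]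
  simp only
  have hsame : ∑ b, overlapSq (B i a) (B i b) = 1 := by
    simp_rw [hB.overlapSq_same]
    simp
  have hother : ∀ i' ∈ univ.erase i, ∑ b, overlapSq (B i a) (B i' b) = 1 := by
    intro i' hi'
    have hne : i ≠ i' := (ne_of_mem_erase hi').symm
    simp_rw [hB.unbiased i i' hne]
    rw [sum_const, card_univ, hB.card_eq, nsmul_eq_mul]
    field_simp
  rw [hsame, sum_congr rfl hother, sum_const, card_erase_of_mem (mem_univ i), card_univ, hι,
    Nat.add_sub_cancel, nsmul_eq_mul, mul_one]
  ring

omit [DecidableEq V] in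
/-- “the union of `d+1` mutually unbiased bases of `ℂ^d` form a WBE-sequence set”: `Φ₁ = 1/d`.
[cite: KlappeneckerRoetteler2005, §3 and §6 proof of Theorem 4 (k = 1: “= 1/d … so, X is a 1-design”)] -/
theorem framePotential₁_eq [Nonempty V] (hB : IsMUBFamily B) (hι : Fintype.card ι = Fintype.card V + 1) :
    framePotential₁ (fun p : ι × κ => B p.1 p.2) = 1 / (Fintype.card V : ℝ) := by
  classical
  have hN : (0 : ℝ) < Fintype.card V := by exact_mod_cast Fintype.card_pos
  unfold framePotential₁
  rw [Fintype.sum_prod_type]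
  simp only
  simp_rw [hB.sum_overlapSq hι]
  simp only [sum_const, card_univ, nsmul_eq_mul, Fintype.card_prod, hι, hB.card_eq]
  push_cast
  field_simp

/-- **The union of `d+1` MUBs is a uniform tight frame / 1-design**: `(1/(d(d+1))) Σ_{i,a} |B_i a⟩⟨B_i a| = 𝟙/d`
(equivalently `Σ_{i,a} |B_i a⟩⟨B_i a| = (d+1)·𝟙`: the `d+1` projective measurements, pooled, form a
resolution of the identity). [cite: KlappeneckerRoetteler2005, Theorem 3 with §3 / §6 (MUBs are WBE-sequence sets, hence 1-designs)] -/
theorem isStateOneDesign [Nonempty V] (hB : IsMUBFamily B) (hι : Fintype.card ι = Fintype.card V + 1) :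
    IsStateOneDesign (fun p : ι × κ => B p.1 p.2) := by
  classical
  haveI : Nonempty ι := Fintype.card_pos_iff.1 (by omega)
  haveI : Nonempty κ := Fintype.card_pos_iff.1 (by rw [hB.card_eq]; exact Fintype.card_pos)
  exact (isStateOneDesign_iff_framePotential₁ _).2 ⟨fun p => hB.norm_sq p.1 p.2, hB.framePotential₁_eq hι⟩

end IsMUBFamily

namespace IsSIC

variable [DecidableEq J] {ψ : J → V → ℂ}

omit [DecidableEq V] in
/-- Row sums of the squared angles of a SIC: `1 + (d² − 1)/(d+1) = d`. [cite: KlappeneckerRoetteler2005, §7 proof of Theorem 6 (k = 1 display)] -/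
theorem sum_overlapSq [Nonempty V] (h : IsSIC ψ) (j : J) :
    ∑ k, overlapSq (ψ j) (ψ k) = (Fintype.card V : ℝ) := by
  have hN : (0 : ℝ) < Fintype.card V := by exact_mod_cast Fintype.card_pos
  rw [← Finset.add_sum_erase _ _ (mem_univ j), overlapSq_self (h.norm_sq j)]
  have hother : ∀ k ∈ univ.erase j, overlapSq (ψ j) (ψ k) = 1 / ((Fintype.card V : ℝ) + 1) :=
    fun k hk => by rw [h.equiangular j k (ne_of_mem_erase hk).symm]
  rw [sum_congr rfl hother, sum_const, card_erase_of_mem (mem_univ j), card_univ, h.card_eq, nsmul_eq_mul]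
  have hcast : ((Fintype.card V ^ 2 - 1 : ℕ) : ℝ) = (Fintype.card V : ℝ) ^ 2 - 1 := by
    rw [Nat.cast_sub (Nat.one_le_pow _ _ Fintype.card_pos), Nat.cast_pow, Nat.cast_one]
  rw [hcast]
  field_simp
  ring

omit [DecidableEq V] in
/-- A SIC is a WBE-sequence set: `Φ₁ = 1/d` (“so, X is a 1-design”). [cite: KlappeneckerRoetteler2005, §7 proof of Theorem 6 (k = 1)] -/
theorem framePotential₁_eq [Nonempty V] (h : IsSIC ψ) :
    framePotential₁ ψ = 1 / (Fintype.card V : ℝ) := by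
  have hN : (0 : ℝ) < Fintype.card V := by exact_mod_cast Fintype.card_pos
  unfold framePotential₁
  simp_rw [h.sum_overlapSq]
  rw [sum_const, card_univ, h.card_eq, nsmul_eq_mul]
  push_cast
  field_simp

/-- **A SIC-POVM is a uniform tight frame / 1-design**: `(1/d²) Σ_j |ψ_j⟩⟨ψ_j| = 𝟙/d` — the operators
`(1/d)|ψ_j⟩⟨ψ_j|` form a POVM. [cite: KlappeneckerRoetteler2005, Theorem 3 with §7 (SIC-POVMs attain the Welch bound for k = 1)] [cite: RenesEtAl2004, §1 (SIC-POVM elements (1/d)|ψ⟩⟨ψ| sum to 𝟙)] -/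
theorem isStateOneDesign [Nonempty V] (h : IsSIC ψ) : IsStateOneDesign ψ := by
  haveI : Nonempty J := Fintype.card_pos_iff.1 (by rw [h.card_eq]; exact pow_pos Fintype.card_pos 2)
  exact (isStateOneDesign_iff_framePotential₁ ψ).2 ⟨h.norm_sq, h.framePotential₁_eq⟩

end IsSIC


/-! ### v2 — Symmetric spread sets over `𝔽_p` and the trace-form spread of `𝔽_{pⁿ}`
(Bandyopadhyay–Boykin–Roychowdhury–Vatan, hypothesis of Theorem 4.4 and §4.3)

“Theorem 4.4. Let `{A_1,…,A_ℓ}` be a set of symmetric `m×m` matrices over `𝔽_p` such that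
`det(A_j − A_k) ≠ 0`, for every `1 ≤ j < k ≤ ℓ`. Then there is a set of `ℓ+1` mutually unbiased bases on
`ℂ^{p^m}`.” and §4.3: “Let `γ_1,…,γ_m` be a basis of `𝔽_{p^m}` as a vector space over `𝔽_p` …
`γ_iγ_j = Σ_ℓ b^ℓ_{ij} γ_ℓ` … the `p^m` matrices `Σ_j a_j B_j`, `(a_1,…,a_m) ∈ 𝔽_p^m`, satisfy the condition
of Theorem 4.4.” [cite: BandyopadhyayEtAl2002, Theorem 4.4, §4.3]  Equivalently (composing with the trace,
a nondegenerate form): `A_λ = (tr(λ γ_i γ_j))_{ij}`, `λ ∈ 𝔽_{pⁿ}` — symmetric, and `A_λ − A_μ = A_{λ−μ}` is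
nonsingular for `λ ≠ μ` because the trace form of the separable extension `𝔽_{pⁿ}/𝔽_p` is nondegenerate
(Mathlib `traceForm_nondegenerate`).  With Mathlib's `GaloisField p n` this is a symmetric spread of size
`pⁿ` for EVERY prime `p` and `n ≥ 1`; the bases are attached to it below, separately for `p = 2`
(`ℤ/4` phases) and for odd `p` (`ω_p` phases). -/

section SymmSpread

variable {n : ℕ}

/-- **A symmetric spread set** (the hypothesis of BBRV Theorem 4.4): symmetric matrices `A_λ` over a
commutative ring (`𝔽_p` in the source) whose pairwise differences are nonsingular (stated as injectivity of
`h ↦ (A_λ − A_μ)h`). [cite: BandyopadhyayEtAl2002, Theorem 4.4 (“symmetric m×m matrices over 𝔽_p such that det(A_j − A_k) ≠ 0”)] -/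
structure IsSymmSpread {R : Type*} [CommRing R] {ι : Type*} (A : ι → Matrix (Fin n) (Fin n) R) : Prop where
  /-- each `A_λ` is symmetric -/
  symm : ∀ l, (A l).IsSymm
  /-- differences are nonsingular -/
  regular : ∀ l m, l ≠ m → ∀ h : Fin n → R, (A l - A m) *ᵥ h = 0 → h = 0

/-- For a symmetric matrix the bilinear form is symmetric: `u·(Mv) = v·(Mu)`.
[cite: BandyopadhyayEtAl2002, Lemma 4.3 (“S is a set of commuting operators iff A is symmetric”)] -/
private theorem dotProduct_mulVec_of_isSymm {R : Type*} [CommRing R] {M : Matrix (Fin n) (Fin n) R}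
    (hM : M.IsSymm) (u v : Fin n → R) : u ⬝ᵥ (M *ᵥ v) = v ⬝ᵥ (M *ᵥ u) := by
  rw [dotProduct_mulVec, ← vecMul_transpose, hM.eq, dotProduct_comm]

/-- The trace-form spread of `𝔽_{pⁿ}`: `A_λ = (tr_{𝔽_{pⁿ}/𝔽_p}(λ γ_i γ_j))_{i,j}` in a fixed `𝔽_p`-basis `γ`
of Mathlib's `GaloisField p n`.
[cite: BandyopadhyayEtAl2002, §4.3 (Wootters–Fields matrices B_ℓ from γ_iγ_j = Σ b^ℓ_ij γ_ℓ)] [cite: WoottersFields1989, (the 𝔽_{pⁿ} construction)] -/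
noncomputable def traceSpread (p n : ℕ) [Fact p.Prime] (hn : n ≠ 0) :
    GaloisField p n → Matrix (Fin n) (Fin n) (ZMod p) :=
  fun l i j =>
    Algebra.trace (ZMod p) (GaloisField p n)
      (l * ((Module.finBasisOfFinrankEq (ZMod p) (GaloisField p n) (GaloisField.finrank p hn) i) *
        (Module.finBasisOfFinrankEq (ZMod p) (GaloisField p n) (GaloisField.finrank p hn) j)))

/-- **The trace-form matrices are a symmetric spread of size `pⁿ`**: symmetric, with `A_λ − A_μ`
nonsingular for `λ ≠ μ` (nondegeneracy of the trace form of `𝔽_{pⁿ}/𝔽_p`).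
[cite: BandyopadhyayEtAl2002, §4.3 (“the p^m matrices Σ a_jB_j … satisfy the condition of Theorem 4.4”)] -/
theorem traceSpread_isSymmSpread (p n : ℕ) [Fact p.Prime] (hn : n ≠ 0) : IsSymmSpread (traceSpread p n hn) := by
  set γ := Module.finBasisOfFinrankEq (ZMod p) (GaloisField p n) (GaloisField.finrank p hn) with hγ
  constructor
  · intro l
    ext i j
    simp only [traceSpread, Matrix.transpose_apply]
    rw [mul_comm (γ j) (γ i)]
  · intro l m hlm h hh
    -- `(A_l − A_m) h = 0` says `tr((l − m) γ_i z) = 0` for all `i`, where `z = Σ_j h_j γ_j`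
    set c : GaloisField p n := l - m with hc
    have hc0 : c ≠ 0 := sub_ne_zero.2 hlm
    set z : GaloisField p n := ∑ j, h j • γ j with hz
    have hrow : ∀ i, Algebra.trace (ZMod p) (GaloisField p n) (c * γ i * z) = 0 := by
      intro i
      have hi := congr_fun hh i
      rw [Pi.zero_apply, Matrix.mulVec, dotProduct] at hi
      rw [hz, Finset.mul_sum, map_sum]
      rw [← hi]
      refine sum_congr rfl fun j _ => ?_
      rw [Matrix.sub_apply, mul_smul_comm, LinearMap.map_smul, smul_eq_mul, mul_comm (h j)]
      congr 1
      simp only [traceSpread, hc]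
      rw [← map_sub, sub_mul, sub_mul, mul_assoc, mul_assoc]
    -- hence `tr((c z) w) = 0` for every `w`, so `c z = 0` by nondegeneracy of the trace form
    have hall : ∀ w : GaloisField p n, Algebra.traceForm (ZMod p) (GaloisField p n) (c * z) w = 0 := by
      intro w
      rw [Algebra.traceForm_apply, ← γ.sum_repr w, Finset.mul_sum, map_sum]
      refine sum_eq_zero fun i _ => ?_
      rw [mul_smul_comm, LinearMap.map_smul, smul_eq_mul]
      have : c * z * γ i = c * γ i * z := by ring
      rw [this, hrow i, mul_zero]
    have hcz : c * z = 0 := (traceForm_nondegenerate (ZMod p) (GaloisField p n)).1 (c * z) hall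
    have hz0 : z = 0 := by
      rcases mul_eq_zero.1 hcz with h0 | h0
      · exact absurd h0 hc0
      · exact h0
    -- `z = Σ h_j γ_j = 0` forces `h = 0`
    have : γ.equivFun.symm h = 0 := by rw [Module.Basis.equivFun_symm_apply, ← hz, hz0]
    have h2 : h = γ.equivFun 0 := by rw [← this, LinearEquiv.apply_symm_apply]
    rw [h2, map_zero]

end SymmSpread

/-! ### v2 — Qubit systems `N = 2ⁿ`: MUBs from symmetric matrices over `𝔽₂` with nonsingular
differences (Bandyopadhyay–Boykin–Roychowdhury–Vatan, Theorem 4.4)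

“Theorem 4.4. Let `{A_1,…,A_ℓ}` be a set of symmetric `m×m` matrices over `𝔽_p` such that
`det(A_j − A_k) ≠ 0`, for every `1 ≤ j < k ≤ ℓ`. Then there is a set of `ℓ+1` mutually unbiased bases on
`ℂ^{p^m}`.  More specifically, the `ℓ+1` bases of the above theorem are represented by the matrices
`(0_m|𝟙_m), (𝟙_m|A_1), …, (𝟙_m|A_ℓ)`” (the classes of commuting Pauli operators `X(a)Z(aA_j)`), with
“Example `d = 4`. The four matrices (over `𝔽₂`) … `(0 0;0 0), (1 0;0 1), (0 1;1 1), (1 1;1 0)`” and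
“Example `d = 8`. The following eight `3×3` matrices determine a set 9 mutually unbiased bases on `ℂ⁸` …”;
§4.3: “to construct `p^m+1` mutually unbiased bases in `ℂ^{p^m}`, we only need to find `m` symmetric
nonsingular matrices `B_1,…,B_m` such that `Σ_j b_j B_j` is also nonsingular for every nonzero vector
`(b_1,…,b_m) ∈ 𝔽_p^m` … Wootters and Fields have found the following general construction for the matrices
`B_1,…,B_m`. Let `γ_1,…,γ_m` be a basis of `𝔽_{p^m}` … `γ_iγ_j = Σ_ℓ b^ℓ_{ij} γ_ℓ`.”
[cite: BandyopadhyayEtAl2002, Theorem 4.4, §4.2 Examples d = 4 / d = 8, §4.3]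
(= Klappenecker–Rötteler's Construction III [cite: KlappeneckerRoetteler2005, §2 Construction III]).

Formalised here for `p = 2` with the common eigenbases written out EXPLICITLY: for a symmetric `A` over `𝔽₂`
with `0/1` integer lift `Ã`, the basis attached to the class `(𝟙|A)` is
`v_{A,c}(x) = 2^{−n/2} i^{xᵀÃx} (−1)^{c·x}`, `c ∈ 𝔽₂ⁿ` — amplitudes `i^{(diag A)·x} (−1)^{Σ_{i<j} A_{ij}x_ix_j}`,
the Dehaene–De Moor normal form of a stabilizer state [cite: DehaeneDemoor2003, Theorem 5 (amplitudes
i^{l(x)}(−1)^{q(x)} with l linear and q quadratic over GF(2))].  PROOF ROUTE (ours, shorter in Lean than the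
printed eigenbasis argument of BBRV Theorem 3.2): mutual unbiasedness of `B_A` and `B_{A'}` is the
`ℤ₄`-valued quadratic Gauss sum `|Σ_{x∈𝔽₂ⁿ} i^{xᵀ(Ã−Ã')x}(−1)^{c·x}|² = 2ⁿ`, valid exactly when `A − A'` is
nonsingular, by completing the square (`(x⊕y)ᵀM(x⊕y) ≡ xᵀMx + yᵀMy + 2xᵀMy (mod 4)` for the integer lifts).
Instances: BBRV's Example `d = 4` (a second two-qubit family), Example `d = 8` (three qubits, 72 states),
and the general `n ≥ 1` through the trace-form spread of `𝔽_{2ⁿ}` (§4.3; Mathlib `GaloisField 2 n`).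
Odd prime powers `pⁿ` (the same argument with `ω_p`-phases, no lift needed) follow in section
OddPrimePower. -/

section QubitSpread

open Complex

variable {n : ℕ}

/-- Bit strings `𝔽₂ⁿ`, the computational-basis labels of `n` qubits. [cite: BandyopadhyayEtAl2002, §4.2 (“ℂ^{p^m}”, p = 2)] -/
abbrev Bits (n : ℕ) := Fin n → ZMod 2

/-- The `0/1` integer lift of a bit string. [cite: DehaeneDemoor2003, Theorem 5 (binary vectors read as integers in the exponent of i)] -/
def liftZ (x : Bits n) : Fin n → ℤ := fun i => ((x i).val : ℤ)

/-- The integer quadratic exponent `xᵀ M x` of an integer matrix `M` at a bit string.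
[cite: DehaeneDemoor2003, Theorem 5 (“i^{l(x)} (−1)^{q(x)}”: xᵀMx = (diag M)·x + 2Σ_{i<j} M_ij x_i x_j for x ∈ {0,1}ⁿ)] -/
def quadExp (M : Matrix (Fin n) (Fin n) ℤ) (x : Bits n) : ℤ := liftZ x ⬝ᵥ (M *ᵥ liftZ x)

/-- The sign character of `𝔽₂`: `ψ(t) = (−1)^t`. [cite: BandyopadhyayEtAl2002, §4.2 (the Pauli Z eigenvalues ±1)] -/
def sgn₂ (t : ZMod 2) : ℂ := (-1 : ℂ) ^ t.val

/-- `(−1)^{c·x} = Π_i (−1)^{c_i x_i}`. [cite: BandyopadhyayEtAl2002, §4.2 (eigenvalues of Z(c) on |x⟩)] -/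
def sgnVec (c x : Bits n) : ℂ := ∏ i, sgn₂ (c i * x i)

/-- `i^k` for `k ∈ ℤ/4`. [cite: DehaeneDemoor2003, Theorem 5 (phases i^{l(x)})] -/
def iPow (k : ZMod 4) : ℂ := I ^ k.val

/-- The vector `v_{M,c}(x) = 2^{−n/2} i^{xᵀMx} (−1)^{c·x}` attached to an integer symmetric matrix `M`
and a sign pattern `c`. [cite: BandyopadhyayEtAl2002, Theorem 4.4 (the basis of the class (𝟙|A))] [cite: DehaeneDemoor2003, Theorem 5] -/
def quadVec (M : Matrix (Fin n) (Fin n) ℤ) (c : Bits n) : Bits n → ℂ :=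
  fun x => (((Real.sqrt 2)⁻¹ : ℝ) : ℂ) ^ n * (iPow (quadExp M x : ZMod 4) * sgnVec c x)

/-- A computational-basis vector `|b⟩` (generic index type). [cite: BandyopadhyayEtAl2002, Theorem 4.4 (the class (0|𝟙): the standard basis)] -/
def basisVec {W : Type*} [DecidableEq W] (b : W) : W → ℂ := fun x => if x = b then 1 else 0

/-- The `0/1` integer lift of a matrix over `𝔽₂`. [cite: DehaeneDemoor2003, Theorem 5] -/
def liftMat (A : Matrix (Fin n) (Fin n) (ZMod 2)) : Matrix (Fin n) (Fin n) ℤ := A.map fun t => (t.val : ℤ)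

/-- The `ℓ + 1` bases of Theorem 4.4: `none ↦` the standard basis `(0|𝟙)`, `some λ ↦` the basis
`{v_{Ã_λ,c}}_c` of the class `(𝟙|A_λ)`. [cite: BandyopadhyayEtAl2002, Theorem 4.4] -/
def spreadMUB {ι : Type*} (A : ι → Matrix (Fin n) (Fin n) (ZMod 2)) : Option ι → Bits n → Bits n → ℂ
  | none => basisVec
  | some l => quadVec (liftMat (A l))

/-! #### Plumbing: the sign character, the `ℤ/4` phases, the lift -/

/-- `ψ(0) = 1`. [cite: BandyopadhyayEtAl2002, §4.2] -/
private theorem sgn₂_zero : sgn₂ 0 = 1 := by simp [sgn₂]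

/-- `ψ(1) = −1`. [cite: BandyopadhyayEtAl2002, §4.2] -/
private theorem sgn₂_one : sgn₂ 1 = -1 := by
  show (-1 : ℂ) ^ (1 : ZMod 2).val = -1
  rw [show (1 : ZMod 2).val = 1 from rfl, pow_one]

/-- `ψ(s + t) = ψ(s)ψ(t)`. [cite: BandyopadhyayEtAl2002, §4.2] -/
private theorem sgn₂_add (s t : ZMod 2) : sgn₂ (s + t) = sgn₂ s * sgn₂ t := by
  unfold sgn₂
  rw [ZMod.val_add, ← neg_one_pow_eq_pow_mod_two, pow_add]

/-- `ψ(t)² = 1`. [cite: BandyopadhyayEtAl2002, §4.2] -/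
private theorem sgn₂_mul_self (t : ZMod 2) : sgn₂ t * sgn₂ t = 1 := by
  unfold sgn₂
  rw [← pow_add, ← two_mul, pow_mul, neg_one_sq, one_pow]

/-- `ψ` is real. [cite: BandyopadhyayEtAl2002, §4.2] -/
private theorem conj_sgn₂ (t : ZMod 2) : conj (sgn₂ t) = sgn₂ t := by
  unfold sgn₂
  rw [map_pow, map_neg, map_one]

/-- `ψ(Σ_i f_i) = Π_i ψ(f_i)`. [cite: BandyopadhyayEtAl2002, §4.2] -/
private theorem sgn₂_sum {α : Type*} (s : Finset α) (f : α → ZMod 2) :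
    sgn₂ (∑ i ∈ s, f i) = ∏ i ∈ s, sgn₂ (f i) := by
  classical
  induction s using Finset.induction_on with
  | empty => simp [sgn₂_zero]
  | insert a s ha ih => rw [sum_insert ha, prod_insert ha, sgn₂_add, ih]

/-- `(−1)^{c·x} = ψ(c ⬝ᵥ x)`. [cite: BandyopadhyayEtAl2002, §4.2] -/
private theorem sgnVec_eq_sgn₂_dotProduct (c x : Bits n) : sgnVec c x = sgn₂ (c ⬝ᵥ x) := by
  unfold sgnVec
  rw [dotProduct, sgn₂_sum]

/-- `(−1)^{c·(x+y)} = (−1)^{c·x}(−1)^{c·y}`. [cite: BandyopadhyayEtAl2002, §4.2] -/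
private theorem sgnVec_add_right (c x y : Bits n) : sgnVec c (x + y) = sgnVec c x * sgnVec c y := by
  unfold sgnVec
  rw [← prod_mul_distrib]
  exact prod_congr rfl fun i _ => by rw [Pi.add_apply, mul_add, sgn₂_add]

/-- `(−1)^{(c+c')·x} = (−1)^{c·x}(−1)^{c'·x}`. [cite: BandyopadhyayEtAl2002, §4.2] -/
private theorem sgnVec_add_left (c c' x : Bits n) : sgnVec (c + c') x = sgnVec c x * sgnVec c' x := by
  unfold sgnVec
  rw [← prod_mul_distrib]
  exact prod_congr rfl fun i _ => by rw [Pi.add_apply, add_mul, sgn₂_add]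

/-- `(−1)^{c·x}` squares to one. [cite: BandyopadhyayEtAl2002, §4.2] -/
private theorem sgnVec_mul_self (c x : Bits n) : sgnVec c x * sgnVec c x = 1 := by
  unfold sgnVec
  rw [← prod_mul_distrib]
  exact prod_eq_one fun i _ => sgn₂_mul_self _

/-- `(−1)^{c·x}` is real. [cite: BandyopadhyayEtAl2002, §4.2] -/
private theorem conj_sgnVec (c x : Bits n) : conj (sgnVec c x) = sgnVec c x := by
  unfold sgnVec
  rw [map_prod]
  exact prod_congr rfl fun i _ => conj_sgn₂ _

/-- `(−1)^{c·0} = 1`. [cite: BandyopadhyayEtAl2002, §4.2] -/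
private theorem sgnVec_zero_right (c : Bits n) : sgnVec c 0 = 1 := by
  unfold sgnVec
  exact prod_eq_one fun i _ => by rw [Pi.zero_apply, mul_zero, sgn₂_zero]

/-- `|(−1)^{c·x}|² = 1`. [cite: BandyopadhyayEtAl2002, §4.2] -/
private theorem normSq_sgnVec (c x : Bits n) : Complex.normSq (sgnVec c x) = 1 := by
  apply Complex.ofReal_injective
  rw [Complex.normSq_eq_conj_mul_self, conj_sgnVec, sgnVec_mul_self]
  simp

/-- Character orthogonality on `𝔽₂ⁿ`: `Σ_y (−1)^{a·y} = 2ⁿ [a = 0]`. [cite: BandyopadhyayEtAl2002, §3 Lemma 3.3 (orthogonality of characters), p = 2] -/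
private theorem sum_sgnVec (a : Bits n) : ∑ y : Bits n, sgnVec a y = if a = 0 then (2 : ℂ) ^ n else 0 := by
  unfold sgnVec
  rw [← Fintype.piFinset_univ, ← Finset.prod_univ_sum (fun _ : Fin n => (Finset.univ : Finset (ZMod 2)))
    (fun i t => sgn₂ (a i * t))]
  have h01 : ∀ t : ZMod 2, t = 0 ∨ t = 1 := by decide
  have hsum : ∀ f : ZMod 2 → ℂ, ∑ t, f t = f 0 + f 1 := fun f => Fin.sum_univ_two f
  have h1 : ∀ i, ∑ t : ZMod 2, sgn₂ (a i * t) = if a i = 0 then (2 : ℂ) else 0 := by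
    intro i
    rw [hsum]
    rcases h01 (a i) with hi | hi
    · rw [if_pos hi, hi, mul_zero, mul_one, sgn₂_zero]; norm_num
    · rw [hi, if_neg (by decide), mul_zero, mul_one, sgn₂_zero, sgn₂_one]; norm_num
  simp_rw [h1]
  by_cases ha : a = 0
  · subst ha
    simp
  · rw [if_neg ha]
    obtain ⟨i, hi⟩ := Function.ne_iff.mp ha
    exact prod_eq_zero (mem_univ i) (if_neg hi)

/-- `i^0 = 1`. [cite: DehaeneDemoor2003, Theorem 5] -/
private theorem iPow_zero : iPow 0 = 1 := by simp [iPow]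

/-- `i^2 = −1`. [cite: DehaeneDemoor2003, Theorem 5] -/
private theorem iPow_two : iPow 2 = -1 := by
  show I ^ (2 : ZMod 4).val = -1
  rw [show (2 : ZMod 4).val = 2 from rfl, I_sq]

/-- `i^{a+b} = i^a i^b` on `ℤ/4` (`i⁴ = 1`). [cite: DehaeneDemoor2003, Theorem 5] -/
private theorem iPow_add (a b : ZMod 4) : iPow (a + b) = iPow a * iPow b := by
  unfold iPow
  rw [ZMod.val_add, ← pow_eq_pow_mod (a.val + b.val) Complex.I_pow_four, pow_add]

/-- `i^a ≠ 0`. [cite: DehaeneDemoor2003, Theorem 5] -/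
private theorem iPow_ne_zero (a : ZMod 4) : iPow a ≠ 0 := pow_ne_zero _ I_ne_zero

/-- `conj i^a = i^{−a}`. [cite: DehaeneDemoor2003, Theorem 5] -/
private theorem conj_iPow (a : ZMod 4) : conj (iPow a) = iPow (-a) := by
  have h1 : conj (iPow a) * iPow a = 1 := by
    unfold iPow
    rw [map_pow, ← mul_pow, conj_I, neg_mul, I_mul_I, neg_neg, one_pow]
  have h2 : iPow (-a) * iPow a = 1 := by rw [← iPow_add, neg_add_cancel, iPow_zero]
  exact mul_right_cancel₀ (iPow_ne_zero a) (h1.trans h2.symm)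

/-- `|i^a|² = 1`. [cite: DehaeneDemoor2003, Theorem 5] -/
private theorem normSq_iPow (a : ZMod 4) : Complex.normSq (iPow a) = 1 := by
  unfold iPow
  rw [Complex.normSq_eq_norm_sq, norm_pow, Complex.norm_I, one_pow, one_pow]

/-- `i^{2m} = (−1)^m = ψ(m mod 2)` for an integer `m`. [cite: DehaeneDemoor2003, Theorem 5 (“(−1)^{q(x)}”)] -/
private theorem iPow_two_mul (m : ℤ) : iPow (2 * (m : ZMod 4)) = sgn₂ (m : ZMod 2) := by
  have h40 : (4 : ZMod 4) = 0 := by decide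
  have h20 : (2 : ZMod 2) = 0 := by decide
  rcases Int.even_or_odd m with ⟨q, hq⟩ | ⟨q, hq⟩
  · subst hq
    have h4 : (2 * ((q + q : ℤ) : ZMod 4)) = 0 := by
      rw [show (2 * ((q + q : ℤ) : ZMod 4)) = 4 * (q : ZMod 4) by push_cast; ring, h40, zero_mul]
    have h2 : ((q + q : ℤ) : ZMod 2) = 0 := by
      rw [show ((q + q : ℤ) : ZMod 2) = 2 * (q : ZMod 2) by push_cast; ring, h20, zero_mul]
    rw [h4, h2, iPow_zero, sgn₂_zero]
  · subst hq
    have h4 : (2 * ((2 * q + 1 : ℤ) : ZMod 4)) = 2 := by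
      rw [show (2 * ((2 * q + 1 : ℤ) : ZMod 4)) = 4 * (q : ZMod 4) + 2 by push_cast; ring, h40, zero_mul,
        zero_add]
    have h2 : ((2 * q + 1 : ℤ) : ZMod 2) = 1 := by
      rw [show ((2 * q + 1 : ℤ) : ZMod 2) = 2 * (q : ZMod 2) + 1 by push_cast; ring, h20, zero_mul, zero_add]
    rw [h4, h2, iPow_two, sgn₂_one]

/-- The lift of a sum of bits: `(x ⊕ y)_i = x_i + y_i − 2 x_i y_i` over `ℤ`. [cite: DehaeneDemoor2003, Theorem 5 (binary arithmetic in the exponent)] -/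
private theorem liftZ_add (x y : Bits n) :
    liftZ (x + y) = liftZ x + liftZ y - (2 : ℤ) • (fun i => liftZ x i * liftZ y i) := by
  have key : ∀ s t : ZMod 2, (((s + t).val : ℕ) : ℤ) = (s.val : ℤ) + t.val - 2 * ((s.val : ℤ) * t.val) := by
    decide
  funext i
  simp only [liftZ, Pi.add_apply, Pi.sub_apply, Pi.smul_apply, smul_eq_mul]
  exact key (x i) (y i)

/-- The lift reduces back: `(liftZ x)_i mod 2 = x_i`. [cite: DehaeneDemoor2003, Theorem 5] -/
private theorem intCast_liftZ (x : Bits n) (i : Fin n) : ((liftZ x i : ℤ) : ZMod 2) = x i := by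
  unfold liftZ
  rw [Int.cast_natCast, ZMod.natCast_zmod_val]

/-- For a symmetric integer matrix the bilinear form is symmetric. [cite: BandyopadhyayEtAl2002, Lemma 4.3 (“S is a set of commuting operators iff A is symmetric”)] -/
private theorem dotProduct_mulVec_comm {M : Matrix (Fin n) (Fin n) ℤ} (hM : M.IsSymm) (u v : Fin n → ℤ) :
    u ⬝ᵥ (M *ᵥ v) = v ⬝ᵥ (M *ᵥ u) := by
  rw [dotProduct_mulVec, ← vecMul_transpose, hM.eq, dotProduct_comm]

/-- The same over `𝔽₂`, in the form `u ⬝ (A v) = (A u) ⬝ v`. [cite: BandyopadhyayEtAl2002, Lemma 4.3] -/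
private theorem dotProduct_mulVec_comm₂ {A : Matrix (Fin n) (Fin n) (ZMod 2)} (hA : A.IsSymm) (u v : Bits n) :
    u ⬝ᵥ (A *ᵥ v) = (A *ᵥ u) ⬝ᵥ v := by
  rw [dotProduct_mulVec, ← vecMul_transpose, hA.eq]

/-- **Completing the square mod 4**: for symmetric `M`,
`(x⊕y)ᵀM(x⊕y) = xᵀMx + yᵀMy + 2·yᵀMx + 4k`. [cite: DehaeneDemoor2003, Theorem 5 (quadratic forms over GF(2) in the exponent)] -/
private theorem quadExp_add {M : Matrix (Fin n) (Fin n) ℤ} (hM : M.IsSymm) (x y : Bits n) :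
    ∃ k : ℤ, quadExp M (x + y) = quadExp M x + quadExp M y + 2 * (liftZ y ⬝ᵥ (M *ᵥ liftZ x)) + 4 * k := by
  unfold quadExp
  rw [liftZ_add]
  set a := liftZ x
  set b := liftZ y
  set w : Fin n → ℤ := fun i => a i * b i
  refine ⟨w ⬝ᵥ (M *ᵥ w) - w ⬝ᵥ (M *ᵥ a) - w ⬝ᵥ (M *ᵥ b), ?_⟩
  have h1 := dotProduct_mulVec_comm hM a b
  have h2 := dotProduct_mulVec_comm hM a w
  have h3 := dotProduct_mulVec_comm hM b w
  simp only [sub_dotProduct, dotProduct_sub, add_dotProduct, dotProduct_add, mulVec_add, mulVec_sub,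
    mulVec_smul, smul_dotProduct, dotProduct_smul, smul_eq_mul]
  rw [h1, h2, h3]
  ring

/-- The exponent is additive in the matrix: `xᵀ(M − M')x = xᵀMx − xᵀM'x`. [cite: BandyopadhyayEtAl2002, Theorem 4.4 (the difference A_j − A_k)] -/
private theorem quadExp_sub (M M' : Matrix (Fin n) (Fin n) ℤ) (x : Bits n) :
    quadExp (M - M') x = quadExp M x - quadExp M' x := by
  unfold quadExp
  rw [sub_mulVec, dotProduct_sub]

/-- `0ᵀ M 0 = 0`. [cite: DehaeneDemoor2003, Theorem 5] -/
private theorem quadExp_zero (M : Matrix (Fin n) (Fin n) ℤ) : quadExp M 0 = 0 := by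
  unfold quadExp
  have : liftZ (0 : Bits n) = 0 := by funext i; simp [liftZ]
  rw [this, zero_dotProduct]

/-- The bilinear form mod 2: `(yᵀ M̃ x) mod 2 = y ⬝ᵥ (A *ᵥ x)` for the lift `M̃` of `A`. [cite: DehaeneDemoor2003, Theorem 5] -/
private theorem intCast_bilin (A : Matrix (Fin n) (Fin n) (ZMod 2)) (x y : Bits n) :
    (((liftZ y ⬝ᵥ (liftMat A *ᵥ liftZ x) : ℤ)) : ZMod 2) = y ⬝ᵥ (A *ᵥ x) := by
  change (Int.castRingHom (ZMod 2)) (liftZ y ⬝ᵥ (liftMat A *ᵥ liftZ x)) = _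
  rw [RingHom.map_dotProduct (Int.castRingHom (ZMod 2))]
  have hv : ((Int.castRingHom (ZMod 2)) ∘ liftZ y) = y := funext fun i => intCast_liftZ y i
  have hw : ((Int.castRingHom (ZMod 2)) ∘ fun i => (liftMat A *ᵥ liftZ x) i) = A *ᵥ x := by
    funext i
    rw [Function.comp_apply, RingHom.map_mulVec]
    have hA : (liftMat A).map (Int.castRingHom (ZMod 2)) = A := by
      ext j k
      simp [liftMat]
    have hx : ((Int.castRingHom (ZMod 2)) ∘ liftZ x) = x := funext fun i => intCast_liftZ x i
    rw [hA, hx]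
  rw [hv]
  exact congrArg _ hw

/-- The lift of a symmetric matrix is symmetric. [cite: BandyopadhyayEtAl2002, Theorem 4.4] -/
private theorem isSymm_liftMat {A : Matrix (Fin n) (Fin n) (ZMod 2)} (hA : A.IsSymm) : (liftMat A).IsSymm := by
  unfold liftMat
  exact hA.map _

/-- **The `ℤ/4` quadratic Gauss sum over `𝔽₂ⁿ`**: if `M` is a symmetric integer matrix whose bilinear
form reduces mod 2 to that of a symmetric nonsingular `A`, then `|Σ_{x∈𝔽₂ⁿ} i^{xᵀMx} (−1)^{c·x}|² = 2ⁿ`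
for every `c` (completing the square: the double sum collapses onto `h = 0` because
`Σ_y (−1)^{(Ah)·y} = 2ⁿ[Ah = 0]`).
[cite: BandyopadhyayEtAl2002, Theorem 4.4 with Theorem 3.2 (unbiasedness of the eigenbases of disjoint classes) — here by direct evaluation] -/
theorem normSq_quadGaussSum₂ {A : Matrix (Fin n) (Fin n) (ZMod 2)}
    (hreg : ∀ h : Bits n, A *ᵥ h = 0 → h = 0) {M : Matrix (Fin n) (Fin n) ℤ} (hM : M.IsSymm)
    (hMA : ∀ y h : Bits n, (((liftZ h ⬝ᵥ (M *ᵥ liftZ y) : ℤ)) : ZMod 2) = (A *ᵥ h) ⬝ᵥ y) (c : Bits n) :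
    Complex.normSq (∑ x : Bits n, iPow (quadExp M x : ZMod 4) * sgnVec c x) = (2 : ℝ) ^ n := by
  have h40 : (4 : ZMod 4) = 0 := by decide
  apply Complex.ofReal_injective
  rw [Complex.normSq_eq_conj_mul_self, map_sum, sum_mul_sum]
  push_cast
  have hinner : ∀ y : Bits n,
      ∑ x : Bits n, conj (iPow (quadExp M y : ZMod 4) * sgnVec c y) * (iPow (quadExp M x : ZMod 4) * sgnVec c x) =
        ∑ h : Bits n, iPow (quadExp M h : ZMod 4) * sgnVec c h * sgnVec (A *ᵥ h) y := by
    intro y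
    rw [← Equiv.sum_comp (Equiv.addLeft y)]
    refine sum_congr rfl fun h _ => ?_
    rw [Equiv.coe_addLeft]
    obtain ⟨k, hk⟩ := quadExp_add hM y h
    rw [map_mul, conj_iPow, conj_sgnVec, sgnVec_add_right, hk]
    have hphase : iPow (((quadExp M y + quadExp M h + 2 * (liftZ h ⬝ᵥ (M *ᵥ liftZ y)) + 4 * k : ℤ)) : ZMod 4) =
        iPow (quadExp M y : ZMod 4) * iPow (quadExp M h : ZMod 4) * sgnVec (A *ᵥ h) y := by
      rw [Int.cast_add, Int.cast_mul, Int.cast_ofNat, h40, zero_mul, add_zero, Int.cast_add, Int.cast_add,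
        Int.cast_mul, Int.cast_ofNat, iPow_add, iPow_add, iPow_two_mul, hMA y h, sgnVec_eq_sgn₂_dotProduct]
    rw [hphase]
    have hs := sgnVec_mul_self c y
    have hi : iPow (-(quadExp M y : ZMod 4)) * iPow (quadExp M y : ZMod 4) = 1 := by
      rw [← iPow_add, neg_add_cancel, iPow_zero]
    calc iPow (-(quadExp M y : ZMod 4)) * sgnVec c y *
          (iPow (quadExp M y : ZMod 4) * iPow (quadExp M h : ZMod 4) * sgnVec (A *ᵥ h) y *
            (sgnVec c y * sgnVec c h))
        = (iPow (-(quadExp M y : ZMod 4)) * iPow (quadExp M y : ZMod 4)) * (sgnVec c y * sgnVec c y) *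
            (iPow (quadExp M h : ZMod 4) * sgnVec c h * sgnVec (A *ᵥ h) y) := by ring
      _ = iPow (quadExp M h : ZMod 4) * sgnVec c h * sgnVec (A *ᵥ h) y := by rw [hi, hs, one_mul, one_mul]
  simp_rw [hinner]
  rw [sum_comm]
  simp_rw [← mul_sum, sum_sgnVec]
  have hiff : ∀ h : Bits n, (A *ᵥ h = 0) ↔ h = 0 := fun h =>
    ⟨hreg h, fun hh => by rw [hh, mulVec_zero]⟩
  simp_rw [hiff, mul_ite, mul_zero]
  rw [Finset.sum_ite_eq' univ (0 : Bits n), if_pos (mem_univ _), quadExp_zero, sgnVec_zero_right,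
    Int.cast_zero, iPow_zero]
  ring

/-- `(1/√2)ⁿ · (1/√2)ⁿ = 2^{−n}`. [cite: BandyopadhyayEtAl2002, §4.2 (the prefactor 1/2 of the d = 4 bases)] -/
private theorem sqrtHalfPow_mul_self (n : ℕ) :
    (((((Real.sqrt 2)⁻¹ : ℝ) : ℂ) ^ n) * ((((Real.sqrt 2)⁻¹ : ℝ) : ℂ) ^ n)) = ((2 : ℂ) ^ n)⁻¹ := by
  rw [← mul_pow, ← Complex.ofReal_mul, ← mul_inv, Real.mul_self_sqrt zero_le_two, ← inv_pow]
  push_cast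
  ring

/-- **Inner products of the quadratic-form vectors**:
`⟨v_{M,c}|v_{M',c'}⟩ = 2^{−n} Σ_x i^{xᵀ(M'−M)x} (−1)^{(c+c')·x}`. [cite: BandyopadhyayEtAl2002, Theorem 4.4 (proof via the difference A_j − A_k)] -/
theorem braket_quadVec (M M' : Matrix (Fin n) (Fin n) ℤ) (c c' : Bits n) :
    braket (quadVec M c) (quadVec M' c') =
      ((2 : ℂ) ^ n)⁻¹ * ∑ x : Bits n, iPow (quadExp (M' - M) x : ZMod 4) * sgnVec (c + c') x := by
  unfold braket quadVec
  rw [dotProduct, mul_sum]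
  refine sum_congr rfl fun x _ => ?_
  rw [Pi.star_apply, star_mul', star_mul', star_pow, Complex.star_def, Complex.conj_ofReal, conj_iPow,
    conj_sgnVec, quadExp_sub, Int.cast_sub, sgnVec_add_left]
  have : iPow (-(quadExp M x : ZMod 4)) * iPow (quadExp M' x : ZMod 4) =
      iPow ((quadExp M' x : ZMod 4) - (quadExp M x : ZMod 4)) := by
    rw [← iPow_add]; congr 1; ring
  calc (((Real.sqrt 2)⁻¹ : ℝ) : ℂ) ^ n * (iPow (-(quadExp M x : ZMod 4)) * sgnVec c x) *
        ((((Real.sqrt 2)⁻¹ : ℝ) : ℂ) ^ n * (iPow (quadExp M' x : ZMod 4) * sgnVec c' x))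
      = ((((Real.sqrt 2)⁻¹ : ℝ) : ℂ) ^ n * (((Real.sqrt 2)⁻¹ : ℝ) : ℂ) ^ n) *
          ((iPow (-(quadExp M x : ZMod 4)) * iPow (quadExp M' x : ZMod 4)) * (sgnVec c x * sgnVec c' x)) := by
        ring
    _ = ((2 : ℂ) ^ n)⁻¹ * (iPow ((quadExp M' x : ZMod 4) - (quadExp M x : ZMod 4)) *
          (sgnVec c x * sgnVec c' x)) := by rw [sqrtHalfPow_mul_self, this]

/-- Orthonormality of each basis `B_A = {v_{Ã,c}}_c`: `⟨v_{M,c}|v_{M,c'}⟩ = [c = c']`.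
[cite: BandyopadhyayEtAl2002, Theorem 4.4 (each class yields an orthonormal eigenbasis)] -/
theorem braket_quadVec_same (M : Matrix (Fin n) (Fin n) ℤ) (c c' : Bits n) :
    braket (quadVec M c) (quadVec M c') = if c = c' then 1 else 0 := by
  rw [braket_quadVec, sub_self]
  have hq : ∀ x : Bits n, quadExp (0 : Matrix (Fin n) (Fin n) ℤ) x = 0 := fun x => by
    unfold quadExp; rw [zero_mulVec, dotProduct_zero]
  simp_rw [hq, Int.cast_zero, iPow_zero, one_mul]
  rw [sum_sgnVec]
  have h2 : ((2 : ℂ) ^ n) ≠ 0 := pow_ne_zero _ two_ne_zero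
  have h20 : (2 : ZMod 2) = 0 := by decide
  have hcc : (c + c' = 0) ↔ c = c' := by
    constructor
    · intro h
      funext i
      have hi := congr_fun h i
      rw [Pi.add_apply, Pi.zero_apply] at hi
      rw [← ZMod.neg_eq_self_mod_two (c' i)]
      exact eq_neg_of_add_eq_zero_left hi
    · rintro rfl
      funext i
      rw [Pi.add_apply, Pi.zero_apply, ← two_mul, h20, zero_mul]
  by_cases h : c = c'
  · rw [if_pos (hcc.2 h), if_pos h, inv_mul_cancel₀ h2]
  · rw [if_neg (fun hh => h (hcc.1 hh)), if_neg h, mul_zero]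

/-- Orthonormality of the standard basis. [cite: BandyopadhyayEtAl2002, Theorem 4.4 (the class (0|𝟙))] -/
theorem braket_basisVec {W : Type*} [Fintype W] [DecidableEq W] (b b' : W) :
    braket (basisVec b) (basisVec b') = if b = b' then 1 else 0 := by
  unfold braket
  rw [dotProduct, Finset.sum_eq_single b]
  · simp [basisVec]
  · intro x _ hx; simp [basisVec, hx]
  · simp

/-- The standard basis is unbiased to every `B_A`: `|⟨b|v_{M,c}⟩|² = 2^{−n}`.
[cite: BandyopadhyayEtAl2002, Theorem 4.4] -/
theorem overlapSq_basisVec_quadVec (b : Bits n) (M : Matrix (Fin n) (Fin n) ℤ) (c : Bits n) :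
    overlapSq (basisVec b) (quadVec M c) = 1 / (2 : ℝ) ^ n := by
  unfold overlapSq braket
  rw [dotProduct, Finset.sum_eq_single b]
  · simp only [basisVec, if_true, Pi.star_apply, star_one, one_mul, quadVec]
    rw [Complex.normSq_mul, Complex.normSq_mul, normSq_iPow, normSq_sgnVec, mul_one, mul_one,
      map_pow, Complex.normSq_ofReal, ← mul_inv, Real.mul_self_sqrt zero_le_two, inv_pow, one_div]
  · intro x _ hx; simp [basisVec, hx]
  · simp

/-- **Distinct classes give unbiased bases**: for symmetric `A, A'` with `A' − A` nonsingular,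
`|⟨v_{Ã,c}|v_{Ã',c'}⟩|² = 2^{−n}`. [cite: BandyopadhyayEtAl2002, Theorem 4.4] -/
theorem overlapSq_quadVec {A A' : Matrix (Fin n) (Fin n) (ZMod 2)} (hA : A.IsSymm) (hA' : A'.IsSymm)
    (hreg : ∀ h : Bits n, (A' - A) *ᵥ h = 0 → h = 0) (c c' : Bits n) :
    overlapSq (quadVec (liftMat A) c) (quadVec (liftMat A') c') = 1 / (2 : ℝ) ^ n := by
  unfold overlapSq
  rw [braket_quadVec, Complex.normSq_mul]
  have hsymm : (liftMat A' - liftMat A).IsSymm := (isSymm_liftMat hA').sub (isSymm_liftMat hA)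
  have hAA : (A' - A).IsSymm := hA'.sub hA
  have hMA : ∀ y h : Bits n,
      (((liftZ h ⬝ᵥ ((liftMat A' - liftMat A) *ᵥ liftZ y) : ℤ)) : ZMod 2) = ((A' - A) *ᵥ h) ⬝ᵥ y := by
    intro y h
    rw [sub_mulVec, dotProduct_sub, Int.cast_sub, intCast_bilin, intCast_bilin, ← dotProduct_sub,
      ← sub_mulVec, dotProduct_mulVec_comm₂ hAA]
  rw [normSq_quadGaussSum₂ hreg hsymm hMA (c + c'), Complex.normSq_inv, map_pow]
  have h4 : Complex.normSq 2 = 4 := by norm_num [Complex.normSq_apply]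
  rw [h4, show (4 : ℝ) ^ n = 2 ^ n * 2 ^ n by rw [← mul_pow]; norm_num]
  have h2 : (2 : ℝ) ^ n ≠ 0 := pow_ne_zero _ two_ne_zero
  field_simp

/-! #### The bases are the common eigenbases of BBRV's commuting classes `(0|𝟙)` and `(𝟙|A)` -/

/-- BBRV's Pauli operators on `ℂ^{2ⁿ}` as matrices in the computational basis:
“`X_p(α)Z_p(β)|a⟩ = ω^{a·β}|a+α⟩`”, here `p = 2`, `ω = −1`. [cite: BandyopadhyayEtAl2002, §4.1 (display “X_p(α)Z_p(β)|a⟩ = ω^{a·β}|a+α⟩, a ∈ 𝔽_p^m”)] -/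
def weyl₂ (α β : Bits n) : Matrix (Bits n) (Bits n) ℂ :=
  Matrix.of fun x a => if x = a + α then sgnVec β a else 0

/-- Action on coefficient vectors: `(X(α)Z(β)v)(x) = (−1)^{β·(x+α)} v(x+α)`. [cite: BandyopadhyayEtAl2002, §4.1] -/
theorem weyl₂_mulVec_apply (α β : Bits n) (v : Bits n → ℂ) (x : Bits n) :
    (weyl₂ α β).mulVec v x = sgnVec β (x + α) * v (x + α) := by
  have h2 : ∀ t : ZMod 2, t + t = 0 := by decide
  have hx : x = x + α + α := by
    funext i; rw [Pi.add_apply, Pi.add_apply, add_assoc, h2, add_zero]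
  rw [Matrix.mulVec, dotProduct, Finset.sum_eq_single (x + α)]
  · rw [weyl₂, Matrix.of_apply, if_pos hx]
  · intro a _ ha
    have hne : x ≠ a + α := by
      intro h; apply ha
      rw [h]; funext i; rw [Pi.add_apply, Pi.add_apply, add_assoc, h2, add_zero]
    rw [weyl₂, Matrix.of_apply, if_neg hne, zero_mul]
  · intro h; exact absurd (mem_univ _) h

/-- **The standard basis is the common eigenbasis of the class `(0|𝟙)`**: `Z(β)|b⟩ = (−1)^{β·b}|b⟩`.
[cite: BandyopadhyayEtAl2002, Theorem 4.4 (“represented by the matrices (0_m|𝟙_m), …”)] -/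
theorem weyl₂_zero_mulVec_basisVec (β b : Bits n) :
    (weyl₂ 0 β).mulVec (basisVec b) = sgnVec β b • (basisVec b : Bits n → ℂ) := by
  funext x
  rw [weyl₂_mulVec_apply, add_zero, Pi.smul_apply, smul_eq_mul]
  by_cases h : x = b
  · subst h; rfl
  · simp [basisVec, h]

/-- **The quadratic-form basis `{v_{Ã,c}}_c` is the common eigenbasis of BBRV's class `(𝟙|A)`**: for
symmetric `A` over `𝔽₂` and every `α ∈ 𝔽₂ⁿ`,
`X(α)Z(Aα) v_{Ã,c} = i^{αᵀÃα} (−1)^{αᵀAα + c·α} v_{Ã,c}` — so the `2ⁿ` commuting operators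
`X(α)Z(αA)` of the class act diagonally in this basis, with the sign pattern `c` separating the
eigenvectors. [cite: BandyopadhyayEtAl2002, Theorem 4.4 (“the ℓ+1 bases … are represented by the matrices (0_m|𝟙_m), (𝟙_m|A_1), …, (𝟙_m|A_ℓ)”), Lemma 4.3] [cite: DehaeneDemoor2003, Theorem 5] -/
theorem weyl₂_mulVec_quadVec {A : Matrix (Fin n) (Fin n) (ZMod 2)} (hA : A.IsSymm) (α c : Bits n) :
    (weyl₂ α (A *ᵥ α)).mulVec (quadVec (liftMat A) c) =
      (iPow (quadExp (liftMat A) α : ZMod 4) * sgnVec (A *ᵥ α) α * sgnVec c α) •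
        (quadVec (liftMat A) c : Bits n → ℂ) := by
  have h40 : (4 : ZMod 4) = 0 := by decide
  funext x
  rw [weyl₂_mulVec_apply, Pi.smul_apply, smul_eq_mul]
  simp only [quadVec]
  obtain ⟨k, hk⟩ := quadExp_add (isSymm_liftMat hA) x α
  rw [hk, sgnVec_add_right c x α, sgnVec_add_right (A *ᵥ α) x α]
  have hphase : iPow (((quadExp (liftMat A) x + quadExp (liftMat A) α +
        2 * (liftZ α ⬝ᵥ (liftMat A *ᵥ liftZ x)) + 4 * k : ℤ)) : ZMod 4) =
      iPow (quadExp (liftMat A) x : ZMod 4) * iPow (quadExp (liftMat A) α : ZMod 4) * sgnVec (A *ᵥ α) x := by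
    rw [Int.cast_add, Int.cast_mul, Int.cast_ofNat, h40, zero_mul, add_zero, Int.cast_add, Int.cast_add,
      Int.cast_mul, Int.cast_ofNat, iPow_add, iPow_add, iPow_two_mul, intCast_bilin A x α,
      dotProduct_mulVec_comm₂ hA α x, sgnVec_eq_sgn₂_dotProduct]
  rw [hphase]
  have hs := sgnVec_mul_self (A *ᵥ α) x
  calc sgnVec (A *ᵥ α) x * sgnVec (A *ᵥ α) α *
        ((((Real.sqrt 2)⁻¹ : ℝ) : ℂ) ^ n *
          (iPow (quadExp (liftMat A) x : ZMod 4) * iPow (quadExp (liftMat A) α : ZMod 4) * sgnVec (A *ᵥ α) x *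
            (sgnVec c x * sgnVec c α)))
      = (sgnVec (A *ᵥ α) x * sgnVec (A *ᵥ α) x) *
          (iPow (quadExp (liftMat A) α : ZMod 4) * sgnVec (A *ᵥ α) α * sgnVec c α *
            ((((Real.sqrt 2)⁻¹ : ℝ) : ℂ) ^ n * (iPow (quadExp (liftMat A) x : ZMod 4) * sgnVec c x))) := by
        ring
    _ = iPow (quadExp (liftMat A) α : ZMod 4) * sgnVec (A *ᵥ α) α * sgnVec c α *
          ((((Real.sqrt 2)⁻¹ : ℝ) : ℂ) ^ n * (iPow (quadExp (liftMat A) x : ZMod 4) * sgnVec c x)) := by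
        rw [hs, one_mul]

/-- **BBRV Theorem 4.4 for `p = 2`, with explicit eigenbases**: a symmetric spread set `{A_λ}_{λ∈ι}` over `𝔽₂`
yields `|ι| + 1` mutually unbiased bases of `ℂ^{2ⁿ}` — the standard basis and the quadratic-form bases
`{2^{−n/2} i^{xᵀÃ_λx}(−1)^{c·x}}_c`. [cite: BandyopadhyayEtAl2002, Theorem 4.4] [cite: KlappeneckerRoetteler2005, §2 Construction III] -/
theorem spreadMUB_isMUBFamily {ι : Type*} {A : ι → Matrix (Fin n) (Fin n) (ZMod 2)} (hA : IsSymmSpread A) :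
    IsMUBFamily (spreadMUB A) where
  card_eq := rfl
  orthonormal := by
    rintro (_ | l) b b'
    · exact braket_basisVec b b'
    · exact braket_quadVec_same _ b b'
  unbiased := by
    have hN : (Fintype.card (Bits n) : ℝ) = 2 ^ n := by
      rw [Fintype.card_fun, ZMod.card, Fintype.card_fin]; push_cast; rfl
    rintro (_ | l) (_ | m) hne b b'
    · exact absurd rfl hne
    · rw [spreadMUB, spreadMUB, overlapSq_basisVec_quadVec, hN]
    · rw [spreadMUB, spreadMUB, overlapSq_comm, overlapSq_basisVec_quadVec, hN]
    · have hlm : l ≠ m := fun h => hne (by rw [h])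
      rw [spreadMUB, spreadMUB, overlapSq_quadVec (hA.symm l) (hA.symm m) (hA.regular m l (Ne.symm hlm)), hN]

/-- Hence, when the spread has `2ⁿ` members, the `2ⁿ(2ⁿ+1)` vectors form a complex projective 2-design in
`ℂ^{2ⁿ}` (Klappenecker–Rötteler Theorem 4). [cite: BandyopadhyayEtAl2002, Theorem 4.4 (ℓ = p^m: a complete set)] [cite: KlappeneckerRoetteler2005, Theorem 4] -/
theorem spreadMUB_isStateTwoDesign {ι : Type*} [Fintype ι] [DecidableEq ι]
    {A : ι → Matrix (Fin n) (Fin n) (ZMod 2)} (hA : IsSymmSpread A) (hι : Fintype.card ι = 2 ^ n) :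
    IsStateTwoDesign (fun q : Option ι × Bits n => spreadMUB A q.1 q.2) :=
  (spreadMUB_isMUBFamily hA).isStateTwoDesign (by
    rw [Fintype.card_option, hι, Fintype.card_fun, ZMod.card, Fintype.card_fin])

/-! #### BBRV's examples `d = 4` and `d = 8` (two and three qubits) -/

/-- BBRV Example `d = 4`: the symmetric spread `(0 0;0 0), (1 0;0 1), (0 1;1 1), (1 1;1 0)` over `𝔽₂`
(from the irreducible polynomial `x² + x + 1`). [cite: BandyopadhyayEtAl2002, §4.2 Example d = 4, eq. (d=4-example)] -/
def bbrvSpread₂ : Fin 4 → Matrix (Fin 2) (Fin 2) (ZMod 2) :=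
  ![!![0, 0; 0, 0], !![1, 0; 0, 1], !![0, 1; 1, 1], !![1, 1; 1, 0]]

/-- The `d = 4` matrices form a symmetric spread (differences nonsingular — checked by `decide`).
[cite: BandyopadhyayEtAl2002, §4.2 Example d = 4] -/
theorem bbrvSpread₂_isSymmSpread : IsSymmSpread bbrvSpread₂ where
  symm := by decide
  regular := by decide

/-- Hence five MUBs of `ℂ⁴` and a 2-design of `20` two-qubit stabilizer states (BBRV's `B_0,…,B_4`).
[cite: BandyopadhyayEtAl2002, §4.2 Example d = 4 (“B_1 = ½(…), …, B_4”)] [cite: KlappeneckerRoetteler2005, Theorem 4] -/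
theorem bbrvSpread₂_isStateTwoDesign :
    IsStateTwoDesign (fun q : Option (Fin 4) × Bits 2 => spreadMUB bbrvSpread₂ q.1 q.2) :=
  spreadMUB_isStateTwoDesign bbrvSpread₂_isSymmSpread (by simp)

/-- BBRV Example `d = 8`: “`A_1 = 0_3`, `A_2 = 𝟙_3`, `A_3 = (0 1 0;1 1 1;0 1 1)`, `A_4 = (0 0 1;0 1 1;1 1 0)`,
`A_5 = (1 1 0;1 0 1;0 1 0)`, `A_6 = (1 0 1;0 0 1;1 1 1)`, `A_7 = (0 1 1;1 0 0;1 0 1)`, `A_8 = (1 1 1;1 1 0;1 0 0)`”.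
[cite: BandyopadhyayEtAl2002, §4.2 Example d = 8] -/
def bbrvSpread₃ : Fin 8 → Matrix (Fin 3) (Fin 3) (ZMod 2) :=
  ![!![0, 0, 0; 0, 0, 0; 0, 0, 0], !![1, 0, 0; 0, 1, 0; 0, 0, 1], !![0, 1, 0; 1, 1, 1; 0, 1, 1],
    !![0, 0, 1; 0, 1, 1; 1, 1, 0], !![1, 1, 0; 1, 0, 1; 0, 1, 0], !![1, 0, 1; 0, 0, 1; 1, 1, 1],
    !![0, 1, 1; 1, 0, 0; 1, 0, 1], !![1, 1, 1; 1, 1, 0; 1, 0, 0]]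

/-- The `d = 8` matrices form a symmetric spread (all 28 differences nonsingular — checked by `decide`).
[cite: BandyopadhyayEtAl2002, §4.2 Example d = 8 (“determine a set 9 mutually unbiased bases on ℂ⁸”)] -/
theorem bbrvSpread₃_isSymmSpread : IsSymmSpread bbrvSpread₃ where
  symm := by decide
  regular := by decide

/-- Hence **nine MUBs of `ℂ⁸` and a 2-design of `72` three-qubit stabilizer states**.
[cite: BandyopadhyayEtAl2002, §4.2 Example d = 8] [cite: KlappeneckerRoetteler2005, Theorem 4] -/
theorem bbrvSpread₃_isStateTwoDesign :
    IsStateTwoDesign (fun q : Option (Fin 8) × Bits 3 => spreadMUB bbrvSpread₃ q.1 q.2) :=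
  spreadMUB_isStateTwoDesign bbrvSpread₃_isSymmSpread (by simp)

/-! #### The complete set for every `n` from the trace-form spread of `𝔽_{2ⁿ}` (`traceSpread 2 n`) -/

/-- **A complete set of `2ⁿ + 1` mutually unbiased bases of `ℂ^{2ⁿ}` for every `n ≥ 1`** — the standard
basis and the `2ⁿ` quadratic-form (stabilizer) bases of the trace-form spread.
[cite: BandyopadhyayEtAl2002, Theorem 4.4 with §4.3] [cite: WoottersFields1989, (2ⁿ + 1 MUBs of ℂ^{2ⁿ})] [cite: KlappeneckerRoetteler2005, §2 (“M(p^r) = p^r + 1”)] -/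
theorem traceSpread_isMUBFamily (n : ℕ) (hn : n ≠ 0) : IsMUBFamily (spreadMUB (traceSpread 2 n hn)) :=
  spreadMUB_isMUBFamily (traceSpread_isSymmSpread 2 n hn)

/-- **Hence, for every `n ≥ 1`, the `2ⁿ(2ⁿ + 1)` n-qubit stabilizer states of the complete MUB set form a
complex projective 2-design in `ℂ^{2ⁿ}`** (Klappenecker–Rötteler Theorem 4) — witnesses of the tree's
`IsStateTwoDesign` in the dimension `N = 2ⁿ` of the qubit rows.
[cite: KlappeneckerRoetteler2005, Theorem 4] [cite: BandyopadhyayEtAl2002, Theorem 4.4, §4.3] [cite: ZhuEtAl2016, §2.1 (“complete sets of mutually unbiased bases (MUB) … the set of stabilizer states”)] -/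
theorem traceSpread_isStateTwoDesign (n : ℕ) (hn : n ≠ 0) [Fintype (GaloisField 2 n)]
    [DecidableEq (GaloisField 2 n)] :
    IsStateTwoDesign (fun q : Option (GaloisField 2 n) × Bits n => spreadMUB (traceSpread 2 n hn) q.1 q.2) :=
  spreadMUB_isStateTwoDesign (traceSpread_isSymmSpread 2 n hn)
    (by rw [← Nat.card_eq_fintype_card, GaloisField.card 2 n hn])

end QubitSpread

/-! ### v2 — Odd prime powers `N = pⁿ`: BBRV Theorem 4.4 for odd `p` with explicit eigenbases
(Wootters–Fields in every odd prime-power dimension)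

For odd `p` the common eigenbasis of the class `(𝟙|2A)`, `A` symmetric over `𝔽_p`, is
`v_{A,c}(x) = p^{−n/2} ω_p^{xᵀAx + c·x}`, `c ∈ 𝔽_pⁿ` (proved below: `weylOdd_mulVec_oddQuadVec`;
`A ↦ 2A` permutes symmetric spreads, so these are Theorem 4.4's bases for the spread `{2A_λ}`)
[cite: BandyopadhyayEtAl2002, Theorem 4.4, §4.1 (p odd: ω a primitive p-th root of unity)] — for
`n = 1` exactly Construction I above
[cite: KlappeneckerRoetteler2005, §2 Construction I (“ω_p^{tr(ax²+bx)}”)].  Unbiasedness of `B_A` and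
`B_{A'}` is the quadratic Gauss sum `|Σ_{x∈𝔽_pⁿ} ω_p^{xᵀMx + c·x}|² = pⁿ` for `M = A' − A` symmetric
nonsingular (complete the square; `2` is invertible).  With the trace-form spread `traceSpread p n`
this gives `pⁿ + 1` MUBs of `ℂ^{pⁿ}` and a 2-design of `pⁿ(pⁿ+1)` vectors for every odd prime `p` and
every `n ≥ 1` [cite: WoottersFields1989, (N + 1 MUBs in every prime-power dimension N)]. -/

section OddPrimePower

open ZMod

variable (p : ℕ) [Fact p.Prime] {n : ℕ}

/-- Digit strings `𝔽_pⁿ`, the computational-basis labels of `ℂ^{pⁿ} = (ℂ^p)^{⊗n}`. [cite: BandyopadhyayEtAl2002, §4 (“ℂ^{p^m}”)] -/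
abbrev Digits (p n : ℕ) := Fin n → ZMod p

/-- The vector `v_{A,c}(x) = p^{−n/2} ω_p^{xᵀAx + c·x}` attached to a symmetric `A` over `𝔽_p` and `c ∈ 𝔽_pⁿ`
(the common eigenvector of the class `(𝟙|2A)`, see `weylOdd_mulVec_oddQuadVec`).
[cite: BandyopadhyayEtAl2002, Theorem 4.4 (the basis of the class (𝟙|A')), §4.1] [cite: WoottersFields1989, (the vectors of the prime-power construction)] -/
def oddQuadVec (A : Matrix (Fin n) (Fin n) (ZMod p)) (c : Digits p n) : Digits p n → ℂ :=
  fun x => (((Real.sqrt p)⁻¹ : ℝ) : ℂ) ^ n * (stdAddChar (x ⬝ᵥ (A *ᵥ x) + c ⬝ᵥ x) : ℂ)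

/-- The `ℓ + 1` bases of Theorem 4.4 for odd `p` (for the spread `{2A_λ}`): `none ↦` the standard basis,
`some λ ↦ {v_{A_λ,c}}_c`. [cite: BandyopadhyayEtAl2002, Theorem 4.4] -/
def oddSpreadMUB {ι : Type*} (A : ι → Matrix (Fin n) (Fin n) (ZMod p)) :
    Option ι → Digits p n → Digits p n → ℂ
  | none => basisVec
  | some l => oddQuadVec p (A l)

variable {p}

/-- `ω_p^{Σ_i f_i} = Π_i ω_p^{f_i}`. [cite: BandyopadhyayEtAl2002, §3 Lemma 3.3 (characters)] -/
private theorem stdAddChar_sum {α : Type*} (s : Finset α) (f : α → ZMod p) :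
    (stdAddChar (∑ i ∈ s, f i) : ℂ) = ∏ i ∈ s, (stdAddChar (f i) : ℂ) := by
  classical
  induction s using Finset.induction_on with
  | empty => simp
  | insert a s ha ih => rw [sum_insert ha, prod_insert ha, AddChar.map_add_eq_mul, ih]

/-- Character orthogonality on `𝔽_pⁿ`: `Σ_y ω_p^{a·y} = pⁿ [a = 0]`. [cite: BandyopadhyayEtAl2002, §3 Lemma 3.3 (orthogonality of characters)] -/
private theorem sum_stdAddChar_dotProduct (a : Digits p n) :
    ∑ y : Digits p n, (stdAddChar (a ⬝ᵥ y) : ℂ) = if a = 0 then (p : ℂ) ^ n else 0 := by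
  simp_rw [dotProduct, stdAddChar_sum]
  rw [← Fintype.piFinset_univ, ← Finset.prod_univ_sum (fun _ : Fin n => (Finset.univ : Finset (ZMod p)))
    (fun i t => (stdAddChar (a i * t) : ℂ))]
  have h1 : ∀ i, ∑ t : ZMod p, (stdAddChar (a i * t) : ℂ) = if a i = 0 then (p : ℂ) else 0 := by
    intro i
    rw [← sum_stdAddChar_mul (a i)]
    exact sum_congr rfl fun t _ => by rw [mul_comm]
  simp_rw [h1]
  by_cases ha : a = 0
  · subst ha
    simp
  · rw [if_neg ha]
    obtain ⟨i, hi⟩ := Function.ne_iff.mp ha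
    exact prod_eq_zero (mem_univ i) (if_neg hi)

omit [Fact p.Prime] in
/-- `(1/√p)ⁿ · (1/√p)ⁿ = p^{−n}`. [cite: BandyopadhyayEtAl2002, Theorem 4.4 (normalisation)] -/
private theorem sqrtInvPow_mul_self (n : ℕ) :
    ((((Real.sqrt p)⁻¹ : ℝ) : ℂ) ^ n) * ((((Real.sqrt p)⁻¹ : ℝ) : ℂ) ^ n) = (((p : ℂ)) ^ n)⁻¹ := by
  rw [← mul_pow, sqrtInv_mul_sqrtInv, inv_pow]

/-- Expanding the exponent at `y + h` for symmetric `M` (completing the square, `p` odd not yet used):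
`f(y+h) = f(y) + (f(h) + 2(Mh)·y)` with `f(x) = xᵀMx + c·x`. [cite: BandyopadhyayEtAl2002, Theorem 4.4] -/
private theorem quadOdd_add {M : Matrix (Fin n) (Fin n) (ZMod p)} (hM : M.IsSymm) (c y h : Digits p n) :
    (y + h) ⬝ᵥ (M *ᵥ (y + h)) + c ⬝ᵥ (y + h) =
      (y ⬝ᵥ (M *ᵥ y) + c ⬝ᵥ y) + ((h ⬝ᵥ (M *ᵥ h) + c ⬝ᵥ h) + ((2 : ZMod p) • (M *ᵥ h)) ⬝ᵥ y) := by
  rw [mulVec_add, add_dotProduct, dotProduct_add, dotProduct_add, dotProduct_add, smul_dotProduct,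
    dotProduct_mulVec_of_isSymm hM h y, dotProduct_comm y (M *ᵥ h), smul_eq_mul]
  ring

/-- **The quadratic Gauss sum over `𝔽_pⁿ`, `p` odd**: for `M` symmetric nonsingular and any `c`,
`|Σ_{x∈𝔽_pⁿ} ω_p^{xᵀMx + c·x}|² = pⁿ` (the double sum collapses onto `h = 0` because
`Σ_y ω_p^{2(Mh)·y} = pⁿ[2Mh = 0]` and `2` is invertible). [cite: BandyopadhyayEtAl2002, Theorem 4.4 (unbiasedness of the classes (𝟙|A_j), (𝟙|A_k))] [cite: WoottersFields1989, (unbiasedness via Gauss sums)] -/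
theorem normSq_quadGaussSum_odd (hp : p ≠ 2) {M : Matrix (Fin n) (Fin n) (ZMod p)} (hM : M.IsSymm)
    (hreg : ∀ h : Digits p n, M *ᵥ h = 0 → h = 0) (c : Digits p n) :
    Complex.normSq (∑ x : Digits p n, (stdAddChar (x ⬝ᵥ (M *ᵥ x) + c ⬝ᵥ x) : ℂ)) = (p : ℝ) ^ n := by
  have h2 : (2 : ZMod p) ≠ 0 := by
    intro h
    have h' : ((2 : ℕ) : ZMod p) = 0 := by exact_mod_cast h
    rw [ZMod.natCast_eq_zero_iff] at h'
    exact hp ((Nat.prime_dvd_prime_iff_eq (Fact.out : p.Prime) Nat.prime_two).1 h')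
  apply Complex.ofReal_injective
  rw [Complex.normSq_eq_conj_mul_self, map_sum, sum_mul_sum]
  push_cast
  have hinner : ∀ y : Digits p n,
      ∑ x : Digits p n, conj (stdAddChar (y ⬝ᵥ (M *ᵥ y) + c ⬝ᵥ y) : ℂ) *
          (stdAddChar (x ⬝ᵥ (M *ᵥ x) + c ⬝ᵥ x) : ℂ) =
        ∑ h : Digits p n, (stdAddChar (h ⬝ᵥ (M *ᵥ h) + c ⬝ᵥ h) : ℂ) *
          (stdAddChar (((2 : ZMod p) • (M *ᵥ h)) ⬝ᵥ y) : ℂ) := by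
    intro y
    rw [← Equiv.sum_comp (Equiv.addLeft y)]
    refine sum_congr rfl fun h _ => ?_
    rw [Equiv.coe_addLeft, ← Complex.star_def, star_stdAddChar, ← AddChar.map_add_eq_mul,
      ← AddChar.map_add_eq_mul, quadOdd_add hM c y h]
    congr 1
    ring
  simp_rw [hinner]
  rw [sum_comm]
  simp_rw [← mul_sum, sum_stdAddChar_dotProduct]
  have hiff : ∀ h : Digits p n, ((2 : ZMod p) • (M *ᵥ h) = 0) ↔ h = 0 := fun h => by
    rw [smul_eq_zero, or_iff_right h2]
    exact ⟨hreg h, fun hh => by rw [hh, mulVec_zero]⟩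
  simp_rw [hiff, mul_ite, mul_zero]
  rw [Finset.sum_ite_eq' univ (0 : Digits p n), if_pos (mem_univ _), mulVec_zero, dotProduct_zero,
    dotProduct_zero, add_zero, AddChar.map_zero_eq_one]
  ring

/-- **Inner products of the `ω_p`-quadratic vectors**:
`⟨v_{A,c}|v_{A',c'}⟩ = p^{−n} Σ_x ω_p^{xᵀ(A'−A)x + (c'−c)·x}`. [cite: BandyopadhyayEtAl2002, Theorem 4.4 (proof via the difference A_j − A_k)] -/
theorem braket_oddQuadVec (A A' : Matrix (Fin n) (Fin n) (ZMod p)) (c c' : Digits p n) :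
    braket (oddQuadVec p A c) (oddQuadVec p A' c') =
      (((p : ℂ)) ^ n)⁻¹ * ∑ x : Digits p n, (stdAddChar (x ⬝ᵥ ((A' - A) *ᵥ x) + (c' - c) ⬝ᵥ x) : ℂ) := by
  unfold braket oddQuadVec
  rw [dotProduct, mul_sum]
  refine sum_congr rfl fun x _ => ?_
  rw [Pi.star_apply, star_mul', star_pow, Complex.star_def, Complex.conj_ofReal, ← Complex.star_def,
    star_stdAddChar, mul_mul_mul_comm, sqrtInvPow_mul_self, ← AddChar.map_add_eq_mul, sub_mulVec,
    dotProduct_sub, sub_dotProduct]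
  congr 2
  ring

/-- Orthonormality of each basis `B_A`: `⟨v_{A,c}|v_{A,c'}⟩ = [c = c']`.
[cite: BandyopadhyayEtAl2002, Theorem 4.4 (each class yields an orthonormal eigenbasis)] -/
theorem braket_oddQuadVec_same (A : Matrix (Fin n) (Fin n) (ZMod p)) (c c' : Digits p n) :
    braket (oddQuadVec p A c) (oddQuadVec p A c') = if c = c' then 1 else 0 := by
  have hp0 : ((p : ℂ)) ^ n ≠ 0 := pow_ne_zero _ (by exact_mod_cast (Fact.out : p.Prime).ne_zero)
  rw [braket_oddQuadVec, sub_self]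
  simp_rw [zero_mulVec, dotProduct_zero, zero_add]
  rw [sum_stdAddChar_dotProduct]
  by_cases h : c = c'
  · subst h
    rw [sub_self, if_pos rfl, if_pos rfl, inv_mul_cancel₀ hp0]
  · rw [if_neg (sub_ne_zero.2 (Ne.symm h)), if_neg h, mul_zero]

/-- The standard basis is unbiased to every `B_A`: `|⟨b|v_{A,c}⟩|² = p^{−n}`. [cite: BandyopadhyayEtAl2002, Theorem 4.4] -/
theorem overlapSq_basisVec_oddQuadVec (b : Digits p n) (A : Matrix (Fin n) (Fin n) (ZMod p)) (c : Digits p n) :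
    overlapSq (basisVec b) (oddQuadVec p A c) = 1 / (p : ℝ) ^ n := by
  unfold overlapSq braket
  rw [dotProduct, Finset.sum_eq_single b]
  · simp only [basisVec, if_true, Pi.star_apply, star_one, one_mul, oddQuadVec]
    rw [Complex.normSq_mul, map_pow, Complex.normSq_ofReal, stdAddChar_apply, Complex.normSq_eq_norm_sq,
      Circle.norm_coe, one_pow, mul_one, ← mul_inv, Real.mul_self_sqrt (Nat.cast_nonneg p), inv_pow,
      one_div]
  · intro x _ hx; simp [basisVec, hx]
  · simp

/-- **Distinct classes give unbiased bases** (`p` odd): for symmetric `A, A'` with `A' − A` nonsingular,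
`|⟨v_{A,c}|v_{A',c'}⟩|² = p^{−n}`. [cite: BandyopadhyayEtAl2002, Theorem 4.4] [cite: WoottersFields1989, (unbiasedness in dimension pⁿ)] -/
theorem overlapSq_oddQuadVec (hp : p ≠ 2) {A A' : Matrix (Fin n) (Fin n) (ZMod p)} (hA : A.IsSymm)
    (hA' : A'.IsSymm) (hreg : ∀ h : Digits p n, (A' - A) *ᵥ h = 0 → h = 0) (c c' : Digits p n) :
    overlapSq (oddQuadVec p A c) (oddQuadVec p A' c') = 1 / (p : ℝ) ^ n := by
  have hp0 : (p : ℝ) ≠ 0 := by exact_mod_cast (Fact.out : p.Prime).ne_zero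
  unfold overlapSq
  rw [braket_oddQuadVec, Complex.normSq_mul, normSq_quadGaussSum_odd hp (hA'.sub hA) hreg (c' - c),
    Complex.normSq_inv, map_pow, Complex.normSq_natCast]
  have hpn : (p : ℝ) ^ n ≠ 0 := pow_ne_zero _ hp0
  rw [mul_pow]
  field_simp

/-! #### The bases are the common eigenbases of the classes `(0|𝟙)` and `(𝟙|2A)` -/

/-- BBRV's generalised Pauli operators on `ℂ^{pⁿ}` as matrices in the computational basis:
“`X_p(α)Z_p(β)|a⟩ = ω^{a·β}|a+α⟩, a ∈ 𝔽_p^m`”. [cite: BandyopadhyayEtAl2002, §4.1 (display “X_p(α)Z_p(β)|a⟩ = ω^{a·β}|a+α⟩”)] -/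
def weylOdd (α β : Digits p n) : Matrix (Digits p n) (Digits p n) ℂ :=
  Matrix.of fun x a => if x = a + α then (stdAddChar (a ⬝ᵥ β) : ℂ) else 0

/-- Action on coefficient vectors: `(X(α)Z(β)v)(x) = ω^{(x−α)·β} v(x−α)`. [cite: BandyopadhyayEtAl2002, §4.1] -/
theorem weylOdd_mulVec_apply (α β : Digits p n) (v : Digits p n → ℂ) (x : Digits p n) :
    (weylOdd α β).mulVec v x = (stdAddChar ((x - α) ⬝ᵥ β) : ℂ) * v (x - α) := by
  rw [Matrix.mulVec, dotProduct, Finset.sum_eq_single (x - α)]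
  · rw [weylOdd, Matrix.of_apply, if_pos (sub_add_cancel x α).symm]
  · intro a _ ha
    have hne : x ≠ a + α := fun h => ha (by rw [h, add_sub_cancel_right])
    rw [weylOdd, Matrix.of_apply, if_neg hne, zero_mul]
  · intro h; exact absurd (mem_univ _) h

/-- **The standard basis is the common eigenbasis of the class `(0|𝟙)`**: `Z(β)|b⟩ = ω^{b·β}|b⟩`.
[cite: BandyopadhyayEtAl2002, Theorem 4.4 (“(0_m|𝟙_m)”)] -/
theorem weylOdd_zero_mulVec_basisVec (β b : Digits p n) :
    (weylOdd 0 β).mulVec (basisVec b) = (stdAddChar (b ⬝ᵥ β) : ℂ) • (basisVec b : Digits p n → ℂ) := by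
  funext x
  rw [weylOdd_mulVec_apply, sub_zero, Pi.smul_apply, smul_eq_mul]
  by_cases h : x = b
  · subst h; rfl
  · simp [basisVec, h]

/-- **The `ω_p`-quadratic basis `{v_{A,c}}_c` is the common eigenbasis of the class `(𝟙|2A)`**: for
symmetric `A` over `𝔽_p` and every `α ∈ 𝔽_pⁿ`, `X(α)Z(2Aα) v_{A,c} = ω_p^{−(αᵀAα + c·α)} v_{A,c}`.
(Our exponent `xᵀAx` is BBRV's `½·xᵀ(2A)x`: for odd `p` the map `A ↦ 2A` permutes symmetric spread
sets — `2·traceSpread(λ) = traceSpread(2λ)` — so the family of bases below is exactly the family of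
Theorem 4.4 for the spread `{2A_λ}`; for `n = 1` it is Construction I's `{ω^{ax²+bx}}`.)
[cite: BandyopadhyayEtAl2002, Theorem 4.4 (“represented by the matrices (0_m|𝟙_m), (𝟙_m|A_1), …”), Lemma 4.3] -/
theorem weylOdd_mulVec_oddQuadVec {A : Matrix (Fin n) (Fin n) (ZMod p)} (hA : A.IsSymm)
    (α c : Digits p n) :
    (weylOdd α ((2 : ZMod p) • (A *ᵥ α))).mulVec (oddQuadVec p A c) =
      (stdAddChar (-(α ⬝ᵥ (A *ᵥ α) + c ⬝ᵥ α)) : ℂ) • (oddQuadVec p A c : Digits p n → ℂ) := by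
  funext x
  rw [weylOdd_mulVec_apply, Pi.smul_apply, smul_eq_mul]
  simp only [oddQuadVec]
  have key : (x - α) ⬝ᵥ ((2 : ZMod p) • (A *ᵥ α)) + ((x - α) ⬝ᵥ (A *ᵥ (x - α)) + c ⬝ᵥ (x - α)) =
      -(α ⬝ᵥ (A *ᵥ α) + c ⬝ᵥ α) + (x ⬝ᵥ (A *ᵥ x) + c ⬝ᵥ x) := by
    have h := quadOdd_add hA c (x - α) α
    rw [sub_add_cancel] at h
    rw [dotProduct_comm (x - α) ((2 : ZMod p) • (A *ᵥ α))]
    linear_combination (-1 : ZMod p) * h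
  rw [mul_left_comm, ← AddChar.map_add_eq_mul, key, AddChar.map_add_eq_mul, mul_left_comm]

/-- **BBRV Theorem 4.4 for odd `p`, with explicit eigenbases**: a symmetric spread set `{A_λ}_{λ∈ι}` over
`𝔽_p` yields `|ι| + 1` mutually unbiased bases of `ℂ^{pⁿ}` — the standard basis and the bases
`{p^{−n/2} ω_p^{xᵀA_λx + c·x}}_c`. [cite: BandyopadhyayEtAl2002, Theorem 4.4] [cite: KlappeneckerRoetteler2005, §2 Construction I (n = 1)] -/
theorem oddSpreadMUB_isMUBFamily (hp : p ≠ 2) {ι : Type*} {A : ι → Matrix (Fin n) (Fin n) (ZMod p)}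
    (hA : IsSymmSpread A) : IsMUBFamily (oddSpreadMUB p A) where
  card_eq := rfl
  orthonormal := by
    rintro (_ | l) b b'
    · exact braket_basisVec b b'
    · exact braket_oddQuadVec_same _ b b'
  unbiased := by
    have hN : (Fintype.card (Digits p n) : ℝ) = (p : ℝ) ^ n := by
      rw [Fintype.card_fun, ZMod.card, Fintype.card_fin]; push_cast; rfl
    rintro (_ | l) (_ | m) hne b b'
    · exact absurd rfl hne
    · rw [oddSpreadMUB, oddSpreadMUB, overlapSq_basisVec_oddQuadVec, hN]
    · rw [oddSpreadMUB, oddSpreadMUB, overlapSq_comm, overlapSq_basisVec_oddQuadVec, hN]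
    · have hlm : l ≠ m := fun h => hne (by rw [h])
      rw [oddSpreadMUB, oddSpreadMUB,
        overlapSq_oddQuadVec hp (hA.symm l) (hA.symm m) (hA.regular m l (Ne.symm hlm)), hN]

/-- Hence, when the spread has `pⁿ` members, the `pⁿ(pⁿ+1)` vectors form a complex projective 2-design in
`ℂ^{pⁿ}` (Klappenecker–Rötteler Theorem 4). [cite: BandyopadhyayEtAl2002, Theorem 4.4 (ℓ = p^m)] [cite: KlappeneckerRoetteler2005, Theorem 4] -/
theorem oddSpreadMUB_isStateTwoDesign (hp : p ≠ 2) {ι : Type*} [Fintype ι] [DecidableEq ι]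
    {A : ι → Matrix (Fin n) (Fin n) (ZMod p)} (hA : IsSymmSpread A) (hι : Fintype.card ι = p ^ n) :
    IsStateTwoDesign (fun q : Option ι × Digits p n => oddSpreadMUB p A q.1 q.2) :=
  (oddSpreadMUB_isMUBFamily hp hA).isStateTwoDesign (by
    rw [Fintype.card_option, hι, Fintype.card_fun, ZMod.card, Fintype.card_fin])

/-- **A complete set of `pⁿ + 1` mutually unbiased bases of `ℂ^{pⁿ}` for every odd prime `p` and `n ≥ 1`**
(Wootters–Fields), from the trace-form spread of `𝔽_{pⁿ}`.
[cite: WoottersFields1989, (pⁿ + 1 MUBs of ℂ^{pⁿ})] [cite: BandyopadhyayEtAl2002, Theorem 4.4 with §4.3] [cite: KlappeneckerRoetteler2005, §2 Construction I (“q + 1 mutually unbiased bases of ℂ^q”, q odd prime power)] -/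
theorem traceSpread_isMUBFamily_odd (hp : p ≠ 2) (n : ℕ) (hn : n ≠ 0) :
    IsMUBFamily (oddSpreadMUB p (traceSpread p n hn)) :=
  oddSpreadMUB_isMUBFamily hp (traceSpread_isSymmSpread p n hn)

/-- **Hence, for every odd prime `p` and `n ≥ 1`, the `pⁿ(pⁿ + 1)` vectors of the complete MUB set form a
complex projective 2-design in `ℂ^{pⁿ}`** (Klappenecker–Rötteler Theorem 4 in every odd prime-power
dimension). [cite: KlappeneckerRoetteler2005, Theorem 4] [cite: WoottersFields1989, (prime-power dimensions)] [cite: BandyopadhyayEtAl2002, Theorem 4.4, §4.3] -/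
theorem traceSpread_isStateTwoDesign_odd (hp : p ≠ 2) (n : ℕ) (hn : n ≠ 0) [Fintype (GaloisField p n)]
    [DecidableEq (GaloisField p n)] :
    IsStateTwoDesign
      (fun q : Option (GaloisField p n) × Digits p n => oddSpreadMUB p (traceSpread p n hn) q.1 q.2) :=
  oddSpreadMUB_isStateTwoDesign hp (traceSpread_isSymmSpread p n hn)
    (by rw [← Nat.card_eq_fintype_card, GaloisField.card p n hn])

end OddPrimePower

/-! ### v2 — Certification lower bound (Hangleiter–Kliesch–Eisert–Gogolin Theorem 7b) for the qubit MUB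
ensembles, UNCONDITIONALLY

`CertificationSampleComplexity.twoDesign_certification_lower_bound` (Theorem 7b for an exact state
2-design) takes Valiant–Valiant's Theorem 2 lower bound as a hypothesis `VVLowerBoundAt c₂ ε P_j` on each
output distribution.  For the spread MUB ensembles the output distributions in the computational basis
are point masses (the standard basis) or UNIFORM on `𝔽₂ⁿ` (every quadratic-form vector has modulus
`2^{−n/2}`), and for both Theorem 2 is a theorem of the tree with `c₂ = 1/8`
(`vvLowerBoundAt_flatOn` for supports of even size `2ⁿ`, `n ≥ 1`; the point-mass case below from
`certification_needs_inv_eps`).  Hence Theorem 7b holds for the `2ⁿ(2ⁿ+1)` n-qubit stabilizer-MUB states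
with no unproved input. [cite: HangleiterEtAl2019, Theorem 7(b) eq. (28), Theorem 2, p. 5–8] -/

section Certification

open Certification

variable {n : ℕ}

/-- Theorem 2's lower bound for a POINT MASS, `c₂ = 1/8`: every `ε`-certification test of `δ_b` uses
`s ≥ (1/8)·max{1/ε, ‖δ_b^{−max}_{−2ε}‖_{2/3}/ε²} = 1/(8ε)` samples (the quasi-norm term vanishes once the
largest entry is removed; the `1/ε` branch is `certification_needs_inv_eps`).
[cite: HangleiterEtAl2019, Theorem 2, p. 5] [cite: ValiantValiant2017, Thm. 1 (point-mass case)] -/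
theorem vvLowerBoundAt_flatOn_singleton {E : Type*} [Fintype E] [DecidableEq E] [Nontrivial E] (b : E)
    {ε : ℝ} (hε : 0 < ε) (hε2 : ε ≤ 1 / 2) : VVLowerBoundAt (1 / 8) ε (flatOn ({b} : Finset E)) := by
  intro s T hT
  have hU0 : ∀ x, 0 ≤ flatOn ({b} : Finset E) x := flatOn_nonneg {b}
  have hU1 : ∑ x, flatOn ({b} : Finset E) x = 1 := sum_flatOn (Finset.singleton_nonempty b)
  have hs : (0 : ℝ) ≤ s := Nat.cast_nonneg s
  have h1 : 1 / (3 * ε) < (s : ℝ) := certification_needs_inv_eps (flatOn {b}) hU0 hU1 hε hε2 hT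
  have hpmax : 1 ≤ pmax (flatOn ({b} : Finset E)) := by
    have h := Finset.le_sup' (flatOn ({b} : Finset E)) (Finset.mem_univ b)
    rw [flatOn_of_mem (Finset.mem_singleton_self b), Finset.card_singleton, Nat.cast_one, div_one] at h
    exact h
  have hnorm : vvNorm (2 * ε) (flatOn ({b} : Finset E)) ≤ 0 := by
    have h := vvNorm_le (by linarith : (0 : ℝ) ≤ 2 * ε) hU0 hU1
    have hX : (0 : ℝ) ≤ (vvSupp (2 * ε) (flatOn ({b} : Finset E)) : ℝ) ^ (1 / 2 : ℝ) :=
      Real.rpow_nonneg (Nat.cast_nonneg _) _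
    nlinarith
  rw [mul_max_of_nonneg _ _ (by norm_num : (0 : ℝ) ≤ 1 / 8)]
  refine max_le ?_ ?_
  · have : (1 : ℝ) / 8 * (1 / ε) ≤ 1 / (3 * ε) := by
      rw [show (1 : ℝ) / 8 * (1 / ε) = 1 / (8 * ε) by ring]
      exact one_div_le_one_div_of_le (by positivity) (by nlinarith)
    linarith
  · have h3 : vvNorm (2 * ε) (flatOn ({b} : Finset E)) / ε ^ 2 ≤ 0 :=
      div_nonpos_iff.2 (Or.inr ⟨hnorm, by positivity⟩)
    linarith

/-- The output distribution of a computational-basis state is a point mass. [cite: HangleiterEtAl2019, §IV (P_U(S) = |⟨S|U|S0⟩|²)] -/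
theorem designDist_spreadMUB_none {ι : Type*} (A : ι → Matrix (Fin n) (Fin n) (ZMod 2)) (b : Bits n) :
    designDist (fun q : Option ι × Bits n => spreadMUB A q.1 q.2) (none, b) = flatOn ({b} : Finset (Bits n)) := by
  funext x
  simp only [designDist, spreadMUB, basisVec, flatOn, Finset.mem_singleton, Finset.card_singleton,
    Nat.cast_one, div_one]
  split_ifs <;> simp

/-- The output distribution of every quadratic-form vector `v_{Ã,c}` is UNIFORM on `𝔽₂ⁿ`
(`|v_{Ã,c}(x)|² = 2^{−n}`). [cite: BandyopadhyayEtAl2002, Theorem 4.4 (unbiasedness to the standard basis)] -/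
theorem designDist_spreadMUB_some {ι : Type*} (A : ι → Matrix (Fin n) (Fin n) (ZMod 2)) (l : ι) (c : Bits n) :
    designDist (fun q : Option ι × Bits n => spreadMUB A q.1 q.2) (some l, c) =
      flatOn (Finset.univ : Finset (Bits n)) := by
  funext x
  simp only [designDist, spreadMUB, quadVec, flatOn, Finset.mem_univ, if_true, Finset.card_univ]
  rw [Complex.normSq_mul, Complex.normSq_mul, normSq_iPow, normSq_sgnVec, mul_one, mul_one, map_pow,
    Complex.normSq_ofReal, ← mul_inv, Real.mul_self_sqrt zero_le_two, inv_pow, Fintype.card_fun, ZMod.card,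
    Fintype.card_fin, one_div]
  push_cast
  ring

open Classical in
/-- **Theorem 7b, unconditional, for the spread MUB ensembles of `n ≥ 1` qubits** (`c₂ = 1/8`,
`0 < ε ≤ 1/2`): for a symmetric spread `{A_λ}` of size `2ⁿ`, at most a `δ`-fraction of the `2ⁿ(2ⁿ+1)`
states `spreadMUB A` have an output distribution admitting an `ε`-certification test from fewer than
`(1/8)·2^{n/4}(δ/2)^{1/4}(1 − 2ε − 2^{−n/2}(δ/2)^{−1/2})^{3/2}/ε²` samples — Valiant–Valiant's Theorem 2 input
being DISCHARGED for point masses and uniform distributions. [cite: HangleiterEtAl2019, Theorem 7(b) eq. (28), p. 8] -/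
theorem spreadMUB_certification_lower_bound {ι : Type*} [Fintype ι] [DecidableEq ι]
    {A : ι → Matrix (Fin n) (Fin n) (ZMod 2)} (hA : IsSymmSpread A) (hι : Fintype.card ι = 2 ^ n)
    (hn : n ≠ 0) {ε δ : ℝ} (hε : 0 < ε) (hε2 : ε ≤ 1 / 2) (hδ : 0 < δ)
    (hfit : 2 * ε + (2 : ℝ) ^ (-Real.logb 2 (Fintype.card (Bits n)) / 2) *
      (δ / 2) ^ (-(1 / 2) : ℝ) ≤ 1) :
    ((univ.filter (fun j : Option ι × Bits n =>
        ¬ (∀ (s : ℕ) (T : (Fin s → Bits n) → Bool),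
            IsCertTest (designDist (fun q : Option ι × Bits n => spreadMUB A q.1 q.2) j) ε s T →
          (1 / 8 : ℝ) * ((2 : ℝ) ^ (Real.logb 2 (Fintype.card (Bits n)) / 4) * (δ / 2) ^ (1 / 4 : ℝ) *
            (1 - 2 * ε - (2 : ℝ) ^ (-Real.logb 2 (Fintype.card (Bits n)) / 2) *
              (δ / 2) ^ (-(1 / 2) : ℝ)) ^ (3 / 2 : ℝ)) / ε ^ 2 ≤ s))).card : ℝ) /
      (Fintype.card (Option ι × Bits n) : ℝ) ≤ δ := by
  have hcard : Fintype.card (Bits n) = 2 ^ n := by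
    rw [Fintype.card_fun, ZMod.card, Fintype.card_fin]
  haveI : Nontrivial (Bits n) := Fintype.one_lt_card_iff_nontrivial.mp
    (by rw [hcard]; exact Nat.one_lt_two_pow hn)
  refine twoDesign_certification_lower_bound (spreadMUB_isStateTwoDesign hA hι) (by norm_num) hε hδ hfit ?_
  rintro ⟨_ | l, c⟩
  · rw [designDist_spreadMUB_none]
    exact vvLowerBoundAt_flatOn_singleton c hε hε2
  · rw [designDist_spreadMUB_some]
    have hS : (Finset.univ : Finset (Bits n)).card = 2 * 2 ^ (n - 1) := by
      rw [Finset.card_univ, hcard, ← pow_succ', Nat.sub_add_cancel (Nat.one_le_iff_ne_zero.2 hn)]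
    exact vvLowerBoundAt_flatOn (by positivity) hS hε hε2

open Classical in
/-- **Theorem 7b, unconditional, for the complete n-qubit stabilizer-MUB ensemble** (`2ⁿ + 1` bases from
the trace-form spread of `𝔽_{2ⁿ}`, every `n ≥ 1`): at most a `δ`-fraction of its `2ⁿ(2ⁿ+1)` states admit an
`ε`-certification test from fewer than `(1/8)·2^{n/4}(δ/2)^{1/4}(1 − 2ε − 2^{−n/2}(δ/2)^{−1/2})^{3/2}/ε²`
computational-basis samples. [cite: HangleiterEtAl2019, Theorem 7(b) eq. (28), p. 8] [cite: BandyopadhyayEtAl2002, Theorem 4.4, §4.3] -/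
theorem traceSpread_certification_lower_bound (n : ℕ) (hn : n ≠ 0) [Fintype (GaloisField 2 n)]
    [DecidableEq (GaloisField 2 n)] {ε δ : ℝ} (hε : 0 < ε) (hε2 : ε ≤ 1 / 2) (hδ : 0 < δ)
    (hfit : 2 * ε + (2 : ℝ) ^ (-Real.logb 2 (Fintype.card (Bits n)) / 2) *
      (δ / 2) ^ (-(1 / 2) : ℝ) ≤ 1) :
    ((univ.filter (fun j : Option (GaloisField 2 n) × Bits n =>
        ¬ (∀ (s : ℕ) (T : (Fin s → Bits n) → Bool),
            IsCertTest (designDist (fun q : Option (GaloisField 2 n) × Bits n =>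
              spreadMUB (traceSpread 2 n hn) q.1 q.2) j) ε s T →
          (1 / 8 : ℝ) * ((2 : ℝ) ^ (Real.logb 2 (Fintype.card (Bits n)) / 4) * (δ / 2) ^ (1 / 4 : ℝ) *
            (1 - 2 * ε - (2 : ℝ) ^ (-Real.logb 2 (Fintype.card (Bits n)) / 2) *
              (δ / 2) ^ (-(1 / 2) : ℝ)) ^ (3 / 2 : ℝ)) / ε ^ 2 ≤ s))).card : ℝ) /
      (Fintype.card (Option (GaloisField 2 n) × Bits n) : ℝ) ≤ δ :=
  spreadMUB_certification_lower_bound (traceSpread_isSymmSpread 2 n hn)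
    (by rw [← Nat.card_eq_fintype_card, GaloisField.card 2 n hn]) hn hε hε2 hδ hfit

end Certification

/-! ### v3 — Relabelling the computational basis, and the Haar QFI value `F_Q^Haar` attained EXACTLY by
the n-qubit stabilizer-MUB ensemble (the third `IsStateTwoDesign` consumer, `CollectiveSpinVarianceBound`)

Mutual unbiasedness and the design property are invariant under relabelling the computational basis
(`V ≃ W`); in particular the qubit families transfer from `𝔽₂ⁿ = Fin n → ZMod 2` to the tree's qubit
register `Fin n → Bool`, where `CollectiveSpinVarianceBound.twoDesign_avg_qfi_collectiveZ` evaluates the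
design mean of the pure-state QFI `4(⟨J²⟩ − ⟨J⟩²)`, `J = Σ_i Ẑ_i`, to the “Haar random value”
`F_Q^Haar = 4n·2ⁿ/(2ⁿ+1)` [cite: NagaoEtAl2026, Fig. 4 caption (F_Q^Haar)] [cite: ZhuEtAl2016, §2
Proposition 1 (t = 2)].  Hence that value is attained exactly by the finite average over the
`2ⁿ(2ⁿ+1)` stabilizer-MUB states, for every `n ≥ 1` and every relabelling. -/

section Relabel

open Literature.InformationTheory.Entanglement.CollectiveVariance

variable {W : Type*} [Fintype W] [DecidableEq W]

omit [DecidableEq V] [DecidableEq W] in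
/-- Inner products are invariant under relabelling the basis. [cite: KlappeneckerRoetteler2005, §2 Definition 1 (basis-independent)] -/
theorem braket_comp_equiv (e : V ≃ W) (φ ψ : V → ℂ) :
    braket (φ ∘ e.symm) (ψ ∘ e.symm) = braket φ ψ := by
  simp only [braket, dotProduct, Function.comp_apply, Pi.star_apply]
  exact Equiv.sum_comp e.symm (fun v => star (φ v) * ψ v)

omit [DecidableEq V] [DecidableEq W] in
/-- Transition probabilities are invariant under relabelling the basis. [cite: KlappeneckerRoetteler2005, §2 Definition 1] -/
theorem overlapSq_comp_equiv (e : V ≃ W) (φ ψ : V → ℂ) :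
    overlapSq (φ ∘ e.symm) (ψ ∘ e.symm) = overlapSq φ ψ := by
  unfold overlapSq
  rw [braket_comp_equiv]

omit [DecidableEq V] [DecidableEq W] in
/-- **A family of MUBs stays a family of MUBs after relabelling the computational basis.**
[cite: KlappeneckerRoetteler2005, §2 Definition 1] -/
theorem IsMUBFamily.comp_equiv {ι κ : Type*} [Fintype κ] [DecidableEq κ] {B : ι → κ → V → ℂ}
    (hB : IsMUBFamily B) (e : V ≃ W) : IsMUBFamily (fun i a => B i a ∘ e.symm) where
  card_eq := hB.card_eq.trans (Fintype.card_congr e)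
  orthonormal := fun i a b => by rw [braket_comp_equiv]; exact hB.orthonormal i a b
  unbiased := fun i i' h a b => by rw [overlapSq_comp_equiv, ← Fintype.card_congr e]; exact hB.unbiased i i' h a b

variable {n : ℕ}

/-- The spread MUB 2-designs of `n` qubits on ANY labelling `W ≃ 𝔽₂ⁿ` of the computational basis (e.g.
the register `Fin n → Bool` via `finTwoEquiv : ZMod 2 ≃ Bool` coordinatewise).
[cite: BandyopadhyayEtAl2002, Theorem 4.4] [cite: KlappeneckerRoetteler2005, Theorem 4] -/
theorem spreadMUB_isStateTwoDesign_comp_equiv {ι : Type*} [Fintype ι] [DecidableEq ι]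
    {A : ι → Matrix (Fin n) (Fin n) (ZMod 2)} (hA : IsSymmSpread A) (hι : Fintype.card ι = 2 ^ n)
    (e : Bits n ≃ W) :
    IsStateTwoDesign (fun q : Option ι × Bits n => spreadMUB A q.1 q.2 ∘ e.symm) :=
  ((spreadMUB_isMUBFamily hA).comp_equiv e).isStateTwoDesign (by
    rw [Fintype.card_option, hι, ← Fintype.card_congr e, Fintype.card_fun, ZMod.card, Fintype.card_fin])

/-- **`F_Q^Haar` is attained exactly by the n-qubit stabilizer-MUB ensemble.** For every `n ≥ 1` and
every relabelling `e : 𝔽₂ⁿ ≃ (Fin n → Bool)` of the computational basis, the mean over the `2ⁿ(2ⁿ+1)`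
states of the complete stabilizer-MUB set of `4(⟨ψ|J²|ψ⟩ − ⟨ψ|J|ψ⟩²)`, `J = Σ_{i<n} Ẑ_i`
(`collectiveZ (Fin n)`), equals `4n·2ⁿ/(2ⁿ+1)` — the Haar random value of Nagao et al.'s eq. (9),
strictly below the separable bound `4n` (`haarValue_lt_separable_bound`).
[cite: NagaoEtAl2026, Fig. 4 caption (F_Q^Haar) and text] [cite: ZhuEtAl2016, §2 Proposition 1 (t = 2), “complete sets of mutually unbiased bases (MUB)”] -/
theorem traceSpread_avg_qfi_collectiveZ (n : ℕ) (hn : n ≠ 0) [Fintype (GaloisField 2 n)]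
    [DecidableEq (GaloisField 2 n)] (e : Bits n ≃ (Fin n → Bool)) :
    ((Fintype.card (Option (GaloisField 2 n) × Bits n) : ℂ))⁻¹ *
        ∑ j : Option (GaloisField 2 n) × Bits n,
          4 * ((proj (spreadMUB (traceSpread 2 n hn) j.1 j.2 ∘ e.symm) *
                  (collectiveZ (Fin n) * collectiveZ (Fin n))).trace -
               (proj (spreadMUB (traceSpread 2 n hn) j.1 j.2 ∘ e.symm) * collectiveZ (Fin n)).trace ^ 2) =
      4 * (n : ℂ) * (2 : ℂ) ^ n / ((2 : ℂ) ^ n + 1) := by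
  have h := twoDesign_avg_qfi_collectiveZ
    (spreadMUB_isStateTwoDesign_comp_equiv (traceSpread_isSymmSpread 2 n hn)
      (by rw [← Nat.card_eq_fintype_card, GaloisField.card 2 n hn]) e)
  rw [Fintype.card_fin, Fintype.card_fun, Fintype.card_bool, Fintype.card_fin] at h
  push_cast at h
  exact h

end Relabel

/-! ### v4 — Theorem 7b, unconditionally, for the ODD prime-power MUB ensembles too

With `CertificationSampleComplexity.vvLowerBoundAt_flatOn_two_le` (Theorem 2's lower bound for flat targets
of EVERY support size `≥ 2`, from the padded Paninski family) the odd-`pⁿ` Wootters–Fields ensembles of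
section OddPrimePower get the same hypothesis-free Theorem 7b as the qubit ensembles above: their output
distributions are point masses (standard basis) or uniform on `𝔽_pⁿ` (`|v_{A,c}(x)|² = p^{−n}`).
[cite: HangleiterEtAl2019, Theorem 7(b) eq. (28), Theorem 2, p. 5–8] -/

section CertificationOdd

open Certification ZMod

variable {p : ℕ} [Fact p.Prime] {n : ℕ}

/-- The output distribution of a standard-basis state is a point mass (odd `p`). [cite: HangleiterEtAl2019, §IV (P_U(S) = |⟨S|U|S0⟩|²)] -/
theorem designDist_oddSpreadMUB_none {ι : Type*} (A : ι → Matrix (Fin n) (Fin n) (ZMod p)) (b : Digits p n) :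
    designDist (fun q : Option ι × Digits p n => oddSpreadMUB p A q.1 q.2) (none, b) =
      flatOn ({b} : Finset (Digits p n)) := by
  funext x
  simp only [designDist, oddSpreadMUB, basisVec, flatOn, Finset.mem_singleton, Finset.card_singleton,
    Nat.cast_one, div_one]
  split_ifs <;> simp

/-- The output distribution of every `ω_p`-quadratic vector is UNIFORM on `𝔽_pⁿ` (`|v_{A,c}(x)|² = p^{−n}`).
[cite: BandyopadhyayEtAl2002, Theorem 4.4 (unbiasedness to the standard basis)] -/
theorem designDist_oddSpreadMUB_some {ι : Type*} (A : ι → Matrix (Fin n) (Fin n) (ZMod p)) (l : ι)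
    (c : Digits p n) :
    designDist (fun q : Option ι × Digits p n => oddSpreadMUB p A q.1 q.2) (some l, c) =
      flatOn (Finset.univ : Finset (Digits p n)) := by
  funext x
  simp only [designDist, oddSpreadMUB, oddQuadVec, flatOn, Finset.mem_univ, if_true, Finset.card_univ]
  rw [Complex.normSq_mul, map_pow, Complex.normSq_ofReal, stdAddChar_apply, Complex.normSq_eq_norm_sq,
    Circle.norm_coe, one_pow, mul_one, ← mul_inv, Real.mul_self_sqrt (Nat.cast_nonneg p), inv_pow,
    Fintype.card_fun, ZMod.card, Fintype.card_fin, one_div]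
  push_cast
  ring

open Classical in
/-- **Theorem 7b, unconditional, for the spread MUB ensembles in odd prime-power dimension `pⁿ`**
(`c₂ = 1/8`, `0 < ε ≤ 1/2`): for a symmetric spread `{A_λ}` of size `pⁿ` over `𝔽_p`, `p` odd, at most a
`δ`-fraction of the `pⁿ(pⁿ+1)` states `oddSpreadMUB p A` admit an `ε`-certification test from fewer than
`(1/8)·N^{1/4}(δ/2)^{1/4}(1 − 2ε − N^{−1/2}(δ/2)^{−1/2})^{3/2}/ε²` samples (`N = pⁿ`) — Theorem 2's input
DISCHARGED by `vvLowerBoundAt_flatOn_two_le` (uniform on `pⁿ ≥ 2` points) and `vvLowerBoundAt_flatOn_singleton`.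
[cite: HangleiterEtAl2019, Theorem 7(b) eq. (28), p. 8] -/
theorem oddSpreadMUB_certification_lower_bound (hp : p ≠ 2) {ι : Type*} [Fintype ι] [DecidableEq ι]
    {A : ι → Matrix (Fin n) (Fin n) (ZMod p)} (hA : IsSymmSpread A) (hι : Fintype.card ι = p ^ n)
    (hn : n ≠ 0) {ε δ : ℝ} (hε : 0 < ε) (hε2 : ε ≤ 1 / 2) (hδ : 0 < δ)
    (hfit : 2 * ε + (2 : ℝ) ^ (-Real.logb 2 (Fintype.card (Digits p n)) / 2) *
      (δ / 2) ^ (-(1 / 2) : ℝ) ≤ 1) :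
    ((univ.filter (fun j : Option ι × Digits p n =>
        ¬ (∀ (s : ℕ) (T : (Fin s → Digits p n) → Bool),
            IsCertTest (designDist (fun q : Option ι × Digits p n => oddSpreadMUB p A q.1 q.2) j) ε s T →
          (1 / 8 : ℝ) * ((2 : ℝ) ^ (Real.logb 2 (Fintype.card (Digits p n)) / 4) * (δ / 2) ^ (1 / 4 : ℝ) *
            (1 - 2 * ε - (2 : ℝ) ^ (-Real.logb 2 (Fintype.card (Digits p n)) / 2) *
              (δ / 2) ^ (-(1 / 2) : ℝ)) ^ (3 / 2 : ℝ)) / ε ^ 2 ≤ s))).card : ℝ) /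
      (Fintype.card (Option ι × Digits p n) : ℝ) ≤ δ := by
  have hcard : Fintype.card (Digits p n) = p ^ n := by
    rw [Fintype.card_fun, ZMod.card, Fintype.card_fin]
  have hp1 : 1 < p := (Fact.out : p.Prime).one_lt
  have h2 : 2 ≤ Fintype.card (Digits p n) := by
    rw [hcard]
    calc 2 ≤ p := hp1
      _ = p ^ 1 := (pow_one p).symm
      _ ≤ p ^ n := Nat.pow_le_pow_right (le_of_lt hp1) (Nat.one_le_iff_ne_zero.2 hn)
  haveI : Nontrivial (Digits p n) := Fintype.one_lt_card_iff_nontrivial.mp (by omega)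
  refine twoDesign_certification_lower_bound (oddSpreadMUB_isStateTwoDesign hp hA hι) (by norm_num) hε hδ
    hfit ?_
  rintro ⟨_ | l, c⟩
  · rw [designDist_oddSpreadMUB_none]
    exact vvLowerBoundAt_flatOn_singleton c hε hε2
  · rw [designDist_oddSpreadMUB_some]
    exact vvLowerBoundAt_flatOn_two_le (by rw [Finset.card_univ]; exact h2) hε hε2

open Classical in
/-- **Theorem 7b, unconditional, for the complete Wootters–Fields MUB set of `ℂ^{pⁿ}`** (`p` odd prime,
`n ≥ 1`; `pⁿ + 1` bases, `pⁿ(pⁿ+1)` states). [cite: HangleiterEtAl2019, Theorem 7(b) eq. (28), p. 8] [cite: WoottersFields1989, (pⁿ + 1 MUBs)] -/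
theorem traceSpread_certification_lower_bound_odd (hp : p ≠ 2) (n : ℕ) (hn : n ≠ 0)
    [Fintype (GaloisField p n)] [DecidableEq (GaloisField p n)] {ε δ : ℝ} (hε : 0 < ε) (hε2 : ε ≤ 1 / 2)
    (hδ : 0 < δ)
    (hfit : 2 * ε + (2 : ℝ) ^ (-Real.logb 2 (Fintype.card (Digits p n)) / 2) *
      (δ / 2) ^ (-(1 / 2) : ℝ) ≤ 1) :
    ((univ.filter (fun j : Option (GaloisField p n) × Digits p n =>
        ¬ (∀ (s : ℕ) (T : (Fin s → Digits p n) → Bool),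
            IsCertTest (designDist (fun q : Option (GaloisField p n) × Digits p n =>
              oddSpreadMUB p (traceSpread p n hn) q.1 q.2) j) ε s T →
          (1 / 8 : ℝ) * ((2 : ℝ) ^ (Real.logb 2 (Fintype.card (Digits p n)) / 4) * (δ / 2) ^ (1 / 4 : ℝ) *
            (1 - 2 * ε - (2 : ℝ) ^ (-Real.logb 2 (Fintype.card (Digits p n)) / 2) *
              (δ / 2) ^ (-(1 / 2) : ℝ)) ^ (3 / 2 : ℝ)) / ε ^ 2 ≤ s))).card : ℝ) /
      (Fintype.card (Option (GaloisField p n) × Digits p n) : ℝ) ≤ δ :=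
  oddSpreadMUB_certification_lower_bound hp (traceSpread_isSymmSpread p n hn)
    (by rw [← Nat.card_eq_fintype_card, GaloisField.card p n hn]) hn hε hε2 hδ hfit

end CertificationOdd

end Literature.Computability.QuantumComplexity.MutuallyUnbiasedBases
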